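/-
Copyright: statement-level skeleton of a published paper (lit-balaban cell, Phase-2 proof seat p39 gen 23). No proof claims
beyond what the kernel checks below.
-/
import Literature.MathematicalPhysics.QuantumFieldTheory.Balaban1983to89.B3BilinearWick
import Literature.MathematicalPhysics.QuantumFieldTheory.Balaban1983to89.B3Eq122FirstOrderWick
import Literature.MathematicalPhysics.QuantumFieldTheory.Balaban1983to89.B3WT226FreeGaussian

/-!
# Bałaban, *(Higgs)₂,₃ quantum fields in a finite volume. III*, CMP 88 (1983) [Balaban1983Higgs3], p. 416: THE ORDER-e² TERMS
# ② `e²dC^ε(0)q²δ^ε(x−x′)` AND ④ `−e²Σ_μ q(∂^ε_μC^ε_0∂^{ε*}_μ)(x−x′)qC^ε(x−x′)` OF (1.22), DERIVED BY WICK'S THEOREM FROM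
# (1.19)/(1.20) — the second charge-derivative of the two-point function at `e = 0` on the model torus, the vector field
# integrated in the Feynman gauge, and its dictionary to p26's typed `B3Eq123Counterterms.sig2` / `sig4`

statement-level skeleton of published theorems with citation tags; proofs where landed; nothing here is a claim about the
Yang–Mills mass gap.

[cite: Balaban1983Higgs3, (1.19)–(1.22) p.416 (PDF 6); (1.8), (1.10) p.413 (PDF 3)].  Unit `lit-balaban-p39-g23` (Phase-2 proof
seat p39, gen 23), free-target protocol G.5-34(d), zero head weight: BRICK 7 of the optional target named in r15 g15's HEAD
QUESTION 25 — row **B3.Eq1.19-1.22** of `HOME/lit-balaban-r15/ROWS-B3.md` (owner r15, head `proved` on the owner path), (1.22)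
cell, OPTIONAL LOCATED MEMBER; the successor brick this seat's gen 22 named («the e-direction of (1.22), needs an A-field
Gaussian»); TAKING HOME/STATUS 2026-08-23T12:35:20Z, p33 g72 12:49:10Z «NO OVERLAP — go ahead».  Sibling bricks (disjoint):
BRICK 1 `B3Eq122FirstOrderWick` (this seat, gen 22: the `e = 0` sector, orders λ, λ² — IMPORTED for its carrier conventions only),
BRICK 2 `B3Eq121OnePIChains` (p32), BRICK 3 `B3OnePIGraphs` (p37), BRICKS 4–6 `B3TwoPointPerturbativeCoefficients` /
`B3Eq119ChargeOrders` (p33: the coefficients to all orders as truncated expectations on the `HiggsLattice` carrier; the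
STRUCTURAL origin of the order treated here is p33's `B3Eq119ChargeOrders.coefX_eq_pow_mul` /
`iteratedDerivWithin_totalFamily_zero_eq` — types (1.8)_{1,0}², (1.8)_{2,0}, (1.10)_{2,0} at n̄ ≥ 2 —, cited by name, not
imported; that file evaluates no Gaussian integral, this file proves no all-orders structure).

PDF held: `paper:balaban1983-higgs-2-3-quantum-fields-finite-volume` (journal page = PDF page + 410); pp. 413, 416 read on the ×2
renders `run/shared/lean/pub/pub-balaban/b2b-balaban-ref1/pages/1983-cmp88-higgs23-III/1983-cmp88-higgs23-III-p003-x2.png`,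
`…-p006-x2.png`; [Balaban1982Higgs1] pp. 604–605 (the lattice fields, `A_{⟨x,x+εe_μ⟩} = A_μ(x)`, `U(A) = exp(qεeA)`, the Feynman
gauge (1.11)) as vendored in `LatticeFieldCalculus` / `HiggsLattice`.

THE PRINTED TEXT (verbatim, p. 416).  *"G^ε_{ab}(x,x′) = ⟨φ_a(x)φ_b(x′)⟩^ε = (Z^ε)^{−1}∫dA∫dφ e^{−S^ε(A,φ)}φ_a(x)φ_b(x′), x, x′ ∈
T_ε, (1.19) where S^ε(A,φ) is the lattice action of the model given by S^ε(A,φ) = ½⟨φ,(−Δ^ε_A + m²)φ⟩ + Σ_{x∈T_ε}ε^d(λ∣φ(x)∣⁴ +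
½δm²∣φ(x)∣²) + ½⟨A,(−Δ^ε + μ₀²)A⟩, (1.20) … G^ε = Σ_{n=0}^∞ C₀^ε[(−δm² + Σ^ε + ∂^{ε*}Σ₁^ε + Σ₁^{ε*}∂^ε + ∂^{ε*}Σ₂^ε∂^ε)C₀^ε]ⁿ,
(1.21) where C₀^ε = (−Δ₀^ε + m²)^{−1} and Σ^ε, Σ₁^ε, Σ₂^ε are given by amputated, one-particle-irreducible graphs of the expansion
of G^ε. … Σ^ε(x−x′) = −4(N+2)λC^ε_0(0)δ^ε(x−x′) + e²dC^ε(0)q²δ^ε(x−x′) + … − e²Σ_{μ=1}^d q(∂^ε_μC^ε_0∂^{ε*}_μ)(x−x′)qC^ε(x−x′) + …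
(1.22) Here we did not write, and we will not write in the future, combinatoric factors before the graphs"* (the terms are
numbered ①–⑦ in p26's `B3Eq123Counterterms`; ② and ④ are the two of order exactly `e²λ⁰`).  P. 413: the vertices of the
expansion in `A` of `½⟨φ,(−Δ^ε_A+m²)φ⟩`, among them (1.8)_{1,0} `−eΣ_bε^d⟨∂^εφ(b),qφ(b₋)⟩A_b`, (1.8)_{2,0}
`½e²εΣ_bε^d⟨∂^εφ(b),q²φ(b₋)⟩A_b²` and (1.10)_{2,0} `½e²Σ_bε^d⟨φ(b₋),q²φ(b₋)⟩A_b²` (signs/orientations as vendored in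
`HiggsLattice`; this file re-derives what it uses from `U = exp(qηeA)`, see `quadForm_eq`, `D1_zero_eq_vertex18`).

THE SETTING (this seat's gen-13…22 Gaussian calculus; print `ε` = the mesh `η` of the model torus `T^{(j)}_η`, `η^d` = the
volume element `w`, `c = η⁻¹` inside `∂^η`).  Scalar fields `φ : T → ℝ^N` (`B3WT223Instance.Cfg P j N`); THE VECTOR FIELD IN
COMPONENTS `A : T → ℝ^d` (`Cfg P j P.d`) with bond values `A_b = ⟪A(b₋), e_{μ_b}⟫` (`toVec`; B1 p. 604 *"A_{⟨x,x+εe_μ⟩} =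
A_μ(x)"*); the charge `e` a VARIABLE with the model's antisymmetric `q` (`Ce C e`, `U(ηeA_b) = exp(ηeA_b·q)`); the joint weight
`J_e(A,φ) = e^{−½⟨A,(−Δ^η+μ²)A⟩}·e^{−½⟨φ,(−Δ^η_{A,e}+m²)φ⟩}` on the product Lebesgue space (`J`, `WA` = this seat's scalar Gaussian
`B3WT223Instance.weight` on `d`-component fields at zero vector field = the Feynman-gauge vector Gaussian, componentwise
`(−Δ^η+μ²)`), and `G_{e,ab}(x,x′) = ∫J_eφ_a(x)φ_b(x′)/∫J_e` (`twoPt`) — (1.19) with the action (1.20) at `λ = δm² = 0` (the terms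
②, ④ are of order `e²λ⁰(δm²)⁰`, so nothing of them is lost) in the Feynman gauge; §8 `J_eq_exp_neg_feynmanHiggsAction`: `J_e =
exp(−S)` with `S` = r15's typed Feynman-gauge action `LatticeFieldCalculus.feynmanHiggsAction` (B1 (1.11)) at `λ = E = 0`.
Propagators `C₀ = C^η_{m²} = B3WTPropagator.G w c m2`, `C^ε = C^η_{μ²} = G w c μ2` (the vector covariance:
`⟨A_bA_{b′}⟩ = δ_{μ_bμ_{b′}}C^ε(b₋,b′₋)`, `integral_WA_toVec_toVec`).  Hypotheses throughout: `η^d > 0`, `m² > 0`, `μ² > 0`; any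
level `j`, mesh, dimension `d`, number of components `N`.

WHAT THIS FILE PROVES (theorems; the definitions are the objects just listed plus the insertions `D1`, `D2`, the bounds `K0`,
`K1`, `K2`, the hopping term `hop`, the legs `legs`, the bracket `Bk`, the companion attachments `att`; no definition of record
is redeclared; no named fact; no `sorry`; standard axioms).
* §1 **THE CHARGE ENTERS ONLY THROUGH THE HOPPING TERMS** (`quadForm_eq`: `⟨φ,(−Δ^η_A+m²)φ⟩ = K₀(φ) − 2Σ_bη^dc²⟪φ(b₋),U(ηeA_b)φ(b₊)⟫`,
  unitarity of `U`), and the `e`-DERIVATIVES OF THE WEIGHT (`hasDerivAt_U`, `hasDerivAt_hop`, `hasDerivAt_weight`,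
  `hasDerivAt_D1_mul_weight`): `∂_e e^{−S_e} = D₁(e)e^{−S_e}`, `∂_e(D₁e^{−S_e}) = D₂(e)e^{−S_e}` with the insertions
  `D₁(e) = Σ_bη^dc²·ηA_b⟪φ(b₋),qU(ηeA_b)φ(b₊)⟫`, `D₂(e) = Σ_bη^dc²(ηA_b)²⟪φ(b₋),q²Uφ(b₊)⟫ + D₁(e)²`.
* §2–§3 **DIFFERENTIATION UNDER `∫dA∫dφ`** at EVERY charge `e₀` (`hasDerivAt_integral_J_mul`, `hasDerivAt_integral_D1_J_mul`;
  bounds `abs_D1_le`, `abs_D2_le` uniform in `e` — `|U| = 1` —, majorant `integrable_majorant` =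
  (polynomial·Gaussian in `A`)×(exp-linear·Gaussian in `φ`) via `weight ≤` the `A`-free Gaussian (`B3WT223Instance.weight_le_gauss`)
  and `Integrable.mul_prod`; Mathlib's `hasDerivAt_integral_of_dominated_loc_of_deriv_le`).
* §4 **AT `e = 0` THE MEASURE FACTORIZES** (`J_zero`, `integral_prod_WA_W0` — Fubini) into the vector Gaussian and the free scalar
  Gaussian; `D1_zero_eq_vertex18`: `D₁(0) = −(cη)Σ_bη^d⟪∂^ηφ(b),qφ(b₋)⟫A_b` — the cubic vertex (1.8)_{1,0} per unit `e` up to the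
  convention-dependent overall sign (it enters below only squared); the vector moments `⟨A_b⟩ = 0`, `⟨A_bA_{b′}⟩ = δ_{μμ′}C^ε(b₋,b′₋)` (`integral_WA_toVec`, `integral_WA_toVec_toVec`,
  from this seat's `B3WTCovariance.moment2` at `N := d`); hence **`G′_{ab}(0) = 0`** (`integral_D1_J_zero`,
  `hasDerivAt_twoPt_zero`: one vector leg against the even Gaussian).
* §5 **WICK'S THEOREM FOR THE ORDER-e² VERTICES AGAINST THE TWO LEGS** on the free scalar Gaussian (engines: this seat's
  `B3WickVertexCalculus.ibp_site`, `B3WTCovariance.moment2(_op)`, `B3BilinearWick`): `integral_legs_mul` (both legs contracted: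
  `∫W₀φ_a(x)φ_b(x′)R = C₀(x′,x)δ_{ab}∫W₀R + ∫W₀D_{h′}D_hR`), `integral_legs_cur` (a current `⟪φ(y),Qφ(y′)⟫` against the legs: loop
  `C₀(y,y′)trQ` × free line + the two connected attachments), `integral_legs_cur_cur` (two currents against the legs: the
  bubble × free line, loop × attachments, and the EIGHT connected terms — which end of each current takes which leg).
* §6 **SECOND-ORDER PERTURBATION THEORY IN THE CHARGE** (`hasDerivAt_twoPt` at every `e`; `hasDerivAt_deriv_twoPt_zero`,
  `iteratedDeriv_two_twoPt`: `G″(0) = (N″(0)Z(0) − N(0)Z″(0))/Z(0)²` with `N″(0) = ∫D₂(0)J₀φ_aφ_b`, `Z″(0) = ∫D₂(0)J₀`;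
  `integral_D2_J_zero`: the `A`-integrals done, `∫D₂(0)J₀F = Z_A[Σ_bη^dc²η²C^ε(b₋,b₋)∫W₀⟪φ(b₋),q²φ(b₊)⟫F +
  Σ_{b,b′:μ=μ′}(η^dc²η)²C^ε(b₋,b′₋)∫W₀⟪φ(b₋),qφ(b₊)⟫⟪φ(b′₋),qφ(b′₊)⟫F]`), and the conclusion **`iteratedDeriv_two_twoPt_eq_wick`:
  `d²/de²|₀G_{ab}(x,x′) = ⟪e_a,q²e_b⟫·[Σ_bη^dc²η²C^ε(b₋,b₋)(C₀(b₋,x)C₀(b₊,x′) + C₀(b₊,x)C₀(b₋,x′)) +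
  Σ_{b,b′:μ=μ′}(η^dc²η)²C^ε(b₋,b′₋)(Bk(b,b′;x,x′) + Bk(b,b′;x′,x))]`** — EVERY DISCONNECTED PIECE CANCELS in `(N″Z − NZ″)/Z²`
  (the vacuum bubble `tr q²·C₀(b₋,b₊)` of the quartic vertex and the current–current bubbles: never evaluated, they drop out
  identically), the `tr q = 0` loops vanish (this seat's `B3WT226FreeGaussian.trE_q`; `adjoint_q`: `q* = −q`), and the charge structure FACTORS as the matrix
  element `(q²)_{ab}` (`inner_q_q`, `inner_qq_comm`); `Bk` = the four-propagator bracket of the two cubic vertices with one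
  external leg each (four attachments, signs from `q* = −q`).
* §7 **THE PRINT'S FORM AND THE DICTIONARY TO p26's TYPED ② AND ④** at `c·η = 1` (`c = ε⁻¹`): bonds as (initial point, direction)
  (`sum_bond`, `sum_bond_bond_dir`), the legs-exchanged half equals the direct half (`Bk_swap`, `sum_Bk_swap`: all kernels
  symmetric), `sq_mul_Bk_eq`: **`c²·Bk(⟨y,μ⟩,⟨y′,μ⟩;u,v) = att_μ(y,y′;u,v) − C₀(y,u)C₀(y′,v)·dKernel c μ C₀ y y′`** with r15's
  `B3Sect3ScalarSelfEnergy.dKernel` = `(∂^ε_μC₀∂^{ε*}_μ)(y,y′)` (the print's ④ pattern: both external legs on the undifferentiated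
  fields, both derivatives on the internal line) and `att` = the three companion attachments in r15's `d1Kernel = ∂^ε_μC₀`
  vocabulary (an external leg on the differentiated field `∂^ηφ(b)` of (1.8)_{1,0}); and the conclusion
  **`secondOrder_eq_C0_sig24_C0`**: for p26's (1.22)-data `D : SEData` with `D.C0 = C₀`, `D.C = C^ε`, `D.e = e`, `D.q2 = (q²)_{ab}`,
  `D.w = η^d`, `D.c = c`,
  **`(e²/2)·d²/de²|₀G_{ab}(x,x′) = Σ_{y,y′}η^{2d}C₀(x,y)[sig2 D + sig4 D](y,y′)C₀(y′,x′) + e²(q²)_{ab}·[(η/2)Σ_{y,μ}η^dC^ε(y,y)(C₀(y,x)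
  (∂^ε_μC₀)(y,x′) + (∂^ε_μC₀)(y,x)C₀(y,x′)) + Σ_{y,y′,μ}η^{2d}C^ε(y,y′)att_μ(y,y′;x,x′)]`** — p26 typed ② `sig2 = e²dC^ε(0)q²δ^ε`
  (`C^ε(0)` = the diagonal value `C^ε(y,y)`, `δ^ε = η^{−d}𝟙`) and ④ `sig4 = −e²Σ_μq²·dKernel·C^ε` AS PRINTED; here `C₀[② + ④]C₀` is
  a theorem about the measure (1.19)/(1.20): print's factor `d` of ② is `Σ_μ 1` over the directions of the bonds at `y`, the
  `δ_{μμ′}`/`Σ_μ` of ④ is the Feynman-gauge vector covariance, the sign of ④ and the absence of any further combinatoric factor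
  are confirmed by the kernel.  THE TWO REMAINING TERMS are exhibited, not estimated: (i) `(η/2)Σ…` is the tadpole of the
  vertex (1.8)_{2,0} (the quartic term of `U(ηeA_b)` has its two fields at the two ENDS of the bond: `⟪φ(b₋),q²φ(b₊)⟫ =
  ⟪φ(b₋),q²φ(b₋)⟫ + η⟪φ(b₋),q²∂^ηφ(b)⟫`; one explicit factor `η = ε`, as printed in (1.8)_{2,0}); (ii) `Σ…att` are the graphs of
  two vertices (1.8)_{1,0} with an external leg contracted into a differentiated field.  Both carry a lattice derivative `∂^ε` on
  at least one EXTERNAL propagator — the shape of the insertions `∂^{ε*}Σ₁^ε`, `Σ₁^{ε*}∂^ε` (one) and `∂^{ε*}Σ₂^ε∂^ε` (two) of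
  (1.21), whose kernels the paper does not display; this file does not define `Σ₁^ε`, `Σ₂^ε` and makes no claim about which
  grouping the paper intends for them, nor about the size of (i), (ii).
* §8 `quadForm_Cvec_eq`, **`J_eq_exp_neg_feynmanHiggsAction`** (the dictionary of the measure, above).
v1.1 (same seat and gen, APPEND-ONLY after v1.0's last declaration `J_eq_exp_neg_feynmanHiggsAction`, §9–§10):
* §9 **THE STRUCTURE (1.21) AT ORDER e² WITH DERIVED KERNELS** (`sgOne`, `sgTwo`, **`secondOrder_eq_structure121`**): the companions
  (i), (ii) of §7 REGROUPED by where the external `∂^ε` sits — `(e²/2)·d²/de²|₀G_{ab}(x,x′) = Σ_{y,y′}η^{2d}C₀(x,y)Σ(y,y′)C₀(y′,x′) +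
  Σ_{y,y′}Σ_μη^{2d}[(∂_μC₀)(y,x)·Σ₁,μ(y,y′)·C₀(y′,x′) + C₀(x,y)·Σ₁,μ(y′,y)·(∂_μC₀)(y′,x′) + (∂_μC₀)(y,x)·Σ₂(y,y′)·(∂_μC₀)(y′,x′)]` with
  `Σ = sig2 D + sig4 D` (② + ④, p26), **`Σ₁,μ(y,y′) = e²q²[(η/2)C^ε(y,y)δ^ε(y−y′) + (C₀∂^{ε*}_μ)(y,y′)C^ε(y,y′)]`** (`sgOne`: the tadpole of
  (1.8)_{2,0}, local, plus the cubic pair with the internal line differentiated once) and **`Σ₂(y,y′) = −e²q²C₀(y,y′)C^ε(y,y′)`** (`sgTwo`: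
  the cubic pair with both external legs on the differentiated fields), `(∂_μC₀) = d1Kernel c μ C₀` (r15).
* §10 **(1.21) AT ORDER e² AS OPERATORS** (**`secondOrder_structure121_op`**; lemmas `sum_G_mul_pdiffAdj` = summation by parts
  `LatticeFieldCalculus.sum_pdiff_mul` against the symmetric `C₀`, r15's `B3Sect3ScalarSelfEnergy.kernelOp_d1Kernel`): in r15's
  vocabulary (`kernelOp η^d K` = the integral operator of (3.9), `pdiff`/`pdiffAdj` = `∂^η_μ`/`∂^{η*}_μ`), for every test function `f`,
  **`kernelOp η^d [(e²/2)G″_{ab}(0)] f = C₀[Σ + Σ_μ(∂^{η*}_μ Σ₁,μ + Σ₁,μ^* ∂^η_μ + ∂^{η*}_μ Σ₂ ∂^η_μ)]C₀ f`** (`Σ₁,μ^*` = the transposed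
  kernel) — the `n = 1` term `C₀^ε[(−δm² + Σ^ε + ∂^{ε*}Σ₁^ε + Σ₁^{ε*}∂^ε + ∂^{ε*}Σ₂^ε∂^ε)C₀^ε]` of (1.21) at order `e²λ⁰(δm²)⁰`, with its
  three kinds of self-energy insertions, DERIVED from (1.19)/(1.20) by Gaussian integration (r15's row disclosure «(1.21) typed as the
  printed Dyson structure for SUPPLIED self-energies — NOT derived from (1.19)» now has a derived instance at this order; `∂^{ε*}Σ₁^ε`
  read as `Σ_μ∂^{ε*}_μΣ^ε_{1,μ}`, which the paper's notation leaves implicit). No claim that these `Σ₁,μ`, `Σ₂` are the paper's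
  (undisplayed) kernels beyond this order-e² identity, nor about one-particle irreducibility (at this order each is one connected
  graph with two amputated legs).  `twoPt_zero`: the `n = 0` term `G_{0,ab} = C₀δ_{ab}` and `d/de|₀G = 0`, so the degree-two Taylor
  polynomial of (1.19) in `e` at `0` is (1.21) through `n = 1` at order `e²`.
HONEST SCOPE.  Order `e²` at `e = 0` only, `λ = δm² = 0` (so: ② and ④; NOT ③ `e⁴`, ⑤ `e⁴`, ⑦ `e²δm²`, nor the mixed `e²λ`
graphs; ① and ⑥ are BRICK 1); the two-point function as a function of the one real variable `e` (Mathlib's `iteratedDeriv`; no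
joint `(e,λ)`-Taylor statement, no all-orders statement — those are BRICKS 4–6 and 2–3); Feynman gauge as the definition of the
`A`-integral (the gauge-fixing of B1 (1.11) is taken as given, not derived from (1.20)'s `½⟨A,(−Δ^ε+μ₀²)A⟩` on forms); no claim on
`Σ₁^ε`, `Σ₂^ε` beyond exhibiting the terms (i), (ii) and (v1.1) regrouping them into the (1.21) pattern with the explicit kernels `sgOne`,
`sgTwo`; no continuum or `ε → 0` statement.  Mathlib + the cited tree files only.

References: [Balaban1983Higgs3] T. Bałaban, CMP 88 (1983) 411–445, (1.8)/(1.10) p. 413, (1.19)–(1.22) p. 416; [Balaban1982Higgs1]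
T. Bałaban, CMP 85 (1982) 603–626, (1.4), (1.7)–(1.8), (1.11) pp. 604–605; [GlimmJaffeQP1987] J. Glimm, A. Jaffe, *Quantum Physics*
(2nd ed., Springer 1987), §8.2–8.5, Prop. 8.3.1, (9.1.5) (Gaussian integration by parts / Wick's theorem / Feynman graphs /
perturbation series).
-/

noncomputable section

open scoped BigOperators InnerProductSpace Topology

namespace Literature.MathematicalPhysics.QuantumFieldTheory.Balaban1983to89.B3Eq122ChargeWick

open _root_.MeasureTheory _root_.Filter
open LatticeFieldCalculus B3WT223Instance B3WTPropagator B3WTCovariance B3WickVertexCalculus B3BilinearWick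
  B3Eq123Counterterms

variable {P : Params} {j N : ℕ} (C : HiggsLattice.ChargeData N) (η w c m2 : ℝ)

/-! ## §0 The charge as a variable; the vector field in components -/

/-- The charge data of the model with the coupling `e` as a VARIABLE and the same antisymmetric charge matrix `q` (B1 (1.7):
`U(A) = exp(qεeA)`): the two-point function (1.19) is studied as a function of `e`. [cite: Balaban1983Higgs3, (1.19) p.416] -/
def Ce (e : ℝ) : HiggsLattice.ChargeData N := ⟨e, C.q, C.q_skew, C.norm_q_le⟩

/-- `(Ce e).U(A) = exp(qηeA)`. [cite: Balaban1982Higgs1, (1.7) p.605] -/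
theorem Ce_U (e a : ℝ) : (Ce C e).U η a = NormedSpace.exp ((η * e * a) • C.q) := rfl

/-- at `e = 0` the representation is trivial, `U ≡ 1`. [cite: Balaban1982Higgs1, (1.7) p.605] -/
theorem Ce_U_zero (a : ℝ) : (Ce C 0).U η a = 1 := by
  rw [Ce_U, mul_zero, zero_mul, zero_smul ℝ C.q, NormedSpace.exp_zero]

/-- Trivial charge data for a `d`-component real field (charge `0`, `q = 0`): the Feynman-gauge vector-field Gaussian of (1.20) is
the `A = 0` instance of this seat's scalar Gaussian weight on `d`-component site fields, which needs SOME charge datum as a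
parameter (it does not enter at `A = 0`). [cite: Balaban1983Higgs3, (1.20) p.416] -/
def Cvec (d : ℕ) : HiggsLattice.ChargeData d :=
  ⟨0, 0, by rw [ContinuousLinearMap.star_eq_adjoint, LinearIsometryEquiv.map_zero, neg_zero], by rw [norm_zero]; exact zero_le_one⟩

/-- THE VECTOR FIELD IN COMPONENTS.  Print ([Balaban1982Higgs1] p. 604): *"A_{⟨x, x+εe_μ⟩} = A_μ(x)"* — a vector field on the
positively oriented bonds is a `d`-component site field `A : T → ℝ^d`; its value on the bond `⟨x, x + ηe_μ⟩` is the `μ`-th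
component `⟪A(x), e_μ⟫`. [cite: Balaban1982Higgs1, (1.4) p.604] -/
def toVec (A : Cfg P j P.d) : VecField P j ℝ := fun b => ⟪A b.src, EuclideanSpace.basisFun (Fin P.d) ℝ b.dir⟫_ℝ

/-- unfolding. [cite: Balaban1982Higgs1, (1.4) p.604] -/
theorem toVec_apply (A : Cfg P j P.d) (b : PBond P j) :
    toVec A b = ⟪A b.src, EuclideanSpace.basisFun (Fin P.d) ℝ b.dir⟫_ℝ := rfl

/-- `|A_b| ≤ sup|A|`. [folklore] -/
private theorem abs_toVec_le (A : Cfg P j P.d) (b : PBond P j) : |toVec A b| ≤ ‖A‖ := by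
  rw [toVec_apply]
  calc |⟪A b.src, EuclideanSpace.basisFun (Fin P.d) ℝ b.dir⟫_ℝ|
      ≤ ‖A b.src‖ * ‖EuclideanSpace.basisFun (Fin P.d) ℝ b.dir‖ := abs_real_inner_le_norm _ _
    _ = ‖A b.src‖ := by rw [(EuclideanSpace.basisFun (Fin P.d) ℝ).orthonormal.1, mul_one]
    _ ≤ ‖A‖ := norm_le_pi_norm A b.src

/-! ## §1 The quadratic form at charge `e`, its `e`-derivatives -/

/-- the e-independent part of `⟨φ,(−Δ^η_A+M²)φ⟩`: `Σ_b η^d c²(|φ(b₊)|² + |φ(b₋)|²) + M²Σ_xη^d|φ(x)|²`. [cite: Balaban1983Higgs3, (1.20) p.416] -/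
def K0 (φ : Cfg P j N) : ℝ :=
  (∑ b : PBond P j, w * (c ^ 2 * (‖φ b.tgt‖ ^ 2 + ‖φ b.src‖ ^ 2))) + m2 * massForm w φ

/-- the hopping term of the bond `b`: `u_b(e) = ⟪φ(b₋), U(ηeA_b)φ(b₊)⟫`. [cite: Balaban1983Higgs3, (1.20) p.416] -/
def hop (e : ℝ) (A : VecField P j ℝ) (φ : Cfg P j N) (b : PBond P j) : ℝ :=
  ⟪φ b.src, (Ce C e).U η (A b) (φ b.tgt)⟫_ℝ

/-- **`⟨φ,(−Δ^η_A+M²)φ⟩ = K₀(φ) − 2Σ_b η^dc²⟪φ(b₋),U(ηeA_b)φ(b₊)⟫`** (unitarity of `U`: `|Uφ(b₊) − φ(b₋)|² = |φ(b₊)|² + |φ(b₋)|² −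
2⟪φ(b₋),Uφ(b₊)⟫`) — the charge enters the action (1.20) only through the hopping terms. [cite: Balaban1983Higgs3, (1.20) p.416] -/
theorem quadForm_eq (e : ℝ) (A : VecField P j ℝ) (φ : Cfg P j N) :
    quadForm (Ce C e) η w c m2 A φ = K0 w c m2 φ - 2 * ∑ b : PBond P j, w * (c ^ 2 * hop C η e A φ b) := by
  unfold quadForm K0 covLaplaceForm
  have hb : ∀ b : PBond P j, w * ‖covDerivScalar c ((Ce C e).Urep η) A φ b‖ ^ 2
      = w * (c ^ 2 * (‖φ b.tgt‖ ^ 2 + ‖φ b.src‖ ^ 2)) - 2 * (w * (c ^ 2 * hop C η e A φ b)) := by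
    intro b
    simp only [covDerivScalar, HiggsLattice.ChargeData.Urep_apply, hop]
    rw [norm_smul, mul_pow, Real.norm_eq_abs, sq_abs, norm_sub_sq_real,
      ContinuousLinearMap.norm_map_of_mem_unitary ((Ce C e).U_mem_unitary η (A b)), real_inner_comm (φ b.src)]
    ring
  rw [Finset.sum_congr rfl fun b _ => hb b, Finset.sum_sub_distrib, Finset.mul_sum]
  ring

/-- `d/de U(ηea)v = ηa·qU(ηea)v`. [cite: Balaban1982Higgs1, (1.7) p.605] -/
theorem hasDerivAt_U (a : ℝ) (v : EuclideanSpace ℝ (Fin N)) (e : ℝ) :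
    HasDerivAt (fun s : ℝ => (Ce C s).U η a v) ((η * a) • C.q ((Ce C e).U η a v)) e := by
  have hθ : HasDerivAt (fun s : ℝ => η * s * a) (η * a) e := by
    have h := ((hasDerivAt_id e).const_mul η).mul_const a
    simpa using h
  have hexp : HasDerivAt (fun u : ℝ => NormedSpace.exp (u • C.q))
      (C.q * NormedSpace.exp ((η * e * a) • C.q)) (η * e * a) :=
    hasDerivAt_exp_smul_const' C.q _
  have hcomp := hexp.scomp e hθ
  have happ := ((ContinuousLinearMap.apply ℝ (EuclideanSpace ℝ (Fin N)) v).hasFDerivAt).comp_hasDerivAt e hcomp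
  simpa [Ce_U, Function.comp_def] using happ

/-- `d/de ⟪u, Q U(ηea)v⟫ = ηa·⟪u, Q q U(ηea)v⟫` for a fixed operator `Q`. [cite: Balaban1982Higgs1, (1.7) p.605] -/
theorem hasDerivAt_inner_Q_U (Q : EuclideanSpace ℝ (Fin N) →L[ℝ] EuclideanSpace ℝ (Fin N)) (a : ℝ)
    (u v : EuclideanSpace ℝ (Fin N)) (e : ℝ) :
    HasDerivAt (fun s : ℝ => ⟪u, Q ((Ce C s).U η a v)⟫_ℝ) ((η * a) * ⟪u, Q (C.q ((Ce C e).U η a v))⟫_ℝ) e := by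
  have h1 := (Q.hasFDerivAt.comp_hasDerivAt e (hasDerivAt_U C η a v e))
  have h2 : HasDerivAt (fun s : ℝ => ⟪u, Q ((Ce C s).U η a v)⟫_ℝ) (⟪u, Q ((η * a) • C.q ((Ce C e).U η a v))⟫_ℝ) e :=
    (hasDerivAt_const e u).inner ℝ h1 |>.congr_deriv (by simp)
  refine h2.congr_deriv ?_
  rw [map_smul, real_inner_smul_right]

/-- `d/de u_b(e) = ηA_b⟪φ(b₋), qUφ(b₊)⟫`. [cite: Balaban1983Higgs3, (1.20) p.416] -/
theorem hasDerivAt_hop (A : VecField P j ℝ) (φ : Cfg P j N) (b : PBond P j) (e : ℝ) :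
    HasDerivAt (fun s : ℝ => hop C η s A φ b) ((η * A b) * ⟪φ b.src, C.q ((Ce C e).U η (A b) (φ b.tgt))⟫_ℝ) e := by
  have h := hasDerivAt_inner_Q_U C η (1 : EuclideanSpace ℝ (Fin N) →L[ℝ] EuclideanSpace ℝ (Fin N)) (A b) (φ b.src)
    (φ b.tgt) e
  simpa [hop] using h

/-- THE FIRST-DERIVATIVE INSERTION `D₁(e; A, φ) = Σ_b η^dc²·ηA_b·⟪φ(b₋), qU(ηeA_b)φ(b₊)⟫` — minus the `e`-derivative of the action
`½⟨φ,(−Δ^η_A+m²)φ⟩`; at `e = 0` it is the cubic vertex (1.8)_{1,0} summed over the bonds (up to sign). [cite: Balaban1983Higgs3, (1.8) p.413] -/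
def D1 (e : ℝ) (A : VecField P j ℝ) (φ : Cfg P j N) : ℝ :=
  ∑ b : PBond P j, w * (c ^ 2 * ((η * A b) * ⟪φ b.src, C.q ((Ce C e).U η (A b) (φ b.tgt))⟫_ℝ))

/-- THE SECOND-DERIVATIVE INSERTION `D₂(e; A, φ) = Σ_b η^dc²·η²A_b²·⟪φ(b₋), q²U(ηeA_b)φ(b₊)⟫ + D₁(e; A, φ)²` (at `e = 0`: the
quartic vertex (1.8)_{2,0}+(1.10)_{2,0} in its unitarity form, plus the square of the cubic one). [cite: Balaban1983Higgs3, (1.10) p.413] -/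
def D2 (e : ℝ) (A : VecField P j ℝ) (φ : Cfg P j N) : ℝ :=
  (∑ b : PBond P j, w * (c ^ 2 * ((η * A b) ^ 2 * ⟪φ b.src, C.q (C.q ((Ce C e).U η (A b) (φ b.tgt)))⟫_ℝ)))
    + D1 C η w c e A φ ^ 2

/-- **`d/de e^{−½⟨φ,(−Δ^η_A+m²)φ⟩} = D₁·e^{−½⟨φ,(−Δ^η_A+m²)φ⟩}`**. [cite: Balaban1983Higgs3, (1.20) p.416] -/
theorem hasDerivAt_weight (A : VecField P j ℝ) (φ : Cfg P j N) (e : ℝ) :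
    HasDerivAt (fun s : ℝ => weight (Ce C s) η w c m2 A φ)
      (D1 C η w c e A φ * weight (Ce C e) η w c m2 A φ) e := by
  have hsum : HasDerivAt (fun s : ℝ => ∑ b : PBond P j, w * (c ^ 2 * hop C η s A φ b)) (D1 C η w c e A φ) e := by
    unfold D1
    refine HasDerivAt.fun_sum fun b _ => ?_
    exact ((hasDerivAt_hop C η A φ b e).const_mul (c ^ 2)).const_mul w
  have hq : HasDerivAt (fun s : ℝ => -(1 / 2 : ℝ) * quadForm (Ce C s) η w c m2 A φ)
      (-(1 / 2 : ℝ) * (0 - 2 * D1 C η w c e A φ)) e := by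
    simp_rw [quadForm_eq]
    exact ((hasDerivAt_const e _).sub (hsum.const_mul 2)).const_mul _
  have hexp := hq.exp
  unfold weight
  refine hexp.congr_deriv ?_
  ring

/-- `d/de D₁ = Σ_b η^dc²η²A_b²⟪φ(b₋),q²Uφ(b₊)⟫`. [cite: Balaban1983Higgs3, (1.10) p.413] -/
theorem hasDerivAt_D1 (A : VecField P j ℝ) (φ : Cfg P j N) (e : ℝ) :
    HasDerivAt (fun s : ℝ => D1 C η w c s A φ)
      (∑ b : PBond P j, w * (c ^ 2 * ((η * A b) ^ 2 * ⟪φ b.src, C.q (C.q ((Ce C e).U η (A b) (φ b.tgt)))⟫_ℝ))) e := by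
  unfold D1
  refine HasDerivAt.fun_sum fun b _ => ?_
  have h := ((hasDerivAt_inner_Q_U C η C.q (A b) (φ b.src) (φ b.tgt) e).const_mul (η * A b)).const_mul (c ^ 2) |>.const_mul w
  refine h.congr_deriv ?_
  ring

/-- **`d/de (D₁·W) = D₂·W`**: the second `e`-derivative of the weight. [cite: Balaban1983Higgs3, (1.20) p.416] -/
theorem hasDerivAt_D1_mul_weight (A : VecField P j ℝ) (φ : Cfg P j N) (e : ℝ) :
    HasDerivAt (fun s : ℝ => D1 C η w c s A φ * weight (Ce C s) η w c m2 A φ)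
      (D2 C η w c e A φ * weight (Ce C e) η w c m2 A φ) e := by
  have h := (hasDerivAt_D1 C η w c A φ e).mul (hasDerivAt_weight C η w c m2 A φ e)
  refine h.congr_deriv ?_
  unfold D2
  ring

/-! ## §2 Bounds uniform in the charge and in the vector field -/

omit C in
/-- `|⟪u, Qv⟫| ≤ ‖Q‖·|u||v|`. [folklore] -/
private theorem abs_inner_op_le (Q : EuclideanSpace ℝ (Fin N) →L[ℝ] EuclideanSpace ℝ (Fin N)) (u v : EuclideanSpace ℝ (Fin N)) :
    |⟪u, Q v⟫_ℝ| ≤ ‖Q‖ * (‖u‖ * ‖v‖) := by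
  calc |⟪u, Q v⟫_ℝ| ≤ ‖u‖ * ‖Q v‖ := abs_real_inner_le_norm _ _
    _ ≤ ‖u‖ * (‖Q‖ * ‖v‖) := mul_le_mul_of_nonneg_left (Q.le_opNorm v) (norm_nonneg _)
    _ = ‖Q‖ * (‖u‖ * ‖v‖) := by ring

/-- `|⟪φ(b₋), qUφ(b₊)⟫| ≤ |φ(b₋)||φ(b₊)|` (`‖q‖ ≤ 1`, `U` unitary). [cite: Balaban1982Higgs1, (1.7) p.605] -/
theorem abs_inner_qU_le (e a : ℝ) (u v : EuclideanSpace ℝ (Fin N)) :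
    |⟪u, C.q ((Ce C e).U η a v)⟫_ℝ| ≤ ‖u‖ * ‖v‖ := by
  have h := abs_inner_op_le C.q u ((Ce C e).U η a v)
  rw [ContinuousLinearMap.norm_map_of_mem_unitary ((Ce C e).U_mem_unitary η a)] at h
  exact h.trans (mul_le_of_le_one_left (by positivity) C.norm_q_le)

/-- `|⟪φ(b₋), q²Uφ(b₊)⟫| ≤ |φ(b₋)||φ(b₊)|`. [cite: Balaban1982Higgs1, (1.7) p.605] -/
theorem abs_inner_qqU_le (e a : ℝ) (u v : EuclideanSpace ℝ (Fin N)) :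
    |⟪u, C.q (C.q ((Ce C e).U η a v))⟫_ℝ| ≤ ‖u‖ * ‖v‖ := by
  have h := abs_inner_op_le (C.q.comp C.q) u ((Ce C e).U η a v)
  rw [ContinuousLinearMap.norm_map_of_mem_unitary ((Ce C e).U_mem_unitary η a)] at h
  have hqq : ‖C.q.comp C.q‖ ≤ 1 :=
    (ContinuousLinearMap.opNorm_comp_le _ _).trans (by nlinarith [C.norm_q_le, norm_nonneg C.q])
  exact (le_of_eq (by rfl)).trans (h.trans (mul_le_of_le_one_left (by positivity) hqq))

/-- the constant `K₁ = Σ_b η^dc²|η|` of the first-derivative bound. [folklore] -/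
def K1 (P : Params) (j : ℕ) (η w c : ℝ) : ℝ := ∑ _b : PBond P j, |w| * (c ^ 2 * |η|)

/-- the constant `K₂ = Σ_b η^dc²η²` of the second-derivative bound. [folklore] -/
def K2 (P : Params) (j : ℕ) (η w c : ℝ) : ℝ := ∑ _b : PBond P j, |w| * (c ^ 2 * η ^ 2)

omit C in
/-- `K₁ ≥ 0`. [folklore] -/
private theorem K1_nonneg : 0 ≤ K1 P j η w c := Finset.sum_nonneg fun _ _ => by positivity

omit C in
/-- `K₂ ≥ 0`. [folklore] -/
private theorem K2_nonneg : 0 ≤ K2 P j η w c := Finset.sum_nonneg fun _ _ => by positivity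

/-- **`|D₁(e; A, φ)| ≤ K₁·sup_b|A_b|·sup|φ|²`**, uniformly in `e`. [cite: Balaban1983Higgs3, (1.8) p.413] -/
theorem abs_D1_le (e : ℝ) (A : VecField P j ℝ) (φ : Cfg P j N) {a : ℝ} (hA : ∀ b, |A b| ≤ a) :
    |D1 C η w c e A φ| ≤ K1 P j η w c * (a * ‖φ‖ ^ 2) := by
  unfold D1 K1
  rw [Finset.sum_mul]
  refine (Finset.abs_sum_le_sum_abs _ _).trans (Finset.sum_le_sum fun b _ => ?_)
  have ha : 0 ≤ a := (abs_nonneg _).trans (hA b)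
  rw [abs_mul, abs_mul, abs_mul, abs_mul, abs_of_nonneg (sq_nonneg c)]
  have h1 := abs_inner_qU_le C η e (A b) (φ b.src) (φ b.tgt)
  have h2 : ‖φ b.src‖ * ‖φ b.tgt‖ ≤ ‖φ‖ ^ 2 := by
    rw [sq]; exact mul_le_mul (norm_le_pi_norm φ _) (norm_le_pi_norm φ _) (norm_nonneg _) (norm_nonneg _)
  calc |w| * (c ^ 2 * (|η| * |A b| * |⟪φ b.src, C.q ((Ce C e).U η (A b) (φ b.tgt))⟫_ℝ|))
      ≤ |w| * (c ^ 2 * (|η| * a * ‖φ‖ ^ 2)) :=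
        mul_le_mul_of_nonneg_left (mul_le_mul_of_nonneg_left (mul_le_mul (mul_le_mul_of_nonneg_left (hA b) (abs_nonneg η))
          (h1.trans h2) (abs_nonneg _) (mul_nonneg (abs_nonneg η) ha)) (sq_nonneg c)) (abs_nonneg w)
    _ = |w| * (c ^ 2 * |η|) * (a * ‖φ‖ ^ 2) := by ring

/-- **`|D₂(e; A, φ)| ≤ K₂·a²·sup|φ|² + K₁²a²sup|φ|⁴`** for `|A_b| ≤ a`, uniformly in `e`. [cite: Balaban1983Higgs3, (1.10) p.413] -/
theorem abs_D2_le (e : ℝ) (A : VecField P j ℝ) (φ : Cfg P j N) {a : ℝ} (hA : ∀ b, |A b| ≤ a) :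
    |D2 C η w c e A φ| ≤ K2 P j η w c * (a ^ 2 * ‖φ‖ ^ 2) + (K1 P j η w c * (a * ‖φ‖ ^ 2)) ^ 2 := by
  unfold D2
  refine (abs_add_le _ _).trans (add_le_add ?_ ?_)
  · unfold K2
    rw [Finset.sum_mul]
    refine (Finset.abs_sum_le_sum_abs _ _).trans (Finset.sum_le_sum fun b _ => ?_)
    rw [abs_mul, abs_mul, abs_mul, abs_of_nonneg (sq_nonneg c)]
    have h1 := abs_inner_qqU_le C η e (A b) (φ b.src) (φ b.tgt)
    have h2 : ‖φ b.src‖ * ‖φ b.tgt‖ ≤ ‖φ‖ ^ 2 := by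
      rw [sq]; exact mul_le_mul (norm_le_pi_norm φ _) (norm_le_pi_norm φ _) (norm_nonneg _) (norm_nonneg _)
    have h3 : |(η * A b) ^ 2| ≤ η ^ 2 * a ^ 2 := by
      rw [abs_of_nonneg (sq_nonneg _), mul_pow]
      exact mul_le_mul_of_nonneg_left (by rw [← sq_abs]; exact pow_le_pow_left₀ (abs_nonneg _) (hA b) 2) (sq_nonneg _)
    calc |w| * (c ^ 2 * (|(η * A b) ^ 2| * |⟪φ b.src, C.q (C.q ((Ce C e).U η (A b) (φ b.tgt)))⟫_ℝ|))
        ≤ |w| * (c ^ 2 * (η ^ 2 * a ^ 2 * ‖φ‖ ^ 2)) :=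
          mul_le_mul_of_nonneg_left (mul_le_mul_of_nonneg_left (mul_le_mul h3 (h1.trans h2) (abs_nonneg _) (by positivity))
            (sq_nonneg c)) (abs_nonneg w)
      _ = |w| * (c ^ 2 * η ^ 2) * (a ^ 2 * ‖φ‖ ^ 2) := by ring
  · rw [abs_pow, ← sq_abs, sq_abs]
    exact pow_le_pow_left₀ (abs_nonneg _) (abs_D1_le C η w c e A φ hA) 2


/-! ## §3 The joint Gaussian of (1.19)/(1.20) at `λ = δm² = 0` on the product space `(A, φ)`; differentiation under `∫dA∫dφ` -/

section Joint

variable (μ2 : ℝ)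

/-- the joint configurations `(A, φ)`: `A : T → ℝ^d` (vector field in components), `φ : T → ℝ^N`. [cite: Balaban1983Higgs3, (1.19) p.416] -/
abbrev JCfg (P : Params) (j N : ℕ) : Type := Cfg P j P.d × Cfg P j N

/-- **the Feynman-gauge vector-field Gaussian `e^{−½⟨A,(−Δ^η+μ₀²)A⟩}` of (1.20)** — `⟨A,−Δ^ηA⟩ = Σ_μ⟨A_μ,−Δ^ηA_μ⟩` acts
componentwise ([Balaban1982Higgs1] p. 605), so it is this seat's scalar Gaussian weight for the `d`-component site field `A` at zero
background. [cite: Balaban1983Higgs3, (1.20) p.416] -/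
def WA (A : Cfg P j P.d) : ℝ := weight (Cvec P.d) η w c μ2 (0 : VecField P j ℝ) A

omit C m2 in
/-- the vector-field weight is positive. [cite: Balaban1983Higgs3, (1.20) p.416] -/
theorem WA_pos (A : Cfg P j P.d) : 0 < WA η w c μ2 A := weight_pos _ _

/-- **the joint weight `e^{−S^ε(A,φ)}` of (1.19) at `λ = δm² = 0` and charge `e`**:
`exp[−½⟨φ,(−Δ^η_A+m²)φ⟩ − ½⟨A,(−Δ^η+μ₀²)A⟩]` with `U(A_b) = exp(qηeA_b)` in `Δ^η_A`. [cite: Balaban1983Higgs3, (1.19)–(1.20) p.416] -/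
def J (e : ℝ) (p : JCfg P j N) : ℝ := WA η w c μ2 p.1 * weight (Ce C e) η w c m2 (toVec p.1) p.2

/-- **(1.19) at `λ = δm² = 0` AS A FUNCTION OF THE CHARGE `e`**:
`G_{e,ab}(x,x′) = (Z^ε_e)^{−1}∫dA∫dφ e^{−S^ε_e(A,φ)}φ_a(x)φ_b(x′)`. [cite: Balaban1983Higgs3, (1.19) p.416] -/
def twoPt (e : ℝ) (a b : Fin N) (x x' : Site P j) : ℝ :=
  (∫ p : JCfg P j N, J C η w c m2 μ2 e p *
      (⟪p.2 x, EuclideanSpace.basisFun (Fin N) ℝ a⟫_ℝ * ⟪p.2 x', EuclideanSpace.basisFun (Fin N) ℝ b⟫_ℝ)) /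
    ∫ p : JCfg P j N, J C η w c m2 μ2 e p

/-- continuity of `(a, v) ↦ U(ηea)v` jointly. [folklore] -/
private theorem continuous_U_apply₂ (e : ℝ) {X : Type*} [TopologicalSpace X] {f : X → ℝ} {g : X → EuclideanSpace ℝ (Fin N)}
    (hf : Continuous f) (hg : Continuous g) : Continuous fun x => (Ce C e).U η (f x) (g x) := by
  letI : NormedAlgebra ℚ (EuclideanSpace ℝ (Fin N) →L[ℝ] EuclideanSpace ℝ (Fin N)) := NormedAlgebra.restrictScalars ℚ ℝ _
  have hU : Continuous fun x => (Ce C e).U η (f x) := by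
    simp only [Ce_U]
    exact NormedSpace.exp_continuous.comp (((continuous_const.mul hf)).smul continuous_const)
  exact isBoundedBilinearMap_apply.continuous.comp (hU.prodMk hg)

/-- continuity of `(A, φ) ↦ u_b(e; A, φ)`. [folklore] -/
private theorem continuous_hop (e : ℝ) (b : PBond P j) :
    Continuous fun p : JCfg P j N => hop C η e (toVec p.1) p.2 b := by
  unfold hop
  refine ((continuous_apply b.src).comp continuous_snd).inner (continuous_U_apply₂ C η e ?_ ?_)
  · exact ((continuous_apply b.src).comp continuous_fst).inner continuous_const
  · exact (continuous_apply b.tgt).comp continuous_snd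

/-- continuity of the joint weight. [folklore] -/
private theorem continuous_J (e : ℝ) : Continuous fun p : JCfg P j N => J C η w c m2 μ2 e p := by
  have h1 : Continuous fun p : JCfg P j N => WA η w c μ2 p.1 :=
    (B3WT224Instance.continuous_weight (Cvec P.d) η w c μ2 _).comp continuous_fst
  have h2 : Continuous fun p : JCfg P j N => weight (Ce C e) η w c m2 (toVec p.1) p.2 := by
    have e2 : (fun p : JCfg P j N => weight (Ce C e) η w c m2 (toVec p.1) p.2) =
        fun p => Real.exp (-(1 / 2 : ℝ) * (K0 w c m2 p.2 - 2 * ∑ b : PBond P j, w * (c ^ 2 * hop C η e (toVec p.1) p.2 b))) := by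
      funext p; rw [weight, quadForm_eq]
    rw [e2]
    refine (continuous_const.mul ((?_ : Continuous fun p : JCfg P j N => K0 w c m2 p.2).sub
      (continuous_const.mul (continuous_finsetSum _ fun b _ => continuous_const.mul
        (continuous_const.mul (continuous_hop C η e b)))))).rexp
    unfold K0 massForm
    refine Continuous.add (continuous_finsetSum _ fun b _ => continuous_const.mul (continuous_const.mul
      ((((continuous_apply b.tgt).comp continuous_snd).norm.pow 2).add
        (((continuous_apply b.src).comp continuous_snd).norm.pow 2)))) (continuous_const.mul
      (continuous_finsetSum _ fun x _ => continuous_const.mul (((continuous_apply x).comp continuous_snd).norm.pow 2)))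
  exact h1.mul h2

/-- continuity of `(A, φ) ↦ D₁(e; A, φ)`. [folklore] -/
private theorem continuous_D1 (e : ℝ) : Continuous fun p : JCfg P j N => D1 C η w c e (toVec p.1) p.2 := by
  unfold D1
  refine continuous_finsetSum _ fun b _ => continuous_const.mul (continuous_const.mul
    ((continuous_const.mul (((continuous_apply b.src).comp continuous_fst).inner continuous_const)).mul
      (((continuous_apply b.src).comp continuous_snd).inner (C.q.continuous.comp (continuous_U_apply₂ C η e
        (((continuous_apply b.src).comp continuous_fst).inner continuous_const) ((continuous_apply b.tgt).comp continuous_snd))))))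

/-- continuity of `(A, φ) ↦ D₂(e; A, φ)`. [folklore] -/
private theorem continuous_D2 (e : ℝ) : Continuous fun p : JCfg P j N => D2 C η w c e (toVec p.1) p.2 := by
  unfold D2
  refine (continuous_finsetSum _ fun b _ => continuous_const.mul (continuous_const.mul
    (((continuous_const.mul (((continuous_apply b.src).comp continuous_fst).inner continuous_const)).pow 2).mul
      (((continuous_apply b.src).comp continuous_snd).inner (C.q.continuous.comp (C.q.continuous.comp
        (continuous_U_apply₂ C η e (((continuous_apply b.src).comp continuous_fst).inner continuous_const)
          ((continuous_apply b.tgt).comp continuous_snd)))))))).add ((continuous_D1 C η w c e).pow 2)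

/-- the Gaussian majorant of the scalar weight, uniform in the charge and the vector field:
`e^{−½⟨φ,(−Δ^η_A+m²)φ⟩} ≤ e^{−(m²η^d/2)Σ_x|φ(x)|²}`. [cite: Balaban1983Higgs3, (1.20) p.416] -/
theorem weight_Ce_le (hw : 0 ≤ w) (e : ℝ) (A : VecField P j ℝ) (φ : Cfg P j N) :
    weight (Ce C e) η w c m2 A φ ≤ Real.exp (-(m2 * w / 2) * ∑ x : Site P j, ‖φ x‖ ^ 2) :=
  weight_le_gauss hw A φ

omit C η w c m2 in
/-- `t ≤ e^t`. [folklore] -/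
private theorem le_exp_self (t : ℝ) : t ≤ Real.exp t := by linarith [Real.add_one_le_exp t]

omit C η w c m2 in
/-- `t² ≤ e^{2t}` for `t ≥ 0`. [folklore] -/
private theorem sq_le_exp_two_mul {t : ℝ} (ht : 0 ≤ t) : t ^ 2 ≤ Real.exp (2 * t) := by
  have h := le_exp_self t
  calc t ^ 2 ≤ Real.exp t ^ 2 := pow_le_pow_left₀ ht h 2
    _ = Real.exp (2 * t) := by rw [← Real.exp_nat_mul]; norm_num

/-- the product majorant `Φ_κ(A, φ) = [W_A(A)e^{2 sup|A|}]·[e^{κ sup|φ|}e^{−(m²η^d/2)Σ|φ|²}]` is integrable on the product space.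
[cite: Balaban1983Higgs3, (1.19) p.416] -/
theorem integrable_majorant (hw : 0 < w) (hm : 0 < m2) (hμ : 0 < μ2) (κ : ℝ) :
    Integrable (fun p : JCfg P j N => (WA η w c μ2 p.1 * Real.exp (2 * ‖p.1‖)) *
      (Real.exp (κ * ‖p.2‖) * Real.exp (-(m2 * w / 2) * ∑ x : Site P j, ‖p.2 x‖ ^ 2))) := by
  have hA : Integrable (fun A : Cfg P j P.d => WA η w c μ2 A * Real.exp (2 * ‖A‖)) :=
    ExpGrowth.integrable (Cvec P.d) η w c μ2 hw hμ
      ⟨(continuous_const.mul continuous_norm).rexp, 1, 2, zero_le_one, by norm_num,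
        fun A => by rw [abs_of_pos (Real.exp_pos _), one_mul]⟩
  have hφ := B3WT224Instance.integrable_explin_mul_gauss (P := P) (j := j) (N := N) κ (half_pos (mul_pos hm hw))
  have hφ' : Integrable (fun φ : Cfg P j N => Real.exp (κ * ‖φ‖) * Real.exp (-(m2 * w / 2) * ∑ x : Site P j, ‖φ x‖ ^ 2)) := by
    refine hφ.congr (Filter.Eventually.of_forall fun φ => ?_)
    show Real.exp (κ * ‖φ‖) * Real.exp (-(m2 * w / 2) * ∑ x : Site P j, ‖φ x‖ ^ 2) =
      Real.exp (κ * ‖φ‖) * Real.exp (-(m2 * w / 2) * ∑ x : Site P j, ‖φ x‖ ^ 2)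
    rfl
  have h := hA.mul_prod hφ'
  rw [← Measure.volume_eq_prod] at h
  exact h

/-- **integrability of `e^{−S_e}·F`** on the product space for observables `F` of the scalar field of exponential-linear growth.
[cite: Balaban1983Higgs3, (1.19) p.416] -/
theorem integrable_J_mul (hw : 0 < w) (hm : 0 < m2) (hμ : 0 < μ2) {F : Cfg P j N → ℝ} (hF : ExpGrowth F) (e : ℝ) :
    Integrable (fun p : JCfg P j N => J C η w c m2 μ2 e p * F p.2) := by
  obtain ⟨hFc, K, κ, hK, hκ, hFb⟩ := hF
  refine ((integrable_majorant (P := P) (j := j) (N := N) η w c m2 μ2 hw hm hμ κ).const_mul K).mono'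
    (((continuous_J C η w c m2 μ2 e).mul (hFc.comp continuous_snd)).aestronglyMeasurable)
    (Filter.Eventually.of_forall fun p => ?_)
  rw [Real.norm_eq_abs, abs_mul, J, abs_mul, abs_of_pos (WA_pos η w c μ2 p.1), abs_of_pos (weight_pos _ _)]
  have hWA : 0 ≤ WA η w c μ2 p.1 := (WA_pos η w c μ2 p.1).le
  have h1 : weight (Ce C e) η w c m2 (toVec p.1) p.2 ≤ Real.exp (-(m2 * w / 2) * ∑ x : Site P j, ‖p.2 x‖ ^ 2) :=
    weight_Ce_le C η w c m2 hw.le e _ _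
  have h2 : (1 : ℝ) ≤ Real.exp (2 * ‖p.1‖) := Real.one_le_exp (by positivity)
  calc WA η w c μ2 p.1 * weight (Ce C e) η w c m2 (toVec p.1) p.2 * |F p.2|
      ≤ WA η w c μ2 p.1 * Real.exp (-(m2 * w / 2) * ∑ x : Site P j, ‖p.2 x‖ ^ 2) * (K * Real.exp (κ * ‖p.2‖)) :=
        mul_le_mul (mul_le_mul_of_nonneg_left h1 hWA) (hFb p.2) (abs_nonneg _) (by positivity)
    _ = K * ((WA η w c μ2 p.1 * 1) * (Real.exp (κ * ‖p.2‖) * Real.exp (-(m2 * w / 2) * ∑ x : Site P j, ‖p.2 x‖ ^ 2))) := by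
        ring
    _ ≤ K * ((WA η w c μ2 p.1 * Real.exp (2 * ‖p.1‖)) *
          (Real.exp (κ * ‖p.2‖) * Real.exp (-(m2 * w / 2) * ∑ x : Site P j, ‖p.2 x‖ ^ 2))) := by
        gcongr

/-- **DIFFERENTIATION UNDER `∫dA∫dφ` IN THE CHARGE**: `d/de ∫ e^{−S_e}F = ∫ D₁(e)e^{−S_e}F` at every `e₀` — dominated
differentiation with the product majorant `K₁K_F·Φ_{κ+2}` (`|D₁| ≤ K₁ sup|A| sup|φ|²`, uniform in `e`).
[cite: Balaban1983Higgs3, (1.19)–(1.21) p.416] -/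
theorem hasDerivAt_integral_J_mul (hw : 0 < w) (hm : 0 < m2) (hμ : 0 < μ2) {F : Cfg P j N → ℝ} (hF : ExpGrowth F) (e₀ : ℝ) :
    Integrable (fun p : JCfg P j N => D1 C η w c e₀ (toVec p.1) p.2 * J C η w c m2 μ2 e₀ p * F p.2) ∧
    HasDerivAt (fun e => ∫ p : JCfg P j N, J C η w c m2 μ2 e p * F p.2)
      (∫ p : JCfg P j N, D1 C η w c e₀ (toVec p.1) p.2 * J C η w c m2 μ2 e₀ p * F p.2) e₀ := by
  obtain ⟨hFc, K, κ, hK, hκ, hFb⟩ := id hF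
  have hbound := (integrable_majorant (P := P) (j := j) (N := N) η w c m2 μ2 hw hm hμ (κ + 2)).const_mul (K1 P j η w c * K)
  refine hasDerivAt_integral_of_dominated_loc_of_deriv_le (F := fun e p => J C η w c m2 μ2 e p * F p.2)
    (F' := fun e p => D1 C η w c e (toVec p.1) p.2 * J C η w c m2 μ2 e p * F p.2) Filter.univ_mem
    (Filter.Eventually.of_forall fun e => ((continuous_J C η w c m2 μ2 e).mul (hFc.comp continuous_snd)).aestronglyMeasurable)
    (integrable_J_mul C η w c m2 μ2 hw hm hμ hF e₀)
    ((((continuous_D1 C η w c e₀).mul (continuous_J C η w c m2 μ2 e₀)).mul (hFc.comp continuous_snd)).aestronglyMeasurable)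
    (Filter.Eventually.of_forall fun p e _ => ?_) hbound (Filter.Eventually.of_forall fun p e _ => ?_)
  · -- the bound
    rw [Real.norm_eq_abs, abs_mul, abs_mul, J, abs_mul, abs_of_pos (WA_pos η w c μ2 p.1), abs_of_pos (weight_pos _ _)]
    have hWA : 0 ≤ WA η w c μ2 p.1 := (WA_pos η w c μ2 p.1).le
    have hD := abs_D1_le C η w c e (toVec p.1) p.2 (a := ‖p.1‖) (abs_toVec_le p.1)
    have h1 : weight (Ce C e) η w c m2 (toVec p.1) p.2 ≤ Real.exp (-(m2 * w / 2) * ∑ x : Site P j, ‖p.2 x‖ ^ 2) :=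
      weight_Ce_le C η w c m2 hw.le e _ _
    have h3 : ‖p.1‖ ≤ Real.exp (2 * ‖p.1‖) := (le_exp_self _).trans (Real.exp_le_exp.mpr (by linarith [norm_nonneg p.1]))
    have h4 : ‖p.2‖ ^ 2 * Real.exp (κ * ‖p.2‖) ≤ Real.exp ((κ + 2) * ‖p.2‖) := by
      rw [add_mul, Real.exp_add, mul_comm]
      exact mul_le_mul_of_nonneg_left (sq_le_exp_two_mul (norm_nonneg _)) (Real.exp_pos _).le
    have hX1 : 0 ≤ WA η w c μ2 p.1 * weight (Ce C e) η w c m2 (toVec p.1) p.2 := mul_nonneg hWA (weight_pos _ _).le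
    have hX2 : 0 ≤ K1 P j η w c * (‖p.1‖ * ‖p.2‖ ^ 2) := mul_nonneg (K1_nonneg η w c) (by positivity)
    have hX3 : 0 ≤ K1 P j η w c * (‖p.1‖ * ‖p.2‖ ^ 2) *
        (WA η w c μ2 p.1 * Real.exp (-(m2 * w / 2) * ∑ x : Site P j, ‖p.2 x‖ ^ 2)) :=
      mul_nonneg hX2 (mul_nonneg hWA (Real.exp_pos _).le)
    calc |D1 C η w c e (toVec p.1) p.2| * (WA η w c μ2 p.1 * weight (Ce C e) η w c m2 (toVec p.1) p.2) * |F p.2|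
        ≤ (K1 P j η w c * (‖p.1‖ * ‖p.2‖ ^ 2)) *
            (WA η w c μ2 p.1 * Real.exp (-(m2 * w / 2) * ∑ x : Site P j, ‖p.2 x‖ ^ 2)) * (K * Real.exp (κ * ‖p.2‖)) :=
          mul_le_mul (mul_le_mul hD (mul_le_mul_of_nonneg_left h1 hWA) hX1 hX2) (hFb p.2) (abs_nonneg _) hX3
      _ = K1 P j η w c * K * ((WA η w c μ2 p.1 * ‖p.1‖) * ((‖p.2‖ ^ 2 * Real.exp (κ * ‖p.2‖)) *
            Real.exp (-(m2 * w / 2) * ∑ x : Site P j, ‖p.2 x‖ ^ 2))) := by ring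
      _ ≤ K1 P j η w c * K * ((WA η w c μ2 p.1 * Real.exp (2 * ‖p.1‖)) * (Real.exp ((κ + 2) * ‖p.2‖) *
            Real.exp (-(m2 * w / 2) * ∑ x : Site P j, ‖p.2 x‖ ^ 2))) := by
          have hK1 := K1_nonneg (P := P) (j := j) η w c
          gcongr
  · -- pointwise derivative
    have h := ((hasDerivAt_weight C η w c m2 (toVec p.1) p.2 e).const_mul (WA η w c μ2 p.1)).mul_const (F p.2)
    simp only [J]
    refine h.congr_deriv ?_
    ring

/-- **THE SECOND DIFFERENTIATION UNDER `∫dA∫dφ`**: `d/de ∫ D₁(e)e^{−S_e}F = ∫ D₂(e)e^{−S_e}F` at every `e₀`.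
[cite: Balaban1983Higgs3, (1.19)–(1.21) p.416] -/
theorem hasDerivAt_integral_D1_J_mul (hw : 0 < w) (hm : 0 < m2) (hμ : 0 < μ2) {F : Cfg P j N → ℝ} (hF : ExpGrowth F)
    (e₀ : ℝ) :
    Integrable (fun p : JCfg P j N => D2 C η w c e₀ (toVec p.1) p.2 * J C η w c m2 μ2 e₀ p * F p.2) ∧
    HasDerivAt (fun e => ∫ p : JCfg P j N, D1 C η w c e (toVec p.1) p.2 * J C η w c m2 μ2 e p * F p.2)
      (∫ p : JCfg P j N, D2 C η w c e₀ (toVec p.1) p.2 * J C η w c m2 μ2 e₀ p * F p.2) e₀ := by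
  obtain ⟨hFc, K, κ, hK, hκ, hFb⟩ := id hF
  have hbound := (integrable_majorant (P := P) (j := j) (N := N) η w c m2 μ2 hw hm hμ (κ + 4)).const_mul
    ((K2 P j η w c + K1 P j η w c ^ 2) * K)
  refine hasDerivAt_integral_of_dominated_loc_of_deriv_le
    (F := fun e p => D1 C η w c e (toVec p.1) p.2 * J C η w c m2 μ2 e p * F p.2)
    (F' := fun e p => D2 C η w c e (toVec p.1) p.2 * J C η w c m2 μ2 e p * F p.2) Filter.univ_mem
    (Filter.Eventually.of_forall fun e => (((continuous_D1 C η w c e).mul (continuous_J C η w c m2 μ2 e)).mul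
      (hFc.comp continuous_snd)).aestronglyMeasurable)
    (hasDerivAt_integral_J_mul C η w c m2 μ2 hw hm hμ hF e₀).1
    ((((continuous_D2 C η w c e₀).mul (continuous_J C η w c m2 μ2 e₀)).mul (hFc.comp continuous_snd)).aestronglyMeasurable)
    (Filter.Eventually.of_forall fun p e _ => ?_) hbound (Filter.Eventually.of_forall fun p e _ => ?_)
  · rw [Real.norm_eq_abs, abs_mul, abs_mul, J, abs_mul, abs_of_pos (WA_pos η w c μ2 p.1), abs_of_pos (weight_pos _ _)]
    have hWA : 0 ≤ WA η w c μ2 p.1 := (WA_pos η w c μ2 p.1).le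
    have hD := abs_D2_le C η w c e (toVec p.1) p.2 (a := ‖p.1‖) (abs_toVec_le p.1)
    have h1 : weight (Ce C e) η w c m2 (toVec p.1) p.2 ≤ Real.exp (-(m2 * w / 2) * ∑ x : Site P j, ‖p.2 x‖ ^ 2) :=
      weight_Ce_le C η w c m2 hw.le e _ _
    have hA2 : ‖p.1‖ ^ 2 ≤ Real.exp (2 * ‖p.1‖) := sq_le_exp_two_mul (norm_nonneg _)
    have hφ2 : ‖p.2‖ ^ 2 ≤ Real.exp (4 * ‖p.2‖) :=
      (sq_le_exp_two_mul (norm_nonneg _)).trans (Real.exp_le_exp.mpr (by linarith [norm_nonneg p.2]))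
    have hφ4 : (‖p.2‖ ^ 2) ^ 2 ≤ Real.exp (4 * ‖p.2‖) := by
      calc (‖p.2‖ ^ 2) ^ 2 ≤ Real.exp (2 * ‖p.2‖) ^ 2 := pow_le_pow_left₀ (sq_nonneg _) (sq_le_exp_two_mul (norm_nonneg _)) 2
        _ = Real.exp (4 * ‖p.2‖) := by rw [← Real.exp_nat_mul]; ring_nf
    have hD' : |D2 C η w c e (toVec p.1) p.2| ≤
        (K2 P j η w c + K1 P j η w c ^ 2) * (Real.exp (2 * ‖p.1‖) * Real.exp (4 * ‖p.2‖)) := by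
      have hK1 := K1_nonneg (P := P) (j := j) η w c
      have hK2 := K2_nonneg (P := P) (j := j) η w c
      calc |D2 C η w c e (toVec p.1) p.2|
          ≤ K2 P j η w c * (‖p.1‖ ^ 2 * ‖p.2‖ ^ 2) + (K1 P j η w c * (‖p.1‖ * ‖p.2‖ ^ 2)) ^ 2 := hD
        _ = K2 P j η w c * (‖p.1‖ ^ 2 * ‖p.2‖ ^ 2) + K1 P j η w c ^ 2 * (‖p.1‖ ^ 2 * (‖p.2‖ ^ 2) ^ 2) := by ring
        _ ≤ K2 P j η w c * (Real.exp (2 * ‖p.1‖) * Real.exp (4 * ‖p.2‖))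
            + K1 P j η w c ^ 2 * (Real.exp (2 * ‖p.1‖) * Real.exp (4 * ‖p.2‖)) := by gcongr
        _ = (K2 P j η w c + K1 P j η w c ^ 2) * (Real.exp (2 * ‖p.1‖) * Real.exp (4 * ‖p.2‖)) := by ring
    have hκ4 : Real.exp (4 * ‖p.2‖) * Real.exp (κ * ‖p.2‖) = Real.exp ((κ + 4) * ‖p.2‖) := by
      rw [← Real.exp_add]; ring_nf
    have hX1 : 0 ≤ WA η w c μ2 p.1 * weight (Ce C e) η w c m2 (toVec p.1) p.2 := mul_nonneg hWA (weight_pos _ _).le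
    have hX2 : 0 ≤ (K2 P j η w c + K1 P j η w c ^ 2) * (Real.exp (2 * ‖p.1‖) * Real.exp (4 * ‖p.2‖)) :=
      mul_nonneg (add_nonneg (K2_nonneg η w c) (sq_nonneg _)) (by positivity)
    have hX3 : 0 ≤ (K2 P j η w c + K1 P j η w c ^ 2) * (Real.exp (2 * ‖p.1‖) * Real.exp (4 * ‖p.2‖)) *
        (WA η w c μ2 p.1 * Real.exp (-(m2 * w / 2) * ∑ x : Site P j, ‖p.2 x‖ ^ 2)) :=
      mul_nonneg hX2 (mul_nonneg hWA (Real.exp_pos _).le)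
    calc |D2 C η w c e (toVec p.1) p.2| * (WA η w c μ2 p.1 * weight (Ce C e) η w c m2 (toVec p.1) p.2) * |F p.2|
        ≤ ((K2 P j η w c + K1 P j η w c ^ 2) * (Real.exp (2 * ‖p.1‖) * Real.exp (4 * ‖p.2‖))) *
            (WA η w c μ2 p.1 * Real.exp (-(m2 * w / 2) * ∑ x : Site P j, ‖p.2 x‖ ^ 2)) * (K * Real.exp (κ * ‖p.2‖)) :=
          mul_le_mul (mul_le_mul hD' (mul_le_mul_of_nonneg_left h1 hWA) hX1 hX2) (hFb p.2) (abs_nonneg _) hX3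
      _ = (K2 P j η w c + K1 P j η w c ^ 2) * K * ((WA η w c μ2 p.1 * Real.exp (2 * ‖p.1‖)) *
            ((Real.exp (4 * ‖p.2‖) * Real.exp (κ * ‖p.2‖)) * Real.exp (-(m2 * w / 2) * ∑ x : Site P j, ‖p.2 x‖ ^ 2))) := by
          ring
      _ = (K2 P j η w c + K1 P j η w c ^ 2) * K * ((WA η w c μ2 p.1 * Real.exp (2 * ‖p.1‖)) *
            (Real.exp ((κ + 4) * ‖p.2‖) * Real.exp (-(m2 * w / 2) * ∑ x : Site P j, ‖p.2 x‖ ^ 2))) := by rw [hκ4]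
  · have h := ((hasDerivAt_D1_mul_weight C η w c m2 (toVec p.1) p.2 e).const_mul (WA η w c μ2 p.1)).mul_const (F p.2)
    have hfun : (fun x : ℝ => D1 C η w c x (toVec p.1) p.2 * (WA η w c μ2 p.1 * weight (Ce C x) η w c m2 (toVec p.1) p.2) *
        F p.2) = fun y => WA η w c μ2 p.1 * (D1 C η w c y (toVec p.1) p.2 * weight (Ce C y) η w c m2 (toVec p.1) p.2) * F p.2 := by
      funext y; ring
    simp only [J]
    rw [hfun]
    refine h.congr_deriv ?_
    ring

/-! ## §4 The values at `e = 0`: the joint Gaussian factorizes; the vector-field covariance `δ_{μν}C^ε(y,y′)` -/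

/-- at `e = 0` the scalar weight does not see the vector field: `e^{−½⟨φ,(−Δ^η_A+m²)φ⟩}|_{e=0} = e^{−½⟨φ,(−Δ^η_0+m²)φ⟩}`.
[cite: Balaban1983Higgs3, (1.20) p.416] -/
theorem weight_Ce_zero (A : VecField P j ℝ) (φ : Cfg P j N) :
    weight (Ce C 0) η w c m2 A φ = weight C η w c m2 (0 : VecField P j ℝ) φ := by
  unfold weight quadForm covLaplaceForm covDerivScalar
  simp only [HiggsLattice.ChargeData.Urep_apply, Ce_U_zero, HiggsLattice.ChargeData.U_zero, Pi.zero_apply,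
    one_apply_eq_self]

/-- **the joint weight at `e = 0` is the PRODUCT of the two free Gaussians** `e^{−½⟨A,(−Δ+μ₀²)A⟩}·e^{−½⟨φ,(−Δ₀+m²)φ⟩}`: at zero
charge `A` and `φ` are independent Gaussian fields. [cite: Balaban1983Higgs3, (1.20) p.416] -/
theorem J_zero (p : JCfg P j N) :
    J C η w c m2 μ2 0 p = WA η w c μ2 p.1 * weight C η w c m2 (0 : VecField P j ℝ) p.2 := by
  rw [J, weight_Ce_zero]

/-- `D₁(0; A, φ) = Σ_b η^dc²ηA_b⟪φ(b₋),qφ(b₊)⟫` — the cubic vertex (1.8)_{1,0} `−eΣ_bη^d⟪∂^ηφ(b),qφ(b₋)⟫A_b` per unit `e` (as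
`⟪φ(b₋),qφ(b₋)⟫ = 0`; see `D1_zero_eq_vertex18`). [cite: Balaban1983Higgs3, (1.8) p.413] -/
theorem D1_zero (A : VecField P j ℝ) (φ : Cfg P j N) :
    D1 C η w c 0 A φ = ∑ b : PBond P j, w * (c ^ 2 * ((η * A b) * ⟪φ b.src, C.q (φ b.tgt)⟫_ℝ)) := by
  unfold D1
  simp only [Ce_U_zero, one_apply_eq_self]

/-- `D₂(0; A, φ) = Σ_b η^dc²η²A_b²⟪φ(b₋),q²φ(b₊)⟫ + D₁(0;A,φ)²`. [cite: Balaban1983Higgs3, (1.10) p.413] -/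
theorem D2_zero (A : VecField P j ℝ) (φ : Cfg P j N) :
    D2 C η w c 0 A φ = (∑ b : PBond P j, w * (c ^ 2 * ((η * A b) ^ 2 * ⟪φ b.src, C.q (C.q (φ b.tgt))⟫_ℝ)))
      + D1 C η w c 0 A φ ^ 2 := by
  unfold D2
  simp only [Ce_U_zero, one_apply_eq_self]

/-- **`D₁(0)` AND THE CUBIC VERTEX (1.8)_{1,0}.** `D₁(0;A,φ) = −(cη)·Σ_bη^d⟪∂^ηφ(b),qφ(b₋)⟫A_b` (`⟪φ(b₋),qφ(b₊)⟫ =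
⟪φ(b₋),q(φ(b₊) − φ(b₋))⟫` by `⟪v,qv⟫ = 0`, and `q* = −q`).  Since `∂_ee^{−S_e} = D₁e^{−S_e}`, `−e·D₁(0) = (cη)·eΣ_bη^d⟪∂^ηφ(b),qφ(b₋)⟫A_b`
is the order-`e` part of this file's action; print's (1.8) at `n = 1, n′ = 0` reads `−eΣ_bε^d⟨∂^εφ(b),qφ(b₋)⟩A_b` (`cη = 1` in
print) — the same vertex up to the overall sign, which is fixed by the orientation conventions for `D_A`, `U`, `q` (here the
vendored ones: `D_Aφ(b) = c(U(A_b)φ(b₊) − φ(b₋))`, `U = exp(ηeA·q)` of `LatticeFieldCalculus`/`HiggsLattice`) and enters the order-e²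
two-point function only through `D₁²`, so nothing below depends on it. [cite: Balaban1983Higgs3, (1.8) p.413] -/
theorem D1_zero_eq_vertex18 (A : VecField P j ℝ) (φ : Cfg P j N) :
    D1 C η w c 0 A φ = (c * η) * ∑ b : PBond P j, w * (⟪grad c φ b, C.q (φ b.src)⟫_ℝ * A b) * (-1) := by
  rw [D1_zero, Finset.mul_sum]
  refine Finset.sum_congr rfl fun b _ => ?_
  have h0 := B3WT226Pairings.inner_q_self C (φ b.src)
  have h1 : ⟪φ b.tgt, C.q (φ b.src)⟫_ℝ = -⟪φ b.src, C.q (φ b.tgt)⟫_ℝ := by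
    calc ⟪φ b.tgt, C.q (φ b.src)⟫_ℝ = ⟪ContinuousLinearMap.adjoint C.q (φ b.tgt), φ b.src⟫_ℝ := by
          rw [ContinuousLinearMap.adjoint_inner_left]
      _ = ⟪(-C.q) (φ b.tgt), φ b.src⟫_ℝ := by rw [← ContinuousLinearMap.star_eq_adjoint, C.q_skew]
      _ = -⟪φ b.src, C.q (φ b.tgt)⟫_ℝ := by rw [neg_apply, inner_neg_left, real_inner_comm]
  rw [grad, inner_smul_left, inner_sub_left, h0, h1]
  simp only [RCLike.conj_to_real]
  ring

/-- **Fubini for the product observables**: `∫dA∫dφ W_A(A)f(A)·W₀(φ)g(φ) = (∫W_Af)·(∫W₀g)` for `f`, `g` of exponential-linear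
growth (the vector and scalar Gaussians at `e = 0` are independent). [cite: Balaban1983Higgs3, (1.20) p.416] -/
theorem integral_prod_WA_W0 (f : Cfg P j P.d → ℝ) (g : Cfg P j N → ℝ) :
    ∫ p : JCfg P j N, WA η w c μ2 p.1 * f p.1 * (weight C η w c m2 (0 : VecField P j ℝ) p.2 * g p.2) =
      (∫ A : Cfg P j P.d, WA η w c μ2 A * f A) * ∫ φ : Cfg P j N, weight C η w c m2 (0 : VecField P j ℝ) φ * g φ := by
  rw [Measure.volume_eq_prod]
  exact integral_prod_mul (fun A => WA η w c μ2 A * f A) (fun φ => weight C η w c m2 (0 : VecField P j ℝ) φ * g φ)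

/-- integrability of the product observables. [cite: Balaban1983Higgs3, (1.20) p.416] -/
theorem integrable_prod_WA_W0 (hw : 0 < w) (hm : 0 < m2) (hμ : 0 < μ2) {f : Cfg P j P.d → ℝ} {g : Cfg P j N → ℝ}
    (hf : ExpGrowth f) (hg : ExpGrowth g) :
    Integrable (fun p : JCfg P j N => WA η w c μ2 p.1 * f p.1 * (weight C η w c m2 (0 : VecField P j ℝ) p.2 * g p.2)) := by
  have h := (ExpGrowth.integrable (Cvec P.d) η w c μ2 hw hμ hf).mul_prod (ExpGrowth.integrable C η w c m2 hw hm hg)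
  rw [← Measure.volume_eq_prod] at h
  exact h

/-- **`⟨A_b⟩ = 0`**: the free vector-field Gaussian is even. [cite: Balaban1983Higgs3, (1.20) p.416] -/
theorem integral_WA_toVec (hw : 0 < w) (hμ : 0 < μ2) (b : PBond P j) : ∫ A : Cfg P j P.d, WA η w c μ2 A * toVec A b = 0 := by
  have h := ibp_site (Cvec P.d) η w c μ2 hw hμ b.src b.dir (g := fun _ => (1 : ℝ)) (g' := fun _ => (0 : ℝ))
    (ExpGrowth.const 1) (ExpGrowth.const 0) (DerivAlong.const _ 1)
  simp only [mul_one, mul_zero, integral_zero] at h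
  simpa [WA, toVec] using h

/-- **THE VECTOR-FIELD COVARIANCE `⟨A_μ(y)A_ν(y′)⟩ = δ_{μν}C^ε(y,y′)`** with `C^ε = (−Δ^η + μ₀²)^{−1}` — *"C^ε = (−Δ^ε + μ₀²)^{−1} for
the vector field (… vector indices are understood here)"*: the propagator of this seat's Gaussian calculus at mass `μ₀²`, diagonal
in the component index. [cite: Balaban1983Higgs3, (1.21) p.416] -/
theorem integral_WA_toVec_toVec (hw : 0 < w) (hμ : 0 < μ2) (b b' : PBond P j) :
    ∫ A : Cfg P j P.d, WA η w c μ2 A * (toVec A b * toVec A b') =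
      (∫ A : Cfg P j P.d, WA η w c μ2 A) * (G w c μ2 b.src b'.src * if b.dir = b'.dir then 1 else 0) := by
  have h := moment2 (Cvec P.d) η w c μ2 hw hμ b.src b'.src (EuclideanSpace.basisFun (Fin P.d) ℝ b.dir)
    (EuclideanSpace.basisFun (Fin P.d) ℝ b'.dir)
  have hδ : ⟪EuclideanSpace.basisFun (Fin P.d) ℝ b.dir, EuclideanSpace.basisFun (Fin P.d) ℝ b'.dir⟫_ℝ =
      if b.dir = b'.dir then 1 else 0 := by
    classical
    exact orthonormal_iff_ite.mp (EuclideanSpace.basisFun (Fin P.d) ℝ).orthonormal _ _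
  unfold WA toVec
  rw [h, hδ]

/-- positivity of the vector-field normalization `Z_A = ∫W_A > 0`. [cite: Balaban1983Higgs3, (1.20) p.416] -/
theorem ZA_pos (hw : 0 < w) (hμ : 0 < μ2) : 0 < ∫ A : Cfg P j P.d, WA η w c μ2 A :=
  B3WT226Traces.Z_pos (Cvec P.d) η w c μ2 hw hμ

/-- positivity of the joint normalization `Z^ε_e = ∫dA∫dφ e^{−S_e} > 0` at every charge. [cite: Balaban1983Higgs3, (1.19) p.416] -/
theorem integral_J_pos (hw : 0 < w) (hm : 0 < m2) (hμ : 0 < μ2) (e : ℝ) : 0 < ∫ p : JCfg P j N, J C η w c m2 μ2 e p := by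
  have hint : Integrable (fun p : JCfg P j N => J C η w c m2 μ2 e p) := by
    have h := integrable_J_mul (P := P) (j := j) C η w c m2 μ2 hw hm hμ (ExpGrowth.const (1 : ℝ)) e
    simpa only [mul_one] using h
  have hpos : ∀ p : JCfg P j N, 0 < J C η w c m2 μ2 e p := fun p => mul_pos (WA_pos η w c μ2 p.1) (weight_pos _ _)
  rw [integral_pos_iff_support_of_nonneg (fun p => (hpos p).le) hint]
  have hsupp : Function.support (fun p : JCfg P j N => J C η w c m2 μ2 e p) = Set.univ :=
    Set.eq_univ_iff_forall.mpr fun p => Function.mem_support.mpr (hpos p).ne'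
  rw [hsupp, Measure.volume_eq_prod, ← Set.univ_prod_univ, Measure.prod_prod]
  exact ENNReal.mul_pos (isOpen_univ.measure_pos volume Set.univ_nonempty).ne'
    (isOpen_univ.measure_pos volume Set.univ_nonempty).ne'

/-- **THE FIRST CHARGE-DERIVATIVE VANISHES AT `e = 0`**: `∫ D₁(0)e^{−S_0}F = 0` for every scalar observable `F` — one vector leg
`A_b` against the even free Gaussian (`⟨A_b⟩ = 0`): no graph of odd order in `e`. [cite: Balaban1983Higgs3, (1.21) p.416] -/
theorem integral_D1_J_zero (hw : 0 < w) (hm : 0 < m2) (hμ : 0 < μ2) {F : Cfg P j N → ℝ} (hF : ExpGrowth F) :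
    ∫ p : JCfg P j N, D1 C η w c 0 (toVec p.1) p.2 * J C η w c m2 μ2 0 p * F p.2 = 0 := by
  have hterm : ∀ b : PBond P j, Integrable (fun p : JCfg P j N => WA η w c μ2 p.1 * toVec p.1 b *
      (weight C η w c m2 (0 : VecField P j ℝ) p.2 * (⟪p.2 b.src, C.q (p.2 b.tgt)⟫_ℝ * F p.2))) := fun b =>
    integrable_prod_WA_W0 C η w c m2 μ2 hw hm hμ (ExpGrowth.inner_apply b.src _)
      ((ExpGrowth.inner_op_apply b.src b.tgt C.q).mul hF)
  have hexp : (fun p : JCfg P j N => D1 C η w c 0 (toVec p.1) p.2 * J C η w c m2 μ2 0 p * F p.2) =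
      fun p => ∑ b : PBond P j, (w * (c ^ 2 * η)) * (WA η w c μ2 p.1 * toVec p.1 b *
        (weight C η w c m2 (0 : VecField P j ℝ) p.2 * (⟪p.2 b.src, C.q (p.2 b.tgt)⟫_ℝ * F p.2))) := by
    funext p
    rw [D1_zero, J_zero, Finset.sum_mul, Finset.sum_mul]
    exact Finset.sum_congr rfl fun b _ => by ring
  rw [hexp, integral_finsetSum _ fun b _ => (hterm b).const_mul _]
  refine Finset.sum_eq_zero fun b _ => ?_
  rw [integral_const_mul, integral_prod_WA_W0 C η w c m2 μ2 (fun A => toVec A b) (fun φ => ⟪φ b.src, C.q (φ b.tgt)⟫_ℝ * F φ),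
    integral_WA_toVec η w c μ2 hw hμ b]
  ring



/-! ## §5 Wick's theorem for the order-e² vertices against the two external legs `φ_a(x)φ_b(x′)` -/

section Wick

/-- the Gaussian weight `W₀(φ) = e^{−½⟨φ,(−Δ^η_0+m²)φ⟩}` of the free scalar field (notation local to this file). [folklore] -/
local notation "W0" => weight C η w c m2 (0 : VecField P j ℝ)

/-- the standard orthonormal basis vector `e_a` of `R^N` (notation local to this file). [folklore] -/
local notation "𝐞" => EuclideanSpace.basisFun (Fin N) ℝ

/-- **THE DOUBLE LEG CONTRACTION**: for an observable `R` with `R₁ = D_{h_{x,a}}R`, `R₂ = D_{h_{x′,b}}R₁`,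
`∫W₀·φ_a(x)φ_b(x′)·R = C₀(x′,x)δ_{ab}·∫W₀R + ∫W₀R₂` — the two external legs pair with each other (the DISCONNECTED part) or are
both contracted into `R` (Gaussian integration by parts twice, `B3WickVertexCalculus.ibp_site`). [cite: GlimmJaffeQP1987, Thm 6.3.1 (6.3.3)]
[cite: Balaban1983Higgs3, (1.19) p.416] -/
theorem integral_legs_mul (hw : 0 < w) (hm : 0 < m2) (a b : Fin N) (x x' : Site P j) {R R₁ R₂ : Cfg P j N → ℝ}
    (hR : ExpGrowth R) (hR₁ : ExpGrowth R₁) (hR₂ : ExpGrowth R₂)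
    (hD₁ : DerivAlong (hx w c m2 x a) R R₁) (hD₂ : DerivAlong (hx w c m2 x' b) R₁ R₂) :
    ∫ φ, W0 φ * (⟪φ x, 𝐞 a⟫_ℝ * ⟪φ x', 𝐞 b⟫_ℝ * R φ) =
      G w c m2 x' x * ⟪𝐞 a, 𝐞 b⟫_ℝ * (∫ φ, W0 φ * R φ) + ∫ φ, W0 φ * R₂ φ := by
  have hg : ExpGrowth (fun φ : Cfg P j N => ⟪φ x', 𝐞 b⟫_ℝ * R φ) := (ExpGrowth.inner_apply x' _).mul hR
  have hg' : ExpGrowth (fun φ : Cfg P j N => G w c m2 x' x * ⟪𝐞 a, 𝐞 b⟫_ℝ * R φ + ⟪φ x', 𝐞 b⟫_ℝ * R₁ φ) :=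
    (hR.const_mul _).add ((ExpGrowth.inner_apply x' _).mul hR₁)
  have hD : DerivAlong (hx w c m2 x a) (fun φ : Cfg P j N => ⟪φ x', 𝐞 b⟫_ℝ * R φ)
      (fun φ => G w c m2 x' x * ⟪𝐞 a, 𝐞 b⟫_ℝ * R φ + ⟪φ x', 𝐞 b⟫_ℝ * R₁ φ) :=
    ((DerivAlong.inner_apply (hx w c m2 x a) x' (𝐞 b)).mul hD₁).congr fun φ => by rw [inner_hx_left]
  have e1 : (fun φ : Cfg P j N => W0 φ * (⟪φ x, 𝐞 a⟫_ℝ * ⟪φ x', 𝐞 b⟫_ℝ * R φ)) =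
      fun φ => W0 φ * (⟪φ x, 𝐞 a⟫_ℝ * (⟪φ x', 𝐞 b⟫_ℝ * R φ)) := by
    funext φ; ring
  rw [e1, ibp_site C η w c m2 hw hm x a hg hg' hD]
  have i1 := ExpGrowth.integrable C η w c m2 hw hm (hR.const_mul (G w c m2 x' x * ⟪𝐞 a, 𝐞 b⟫_ℝ))
  have i2 := ExpGrowth.integrable C η w c m2 hw hm ((ExpGrowth.inner_apply x' (𝐞 b)).mul hR₁)
  have e2 : (fun φ : Cfg P j N => W0 φ * (G w c m2 x' x * ⟪𝐞 a, 𝐞 b⟫_ℝ * R φ + ⟪φ x', 𝐞 b⟫_ℝ * R₁ φ)) =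
      fun φ => W0 φ * (G w c m2 x' x * ⟪𝐞 a, 𝐞 b⟫_ℝ * R φ) + W0 φ * (⟪φ x', 𝐞 b⟫_ℝ * R₁ φ) := by
    funext φ; ring
  rw [e2, integral_add i1 i2, ibp_site C η w c m2 hw hm x' b hR₁ hR₂ hD₂]
  have e3 : (fun φ : Cfg P j N => W0 φ * (G w c m2 x' x * ⟪𝐞 a, 𝐞 b⟫_ℝ * R φ)) =
      fun φ => G w c m2 x' x * ⟪𝐞 a, 𝐞 b⟫_ℝ * (W0 φ * R φ) := by
    funext φ; ring
  rw [e3, integral_const_mul]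

omit C η w c m2 in
/-- `⟪v, Qu⟫ = ⟪u, Q*v⟫`. [folklore] -/
private theorem inner_op_eq_adjoint (Q : EuclideanSpace ℝ (Fin N) →L[ℝ] EuclideanSpace ℝ (Fin N)) (v u : EuclideanSpace ℝ (Fin N)) :
    ⟪v, Q u⟫_ℝ = ⟪u, ContinuousLinearMap.adjoint Q v⟫_ℝ := by
  rw [ContinuousLinearMap.adjoint_inner_right, real_inner_comm]

/-- **THE TWO LEGS AGAINST ONE CURRENT `⟪φ(y),Qφ(y′)⟫`**:
`∫W₀·φ_a(x)φ_b(x′)·⟪φ(y),Qφ(y′)⟫ = Z_φ[C₀(x′,x)δ_{ab}·C₀(y,y′)trQ + C₀(y,x)C₀(y′,x′)⟪e_a,Qe_b⟫ + C₀(y′,x)C₀(y,x′)⟪e_b,Qe_a⟫]`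
— the legs pair with each other and the current closes into a loop (disconnected), or the two legs enter the two ends of the current
in either order. [cite: Balaban1983Higgs3, (1.22) p.416] [cite: GlimmJaffeQP1987, §8.2 (8.2.4)] -/
theorem integral_legs_cur (hw : 0 < w) (hm : 0 < m2) (a b : Fin N) (x x' y y' : Site P j)
    (Q : EuclideanSpace ℝ (Fin N) →L[ℝ] EuclideanSpace ℝ (Fin N)) :
    ∫ φ, W0 φ * (⟪φ x, 𝐞 a⟫_ℝ * ⟪φ x', 𝐞 b⟫_ℝ * ⟪φ y, Q (φ y')⟫_ℝ) =
      (∫ φ, W0 φ) * (G w c m2 x' x * ⟪𝐞 a, 𝐞 b⟫_ℝ * (G w c m2 y y' * trE Q)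
        + G w c m2 y x * G w c m2 y' x' * ⟪𝐞 a, Q (𝐞 b)⟫_ℝ + G w c m2 y' x * G w c m2 y x' * ⟪𝐞 b, Q (𝐞 a)⟫_ℝ) := by
  -- R₁ = D_{h_{x,a}}⟪φ(y),Qφ(y′)⟫ = C(y,x)⟪φ(y′),Q*e_a⟫ + C(y′,x)⟪φ(y),Qe_a⟫ ; R₂ = D_{h_{x′,b}}R₁ is a constant
  have hR : ExpGrowth (fun φ : Cfg P j N => ⟪φ y, Q (φ y')⟫_ℝ) := ExpGrowth.inner_op_apply y y' Q
  have hR₁ : ExpGrowth (fun φ : Cfg P j N => G w c m2 y x * ⟪φ y', ContinuousLinearMap.adjoint Q (𝐞 a)⟫_ℝ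
      + G w c m2 y' x * ⟪φ y, Q (𝐞 a)⟫_ℝ) :=
    ((ExpGrowth.inner_apply y' _).const_mul _).add ((ExpGrowth.inner_apply y _).const_mul _)
  have hR₂ : ExpGrowth (fun _ : Cfg P j N => G w c m2 y x * (G w c m2 y' x' * ⟪𝐞 b, ContinuousLinearMap.adjoint Q (𝐞 a)⟫_ℝ)
      + G w c m2 y' x * (G w c m2 y x' * ⟪𝐞 b, Q (𝐞 a)⟫_ℝ)) := ExpGrowth.const _
  have hD₁ : DerivAlong (hx w c m2 x a) (fun φ : Cfg P j N => ⟪φ y, Q (φ y')⟫_ℝ)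
      (fun φ => G w c m2 y x * ⟪φ y', ContinuousLinearMap.adjoint Q (𝐞 a)⟫_ℝ + G w c m2 y' x * ⟪φ y, Q (𝐞 a)⟫_ℝ) :=
    (DerivAlong.inner_op_apply (hx w c m2 x a) y y' Q).congr fun φ => by
      rw [inner_hx_left, op_hx, inner_smul_right, inner_op_eq_adjoint Q (𝐞 a)]
  have hD₂ : DerivAlong (hx w c m2 x' b)
      (fun φ : Cfg P j N => G w c m2 y x * ⟪φ y', ContinuousLinearMap.adjoint Q (𝐞 a)⟫_ℝ + G w c m2 y' x * ⟪φ y, Q (𝐞 a)⟫_ℝ)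
      (fun _ => G w c m2 y x * (G w c m2 y' x' * ⟪𝐞 b, ContinuousLinearMap.adjoint Q (𝐞 a)⟫_ℝ)
        + G w c m2 y' x * (G w c m2 y x' * ⟪𝐞 b, Q (𝐞 a)⟫_ℝ)) :=
    (((DerivAlong.inner_apply _ y' _).const_mul _).add ((DerivAlong.inner_apply _ y _).const_mul _)).congr fun φ => by
      rw [inner_hx_left, inner_hx_left]
  rw [integral_legs_mul C η w c m2 hw hm a b x x' hR hR₁ hR₂ hD₁ hD₂, moment2_op C η w c m2 hw hm y y' Q, integral_mul_const,
    ← inner_op_eq_adjoint Q (𝐞 a) (𝐞 b)]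
  ring

omit C η w c m2 in
/-- `∫(f₁+f₂+(f₃+f₄)) = ∫f₁+∫f₂+(∫f₃+∫f₄)` for integrable summands. [folklore] -/
private theorem integral_add4 {f₁ f₂ f₃ f₄ : Cfg P j N → ℝ} (h₁ : Integrable f₁) (h₂ : Integrable f₂) (h₃ : Integrable f₃)
    (h₄ : Integrable f₄) :
    ∫ φ, (f₁ φ + f₂ φ + (f₃ φ + f₄ φ)) = (∫ φ, f₁ φ) + (∫ φ, f₂ φ) + ((∫ φ, f₃ φ) + ∫ φ, f₄ φ) := by
  have h12 : Integrable (fun φ => f₁ φ + f₂ φ) := h₁.add h₂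
  have h34 : Integrable (fun φ => f₃ φ + f₄ φ) := h₃.add h₄
  rw [integral_add h12 h34, integral_add h₁ h₂, integral_add h₃ h₄]

/-- **THE TWO LEGS AGAINST TWO CURRENTS** `⟪φ(y₁),Q₁φ(y₁′)⟫⟪φ(y₂),Q₂φ(y₂′)⟫`: the disconnected part `C₀(x′,x)δ_{ab}·∫W₀(two currents)`
plus the CONNECTED part — both legs into the same current (whose partner closes into a loop, `trQ`) or one leg into each current
and the two currents joined by a line (eight terms). [cite: Balaban1983Higgs3, (1.22) p.416] [cite: GlimmJaffeQP1987, §8.2 (8.2.4)] -/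
theorem integral_legs_cur_cur (hw : 0 < w) (hm : 0 < m2) (a b : Fin N) (x x' y₁ y₁' y₂ y₂' : Site P j)
    (Q₁ Q₂ : EuclideanSpace ℝ (Fin N) →L[ℝ] EuclideanSpace ℝ (Fin N)) :
    ∫ φ, W0 φ * (⟪φ x, 𝐞 a⟫_ℝ * ⟪φ x', 𝐞 b⟫_ℝ * (⟪φ y₁, Q₁ (φ y₁')⟫_ℝ * ⟪φ y₂, Q₂ (φ y₂')⟫_ℝ)) =
      G w c m2 x' x * ⟪𝐞 a, 𝐞 b⟫_ℝ * (∫ φ, W0 φ * (⟪φ y₁, Q₁ (φ y₁')⟫_ℝ * ⟪φ y₂, Q₂ (φ y₂')⟫_ℝ))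
      + (∫ φ, W0 φ) * (
        -- both legs into current 1, current 2 a loop; both legs into current 2, current 1 a loop
          (G w c m2 y₁ x * G w c m2 y₁' x' * ⟪𝐞 b, ContinuousLinearMap.adjoint Q₁ (𝐞 a)⟫_ℝ
            + G w c m2 y₁' x * G w c m2 y₁ x' * ⟪𝐞 b, Q₁ (𝐞 a)⟫_ℝ) * (G w c m2 y₂ y₂' * trE Q₂)
        + (G w c m2 y₂ x * G w c m2 y₂' x' * ⟪𝐞 b, ContinuousLinearMap.adjoint Q₂ (𝐞 a)⟫_ℝ
            + G w c m2 y₂' x * G w c m2 y₂ x' * ⟪𝐞 b, Q₂ (𝐞 a)⟫_ℝ) * (G w c m2 y₁ y₁' * trE Q₁)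
        -- leg a into current 1, leg b into current 2
        + (G w c m2 y₁ x * G w c m2 y₂ x' * (G w c m2 y₁' y₂' *
              ⟪ContinuousLinearMap.adjoint Q₁ (𝐞 a), ContinuousLinearMap.adjoint Q₂ (𝐞 b)⟫_ℝ)
          + G w c m2 y₁ x * G w c m2 y₂' x' * (G w c m2 y₁' y₂ * ⟪ContinuousLinearMap.adjoint Q₁ (𝐞 a), Q₂ (𝐞 b)⟫_ℝ)
          + G w c m2 y₁' x * G w c m2 y₂ x' * (G w c m2 y₁ y₂' * ⟪Q₁ (𝐞 a), ContinuousLinearMap.adjoint Q₂ (𝐞 b)⟫_ℝ)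
          + G w c m2 y₁' x * G w c m2 y₂' x' * (G w c m2 y₁ y₂ * ⟪Q₁ (𝐞 a), Q₂ (𝐞 b)⟫_ℝ))
        -- leg b into current 1, leg a into current 2
        + (G w c m2 y₁ x' * G w c m2 y₂ x * (G w c m2 y₁' y₂' *
              ⟪ContinuousLinearMap.adjoint Q₁ (𝐞 b), ContinuousLinearMap.adjoint Q₂ (𝐞 a)⟫_ℝ)
          + G w c m2 y₁ x' * G w c m2 y₂' x * (G w c m2 y₁' y₂ * ⟪ContinuousLinearMap.adjoint Q₁ (𝐞 b), Q₂ (𝐞 a)⟫_ℝ)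
          + G w c m2 y₁' x' * G w c m2 y₂ x * (G w c m2 y₁ y₂' * ⟪Q₁ (𝐞 b), ContinuousLinearMap.adjoint Q₂ (𝐞 a)⟫_ℝ)
          + G w c m2 y₁' x' * G w c m2 y₂' x * (G w c m2 y₁ y₂ * ⟪Q₁ (𝐞 b), Q₂ (𝐞 a)⟫_ℝ))) := by
  -- the linear remnants of the currents after one contraction, and their constants after the second
  set L₁ : Cfg P j N → ℝ := fun φ => G w c m2 y₁ x * ⟪φ y₁', ContinuousLinearMap.adjoint Q₁ (𝐞 a)⟫_ℝ
    + G w c m2 y₁' x * ⟪φ y₁, Q₁ (𝐞 a)⟫_ℝ with hL₁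
  set L₂ : Cfg P j N → ℝ := fun φ => G w c m2 y₂ x * ⟪φ y₂', ContinuousLinearMap.adjoint Q₂ (𝐞 a)⟫_ℝ
    + G w c m2 y₂' x * ⟪φ y₂, Q₂ (𝐞 a)⟫_ℝ with hL₂
  set L₁' : Cfg P j N → ℝ := fun φ => G w c m2 y₁ x' * ⟪φ y₁', ContinuousLinearMap.adjoint Q₁ (𝐞 b)⟫_ℝ
    + G w c m2 y₁' x' * ⟪φ y₁, Q₁ (𝐞 b)⟫_ℝ with hL₁'
  set L₂' : Cfg P j N → ℝ := fun φ => G w c m2 y₂ x' * ⟪φ y₂', ContinuousLinearMap.adjoint Q₂ (𝐞 b)⟫_ℝ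
    + G w c m2 y₂' x' * ⟪φ y₂, Q₂ (𝐞 b)⟫_ℝ with hL₂'
  set κ₁ : ℝ := G w c m2 y₁ x * (G w c m2 y₁' x' * ⟪𝐞 b, ContinuousLinearMap.adjoint Q₁ (𝐞 a)⟫_ℝ)
    + G w c m2 y₁' x * (G w c m2 y₁ x' * ⟪𝐞 b, Q₁ (𝐞 a)⟫_ℝ) with hκ₁
  set κ₂ : ℝ := G w c m2 y₂ x * (G w c m2 y₂' x' * ⟪𝐞 b, ContinuousLinearMap.adjoint Q₂ (𝐞 a)⟫_ℝ)
    + G w c m2 y₂' x * (G w c m2 y₂ x' * ⟪𝐞 b, Q₂ (𝐞 a)⟫_ℝ) with hκ₂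
  set c₁ : Cfg P j N → ℝ := fun φ => ⟪φ y₁, Q₁ (φ y₁')⟫_ℝ with hc₁
  set c₂ : Cfg P j N → ℝ := fun φ => ⟪φ y₂, Q₂ (φ y₂')⟫_ℝ with hc₂
  have gc₁ : ExpGrowth c₁ := ExpGrowth.inner_op_apply y₁ y₁' Q₁
  have gc₂ : ExpGrowth c₂ := ExpGrowth.inner_op_apply y₂ y₂' Q₂
  have gL₁ : ExpGrowth L₁ := ((ExpGrowth.inner_apply y₁' _).const_mul _).add ((ExpGrowth.inner_apply y₁ _).const_mul _)
  have gL₂ : ExpGrowth L₂ := ((ExpGrowth.inner_apply y₂' _).const_mul _).add ((ExpGrowth.inner_apply y₂ _).const_mul _)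
  have gL₁' : ExpGrowth L₁' := ((ExpGrowth.inner_apply y₁' _).const_mul _).add ((ExpGrowth.inner_apply y₁ _).const_mul _)
  have gL₂' : ExpGrowth L₂' := ((ExpGrowth.inner_apply y₂' _).const_mul _).add ((ExpGrowth.inner_apply y₂ _).const_mul _)
  -- first contractions of the currents
  have dc₁ : DerivAlong (hx w c m2 x a) c₁ L₁ :=
    (DerivAlong.inner_op_apply (hx w c m2 x a) y₁ y₁' Q₁).congr fun φ => by
      rw [hL₁, inner_hx_left, op_hx, inner_smul_right, inner_op_eq_adjoint Q₁ (𝐞 a)]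
  have dc₂ : DerivAlong (hx w c m2 x a) c₂ L₂ :=
    (DerivAlong.inner_op_apply (hx w c m2 x a) y₂ y₂' Q₂).congr fun φ => by
      rw [hL₂, inner_hx_left, op_hx, inner_smul_right, inner_op_eq_adjoint Q₂ (𝐞 a)]
  have dc₁' : DerivAlong (hx w c m2 x' b) c₁ L₁' :=
    (DerivAlong.inner_op_apply (hx w c m2 x' b) y₁ y₁' Q₁).congr fun φ => by
      rw [hL₁', inner_hx_left, op_hx, inner_smul_right, inner_op_eq_adjoint Q₁ (𝐞 b)]
  have dc₂' : DerivAlong (hx w c m2 x' b) c₂ L₂' :=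
    (DerivAlong.inner_op_apply (hx w c m2 x' b) y₂ y₂' Q₂).congr fun φ => by
      rw [hL₂', inner_hx_left, op_hx, inner_smul_right, inner_op_eq_adjoint Q₂ (𝐞 b)]
  -- second contractions of the linear remnants: constants
  have dL₁ : DerivAlong (hx w c m2 x' b) L₁ (fun _ => κ₁) :=
    (((DerivAlong.inner_apply _ y₁' _).const_mul _).add ((DerivAlong.inner_apply _ y₁ _).const_mul _)).congr fun φ => by
      rw [hκ₁, inner_hx_left, inner_hx_left]
  have dL₂ : DerivAlong (hx w c m2 x' b) L₂ (fun _ => κ₂) :=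
    (((DerivAlong.inner_apply _ y₂' _).const_mul _).add ((DerivAlong.inner_apply _ y₂ _).const_mul _)).congr fun φ => by
      rw [hκ₂, inner_hx_left, inner_hx_left]
  -- R, R₁, R₂
  have hR : ExpGrowth (fun φ => c₁ φ * c₂ φ) := gc₁.mul gc₂
  have hR₁ : ExpGrowth (fun φ => L₁ φ * c₂ φ + c₁ φ * L₂ φ) := (gL₁.mul gc₂).add (gc₁.mul gL₂)
  have hR₂ : ExpGrowth (fun φ => (κ₁ * c₂ φ + L₁ φ * L₂' φ) + (L₁' φ * L₂ φ + c₁ φ * κ₂)) :=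
    (((gc₂.const_mul κ₁)).add (gL₁.mul gL₂')).add ((gL₁'.mul gL₂).add (gc₁.mul (ExpGrowth.const κ₂)))
  have hD₁ : DerivAlong (hx w c m2 x a) (fun φ => c₁ φ * c₂ φ) (fun φ => L₁ φ * c₂ φ + c₁ φ * L₂ φ) := dc₁.mul dc₂
  have hD₂ : DerivAlong (hx w c m2 x' b) (fun φ => L₁ φ * c₂ φ + c₁ φ * L₂ φ)
      (fun φ => (κ₁ * c₂ φ + L₁ φ * L₂' φ) + (L₁' φ * L₂ φ + c₁ φ * κ₂)) := (dL₁.mul dc₂').add (dc₁'.mul dL₂)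
  have hmain := integral_legs_mul C η w c m2 hw hm a b x x' hR hR₁ hR₂ hD₁ hD₂
  simp only [hc₁, hc₂] at hmain
  rw [hmain]
  -- evaluate ∫W₀R₂: four Gaussian integrals
  have iA := ExpGrowth.integrable C η w c m2 hw hm (gc₂.const_mul κ₁)
  have iB := ExpGrowth.integrable C η w c m2 hw hm (gL₁.mul gL₂')
  have iC := ExpGrowth.integrable C η w c m2 hw hm (gL₁'.mul gL₂)
  have iD := ExpGrowth.integrable C η w c m2 hw hm (gc₁.mul (ExpGrowth.const κ₂))
  have esplit : (fun φ : Cfg P j N => W0 φ * ((κ₁ * c₂ φ + L₁ φ * L₂' φ) + (L₁' φ * L₂ φ + c₁ φ * κ₂))) =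
      fun φ => (W0 φ * (κ₁ * c₂ φ) + W0 φ * (L₁ φ * L₂' φ)) + (W0 φ * (L₁' φ * L₂ φ) + W0 φ * (c₁ φ * κ₂)) := by
    funext φ; ring
  rw [esplit, integral_add4 iA iB iC iD]
  -- (A) κ₁·∫W₀c₂ and (D) κ₂·∫W₀c₁
  have eA : ∫ φ, W0 φ * (κ₁ * c₂ φ) = κ₁ * ((∫ φ, W0 φ) * (G w c m2 y₂ y₂' * trE Q₂)) := by
    rw [← moment2_op C η w c m2 hw hm y₂ y₂' Q₂, ← integral_const_mul]
    refine integral_congr_ae (Filter.Eventually.of_forall fun φ => ?_)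
    simp only [hc₂]; ring
  have eD : ∫ φ, W0 φ * (c₁ φ * κ₂) = κ₂ * ((∫ φ, W0 φ) * (G w c m2 y₁ y₁' * trE Q₁)) := by
    rw [← moment2_op C η w c m2 hw hm y₁ y₁' Q₁, ← integral_const_mul]
    refine integral_congr_ae (Filter.Eventually.of_forall fun φ => ?_)
    simp only [hc₁]; ring
  -- (B) ∫W₀L₁L₂′ and (C) ∫W₀L₁′L₂: four `moment2` each
  have mm : ∀ (α β : ℝ) (z z' : Site P j) (u v : EuclideanSpace ℝ (Fin N)),
      ∫ φ, W0 φ * (α * ⟪φ z, u⟫_ℝ * (β * ⟪φ z', v⟫_ℝ)) = α * β * ((∫ φ, W0 φ) * (G w c m2 z z' * ⟪u, v⟫_ℝ)) := by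
    intro α β z z' u v
    rw [← moment2 C η w c m2 hw hm z z' u v, ← integral_const_mul]
    refine integral_congr_ae (Filter.Eventually.of_forall fun φ => ?_)
    ring
  have iLL : ∀ (α β : ℝ) (z z' : Site P j) (u v : EuclideanSpace ℝ (Fin N)),
      Integrable (fun φ : Cfg P j N => W0 φ * (α * ⟪φ z, u⟫_ℝ * (β * ⟪φ z', v⟫_ℝ))) := fun α β z z' u v =>
    ExpGrowth.integrable C η w c m2 hw hm (((ExpGrowth.inner_apply z u).const_mul α).mul
      ((ExpGrowth.inner_apply z' v).const_mul β))
  have eB : ∫ φ, W0 φ * (L₁ φ * L₂' φ) = (∫ φ, W0 φ) *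
      (G w c m2 y₁ x * G w c m2 y₂ x' * (G w c m2 y₁' y₂' *
          ⟪ContinuousLinearMap.adjoint Q₁ (𝐞 a), ContinuousLinearMap.adjoint Q₂ (𝐞 b)⟫_ℝ)
        + G w c m2 y₁ x * G w c m2 y₂' x' * (G w c m2 y₁' y₂ * ⟪ContinuousLinearMap.adjoint Q₁ (𝐞 a), Q₂ (𝐞 b)⟫_ℝ)
        + G w c m2 y₁' x * G w c m2 y₂ x' * (G w c m2 y₁ y₂' * ⟪Q₁ (𝐞 a), ContinuousLinearMap.adjoint Q₂ (𝐞 b)⟫_ℝ)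
        + G w c m2 y₁' x * G w c m2 y₂' x' * (G w c m2 y₁ y₂ * ⟪Q₁ (𝐞 a), Q₂ (𝐞 b)⟫_ℝ)) := by
    have e : (fun φ : Cfg P j N => W0 φ * (L₁ φ * L₂' φ)) = fun φ =>
        (W0 φ * (G w c m2 y₁ x * ⟪φ y₁', ContinuousLinearMap.adjoint Q₁ (𝐞 a)⟫_ℝ *
            (G w c m2 y₂ x' * ⟪φ y₂', ContinuousLinearMap.adjoint Q₂ (𝐞 b)⟫_ℝ))
          + W0 φ * (G w c m2 y₁ x * ⟪φ y₁', ContinuousLinearMap.adjoint Q₁ (𝐞 a)⟫_ℝ *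
            (G w c m2 y₂' x' * ⟪φ y₂, Q₂ (𝐞 b)⟫_ℝ)))
        + (W0 φ * (G w c m2 y₁' x * ⟪φ y₁, Q₁ (𝐞 a)⟫_ℝ * (G w c m2 y₂ x' * ⟪φ y₂', ContinuousLinearMap.adjoint Q₂ (𝐞 b)⟫_ℝ))
          + W0 φ * (G w c m2 y₁' x * ⟪φ y₁, Q₁ (𝐞 a)⟫_ℝ * (G w c m2 y₂' x' * ⟪φ y₂, Q₂ (𝐞 b)⟫_ℝ))) := by
      funext φ; simp only [hL₁, hL₂']; ring
    rw [e, integral_add4 (iLL _ _ _ _ _ _) (iLL _ _ _ _ _ _) (iLL _ _ _ _ _ _) (iLL _ _ _ _ _ _), mm, mm, mm, mm]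
    ring
  have eC : ∫ φ, W0 φ * (L₁' φ * L₂ φ) = (∫ φ, W0 φ) *
      (G w c m2 y₁ x' * G w c m2 y₂ x * (G w c m2 y₁' y₂' *
          ⟪ContinuousLinearMap.adjoint Q₁ (𝐞 b), ContinuousLinearMap.adjoint Q₂ (𝐞 a)⟫_ℝ)
        + G w c m2 y₁ x' * G w c m2 y₂' x * (G w c m2 y₁' y₂ * ⟪ContinuousLinearMap.adjoint Q₁ (𝐞 b), Q₂ (𝐞 a)⟫_ℝ)
        + G w c m2 y₁' x' * G w c m2 y₂ x * (G w c m2 y₁ y₂' * ⟪Q₁ (𝐞 b), ContinuousLinearMap.adjoint Q₂ (𝐞 a)⟫_ℝ)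
        + G w c m2 y₁' x' * G w c m2 y₂' x * (G w c m2 y₁ y₂ * ⟪Q₁ (𝐞 b), Q₂ (𝐞 a)⟫_ℝ)) := by
    have e : (fun φ : Cfg P j N => W0 φ * (L₁' φ * L₂ φ)) = fun φ =>
        (W0 φ * (G w c m2 y₁ x' * ⟪φ y₁', ContinuousLinearMap.adjoint Q₁ (𝐞 b)⟫_ℝ *
            (G w c m2 y₂ x * ⟪φ y₂', ContinuousLinearMap.adjoint Q₂ (𝐞 a)⟫_ℝ))
          + W0 φ * (G w c m2 y₁ x' * ⟪φ y₁', ContinuousLinearMap.adjoint Q₁ (𝐞 b)⟫_ℝ *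
            (G w c m2 y₂' x * ⟪φ y₂, Q₂ (𝐞 a)⟫_ℝ)))
        + (W0 φ * (G w c m2 y₁' x' * ⟪φ y₁, Q₁ (𝐞 b)⟫_ℝ * (G w c m2 y₂ x * ⟪φ y₂', ContinuousLinearMap.adjoint Q₂ (𝐞 a)⟫_ℝ))
          + W0 φ * (G w c m2 y₁' x' * ⟪φ y₁, Q₁ (𝐞 b)⟫_ℝ * (G w c m2 y₂' x * ⟪φ y₂, Q₂ (𝐞 a)⟫_ℝ))) := by
      funext φ; simp only [hL₁', hL₂]; ring
    rw [e, integral_add4 (iLL _ _ _ _ _ _) (iLL _ _ _ _ _ _) (iLL _ _ _ _ _ _) (iLL _ _ _ _ _ _), mm, mm, mm, mm]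
    ring
  rw [eA, eB, eC, eD, hκ₁, hκ₂]
  ring

end Wick

/-! ## §6 Second-order perturbation theory in the charge: `G″_{ab}(0)(x,x′)` -/

section SecondOrder

/-- the Gaussian weight `W₀(φ) = e^{−½⟨φ,(−Δ^η_0+m²)φ⟩}` of the free scalar field (notation local to this file). [folklore] -/
local notation "W0" => weight C η w c m2 (0 : VecField P j ℝ)

/-- the standard orthonormal basis vector `e_a` of `R^N` (notation local to this file). [folklore] -/
local notation "𝐞" => EuclideanSpace.basisFun (Fin N) ℝ

/-- `adjoint q = −q` (antisymmetry, B1 p. 605). [cite: Balaban1982Higgs1, (1.7) p.605] -/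
theorem adjoint_q : ContinuousLinearMap.adjoint C.q = -C.q := by
  rw [← ContinuousLinearMap.star_eq_adjoint, C.q_skew]

/-- `⟪qu, qv⟫ = −⟪u, q²v⟫`. [cite: Balaban1982Higgs1, (1.7) p.605] -/
theorem inner_q_q (u v : EuclideanSpace ℝ (Fin N)) : ⟪C.q u, C.q v⟫_ℝ = -⟪u, C.q (C.q v)⟫_ℝ :=
  B3WT226Pairings.inner_q_left C u (C.q v)

/-- `⟪u, q²v⟫ = ⟪v, q²u⟫` (`q²` is symmetric). [cite: Balaban1982Higgs1, (1.7) p.605] -/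
theorem inner_qq_comm (u v : EuclideanSpace ℝ (Fin N)) : ⟪u, C.q (C.q v)⟫_ℝ = ⟪v, C.q (C.q u)⟫_ℝ := by
  have h1 := inner_q_q C u v
  have h2 := inner_q_q C v u
  rw [real_inner_comm (C.q u)] at h2
  linarith

/-- **`∫ D₂(0)·e^{−S_0}·F` AS A SUM OVER THE BONDS** (the `A`-integrals done: `⟨A_b²⟩ = C^ε(y,y)`, `⟨A_bA_{b′}⟩ = δ_{μμ′}C^ε(y,y′)`):
`∫ D₂(0)e^{−S_0}F = Z_A·[Σ_b η^dc²η²·C^ε(b₋,b₋)·∫W₀⟪φ(b₋),q²φ(b₊)⟫F + Σ_{b,b′: μ=μ′}(η^dc²η)²·C^ε(b₋,b′₋)·∫W₀⟪φ(b₋),qφ(b₊)⟫⟪φ(b′₋),qφ(b′₊)⟫F]`.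
[cite: Balaban1983Higgs3, (1.21)–(1.22) p.416] -/
theorem integral_D2_J_zero (hw : 0 < w) (hm : 0 < m2) (hμ : 0 < μ2) {F : Cfg P j N → ℝ} (hF : ExpGrowth F) :
    ∫ p : JCfg P j N, D2 C η w c 0 (toVec p.1) p.2 * J C η w c m2 μ2 0 p * F p.2 =
      (∫ A : Cfg P j P.d, WA η w c μ2 A) *
        ((∑ b : PBond P j, w * (c ^ 2 * η ^ 2) * G w c μ2 b.src b.src *
            ∫ φ, W0 φ * (⟪φ b.src, C.q (C.q (φ b.tgt))⟫_ℝ * F φ))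
          + ∑ b : PBond P j, ∑ b' : PBond P j, (w * (c ^ 2 * η)) * (w * (c ^ 2 * η)) *
              (G w c μ2 b.src b'.src * if b.dir = b'.dir then 1 else 0) *
                ∫ φ, W0 φ * (⟪φ b.src, C.q (φ b.tgt)⟫_ℝ * ⟪φ b'.src, C.q (φ b'.tgt)⟫_ℝ * F φ)) := by
  -- expand the integrand
  have hexp : (fun p : JCfg P j N => D2 C η w c 0 (toVec p.1) p.2 * J C η w c m2 μ2 0 p * F p.2) =
      fun p => (∑ b : PBond P j, (w * (c ^ 2 * η ^ 2)) * (WA η w c μ2 p.1 * (toVec p.1 b * toVec p.1 b) *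
          (W0 p.2 * (⟪p.2 b.src, C.q (C.q (p.2 b.tgt))⟫_ℝ * F p.2))))
        + ∑ b : PBond P j, ∑ b' : PBond P j, ((w * (c ^ 2 * η)) * (w * (c ^ 2 * η))) *
            (WA η w c μ2 p.1 * (toVec p.1 b * toVec p.1 b') *
              (W0 p.2 * (⟪p.2 b.src, C.q (p.2 b.tgt)⟫_ℝ * ⟪p.2 b'.src, C.q (p.2 b'.tgt)⟫_ℝ * F p.2))) := by
    funext p
    rw [D2_zero, D1_zero, J_zero]
    set X : PBond P j → ℝ := fun b => w * (c ^ 2 * ((η * toVec p.1 b) * ⟪p.2 b.src, C.q (p.2 b.tgt)⟫_ℝ)) with hX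
    have hsq : (∑ b : PBond P j, X b) ^ 2 = ∑ b : PBond P j, ∑ b' : PBond P j, X b * X b' := by
      rw [sq, Finset.sum_mul_sum]
    rw [hsq, add_mul, add_mul, Finset.sum_mul, Finset.sum_mul, Finset.sum_mul, Finset.sum_mul]
    congr 1
    · exact Finset.sum_congr rfl fun b _ => by ring
    · refine Finset.sum_congr rfl fun b _ => ?_
      rw [Finset.sum_mul, Finset.sum_mul]
      exact Finset.sum_congr rfl fun b' _ => by simp only [hX]; ring
  have hI1 : ∀ b : PBond P j, Integrable (fun p : JCfg P j N => WA η w c μ2 p.1 * (toVec p.1 b * toVec p.1 b) *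
      (W0 p.2 * (⟪p.2 b.src, C.q (C.q (p.2 b.tgt))⟫_ℝ * F p.2))) := fun b =>
    integrable_prod_WA_W0 C η w c m2 μ2 hw hm hμ ((ExpGrowth.inner_apply b.src _).mul (ExpGrowth.inner_apply b.src _))
      ((ExpGrowth.inner_op_apply b.src b.tgt (C.q.comp C.q)).mul hF)
  have hI2 : ∀ b b' : PBond P j, Integrable (fun p : JCfg P j N => WA η w c μ2 p.1 * (toVec p.1 b * toVec p.1 b') *
      (W0 p.2 * (⟪p.2 b.src, C.q (p.2 b.tgt)⟫_ℝ * ⟪p.2 b'.src, C.q (p.2 b'.tgt)⟫_ℝ * F p.2))) := fun b b' =>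
    integrable_prod_WA_W0 C η w c m2 μ2 hw hm hμ ((ExpGrowth.inner_apply b.src _).mul (ExpGrowth.inner_apply b'.src _))
      (((ExpGrowth.inner_op_apply b.src b.tgt C.q).mul (ExpGrowth.inner_op_apply b'.src b'.tgt C.q)).mul hF)
  have hS1 : Integrable (fun p : JCfg P j N => ∑ b : PBond P j, (w * (c ^ 2 * η ^ 2)) *
      (WA η w c μ2 p.1 * (toVec p.1 b * toVec p.1 b) * (W0 p.2 * (⟪p.2 b.src, C.q (C.q (p.2 b.tgt))⟫_ℝ * F p.2)))) :=
    integrable_finsetSum _ fun b _ => (hI1 b).const_mul _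
  have hS2 : Integrable (fun p : JCfg P j N => ∑ b : PBond P j, ∑ b' : PBond P j, ((w * (c ^ 2 * η)) * (w * (c ^ 2 * η))) *
      (WA η w c μ2 p.1 * (toVec p.1 b * toVec p.1 b') *
        (W0 p.2 * (⟪p.2 b.src, C.q (p.2 b.tgt)⟫_ℝ * ⟪p.2 b'.src, C.q (p.2 b'.tgt)⟫_ℝ * F p.2)))) :=
    integrable_finsetSum _ fun b _ => integrable_finsetSum _ fun b' _ => (hI2 b b').const_mul _
  rw [hexp, integral_add hS1 hS2, integral_finsetSum _ (fun b _ => (hI1 b).const_mul _),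
    integral_finsetSum _ (fun b _ => integrable_finsetSum _ fun b' _ => (hI2 b b').const_mul _), mul_add,
    Finset.mul_sum, Finset.mul_sum]
  congr 1
  · refine Finset.sum_congr rfl fun b _ => ?_
    rw [integral_const_mul, integral_prod_WA_W0 C η w c m2 μ2 (fun A => toVec A b * toVec A b)
      (fun φ => ⟪φ b.src, C.q (C.q (φ b.tgt))⟫_ℝ * F φ), integral_WA_toVec_toVec η w c μ2 hw hμ b b, if_pos rfl]
    ring
  · refine Finset.sum_congr rfl fun b _ => ?_
    rw [integral_finsetSum _ (fun b' _ => (hI2 b b').const_mul _), Finset.mul_sum]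
    refine Finset.sum_congr rfl fun b' _ => ?_
    rw [integral_const_mul, integral_prod_WA_W0 C η w c m2 μ2 (fun A => toVec A b * toVec A b')
      (fun φ => ⟪φ b.src, C.q (φ b.tgt)⟫_ℝ * ⟪φ b'.src, C.q (φ b'.tgt)⟫_ℝ * F φ), integral_WA_toVec_toVec η w c μ2 hw hμ b b']
    ring

/-- the two external legs as an observable of the scalar field: `φ_a(x)φ_b(x′) = ⟪φ(x),e_a⟫⟪φ(x′),e_b⟫`. [cite: Balaban1983Higgs3, (1.19) p.416] -/
def legs (a b : Fin N) (x x' : Site P j) (φ : Cfg P j N) : ℝ :=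
  ⟪φ x, EuclideanSpace.basisFun (Fin N) ℝ a⟫_ℝ * ⟪φ x', EuclideanSpace.basisFun (Fin N) ℝ b⟫_ℝ

omit C η w c m2 in
/-- the legs have exponential-linear growth. [cite: Balaban1983Higgs3, (1.19) p.416] -/
theorem expGrowth_legs (a b : Fin N) (x x' : Site P j) : ExpGrowth (legs a b x x' : Cfg P j N → ℝ) :=
  (ExpGrowth.inner_apply x _).mul (ExpGrowth.inner_apply x' _)

/-- (1.19) as the quotient `N(e)/Z(e)` of the two integrals. [cite: Balaban1983Higgs3, (1.19) p.416] -/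
theorem twoPt_eq (e : ℝ) (a b : Fin N) (x x' : Site P j) :
    twoPt C η w c m2 μ2 e a b x x' =
      (∫ p : JCfg P j N, J C η w c m2 μ2 e p * legs a b x x' p.2) / ∫ p : JCfg P j N, J C η w c m2 μ2 e p * (1 : ℝ) := by
  simp only [twoPt, legs, mul_one]

/-- **FIRST-ORDER PERTURBATION THEORY IN THE CHARGE, AT EVERY `e`**: `G_e = N(e)/Z(e)` is differentiable with
`G′_e = (N′Z − NZ′)/Z²`, `N′(e) = ∫D₁(e)e^{−S_e}φ_aφ_b`, `Z′(e) = ∫D₁(e)e^{−S_e}`. [cite: Balaban1983Higgs3, (1.19)–(1.21) p.416] -/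
theorem hasDerivAt_twoPt (hw : 0 < w) (hm : 0 < m2) (hμ : 0 < μ2) (a b : Fin N) (x x' : Site P j) (e₀ : ℝ) :
    HasDerivAt (fun e => twoPt C η w c m2 μ2 e a b x x')
      (((∫ p : JCfg P j N, D1 C η w c e₀ (toVec p.1) p.2 * J C η w c m2 μ2 e₀ p * legs a b x x' p.2) *
          (∫ p : JCfg P j N, J C η w c m2 μ2 e₀ p * (1 : ℝ))
        - (∫ p : JCfg P j N, J C η w c m2 μ2 e₀ p * legs a b x x' p.2) *
          (∫ p : JCfg P j N, D1 C η w c e₀ (toVec p.1) p.2 * J C η w c m2 μ2 e₀ p * (1 : ℝ))) /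
        (∫ p : JCfg P j N, J C η w c m2 μ2 e₀ p * (1 : ℝ)) ^ 2) e₀ := by
  have hN := (hasDerivAt_integral_J_mul C η w c m2 μ2 hw hm hμ (expGrowth_legs a b x x') e₀).2
  have hZ := (hasDerivAt_integral_J_mul (P := P) (j := j) C η w c m2 μ2 hw hm hμ (ExpGrowth.const (1 : ℝ)) e₀).2
  have hZ0 : (∫ p : JCfg P j N, J C η w c m2 μ2 e₀ p * (1 : ℝ)) ≠ 0 := by
    simp only [mul_one]; exact (integral_J_pos C η w c m2 μ2 hw hm hμ e₀).ne'
  have h := hN.div hZ hZ0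
  simp only [twoPt_eq]
  exact h

/-- **THE ORDER-e TERM VANISHES**: `G′_{ab}(0)(x,x′) = 0` — `N′(0) = Z′(0) = 0` (one vector leg against the even Gaussian).
[cite: Balaban1983Higgs3, (1.21) p.416] -/
theorem hasDerivAt_twoPt_zero (hw : 0 < w) (hm : 0 < m2) (hμ : 0 < μ2) (a b : Fin N) (x x' : Site P j) :
    HasDerivAt (fun e => twoPt C η w c m2 μ2 e a b x x') 0 0 := by
  have h := hasDerivAt_twoPt C η w c m2 μ2 hw hm hμ a b x x' 0
  rw [integral_D1_J_zero C η w c m2 μ2 hw hm hμ (expGrowth_legs a b x x'),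
    integral_D1_J_zero (P := P) (j := j) C η w c m2 μ2 hw hm hμ (ExpGrowth.const (1 : ℝ))] at h
  simpa using h

/-- **SECOND-ORDER PERTURBATION THEORY IN THE CHARGE: THE ORDER-e² COEFFICIENT EXISTS** — the first derivative
`(N′Z − NZ′)/Z²` (the derivative of `G_e` at every `e`, `hasDerivAt_twoPt`) is differentiable at `e = 0` with derivative
`(N″(0)Z(0) − N(0)Z″(0))/Z(0)²`, `N″(0) = ∫D₂(0)e^{−S_0}φ_aφ_b`, `Z″(0) = ∫D₂(0)e^{−S_0}` (the cross terms vanish with `N′(0) =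
Z′(0) = 0`). [cite: Balaban1983Higgs3, (1.19)–(1.21) p.416] -/
theorem hasDerivAt_deriv_twoPt_zero (hw : 0 < w) (hm : 0 < m2) (hμ : 0 < μ2) (a b : Fin N) (x x' : Site P j) :
    HasDerivAt (fun e =>
      ((∫ p : JCfg P j N, D1 C η w c e (toVec p.1) p.2 * J C η w c m2 μ2 e p * legs a b x x' p.2) *
          (∫ p : JCfg P j N, J C η w c m2 μ2 e p * (1 : ℝ))
        - (∫ p : JCfg P j N, J C η w c m2 μ2 e p * legs a b x x' p.2) *
          (∫ p : JCfg P j N, D1 C η w c e (toVec p.1) p.2 * J C η w c m2 μ2 e p * (1 : ℝ))) /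
        (∫ p : JCfg P j N, J C η w c m2 μ2 e p * (1 : ℝ)) ^ 2)
      (((∫ p : JCfg P j N, D2 C η w c 0 (toVec p.1) p.2 * J C η w c m2 μ2 0 p * legs a b x x' p.2) *
          (∫ p : JCfg P j N, J C η w c m2 μ2 0 p * (1 : ℝ))
        - (∫ p : JCfg P j N, J C η w c m2 μ2 0 p * legs a b x x' p.2) *
          (∫ p : JCfg P j N, D2 C η w c 0 (toVec p.1) p.2 * J C η w c m2 μ2 0 p * (1 : ℝ))) /
        (∫ p : JCfg P j N, J C η w c m2 μ2 0 p * (1 : ℝ)) ^ 2) 0 := by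
  have hN := (hasDerivAt_integral_J_mul C η w c m2 μ2 hw hm hμ (expGrowth_legs a b x x') 0).2
  have hZ := (hasDerivAt_integral_J_mul (P := P) (j := j) C η w c m2 μ2 hw hm hμ (ExpGrowth.const (1 : ℝ)) 0).2
  have hN' := (hasDerivAt_integral_D1_J_mul C η w c m2 μ2 hw hm hμ (expGrowth_legs a b x x') 0).2
  have hZ' := (hasDerivAt_integral_D1_J_mul (P := P) (j := j) C η w c m2 μ2 hw hm hμ (ExpGrowth.const (1 : ℝ)) 0).2
  have h0N := integral_D1_J_zero C η w c m2 μ2 hw hm hμ (expGrowth_legs a b x x')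
  have h0Z := integral_D1_J_zero (P := P) (j := j) C η w c m2 μ2 hw hm hμ (ExpGrowth.const (1 : ℝ))
  have hZ0 : (∫ p : JCfg P j N, J C η w c m2 μ2 0 p * (1 : ℝ)) ≠ 0 := by
    simp only [mul_one]; exact (integral_J_pos C η w c m2 μ2 hw hm hμ 0).ne'
  have hnum := (hN'.mul hZ).sub (hN.mul hZ')
  have hden := hZ.pow 2
  have h := hnum.div hden (pow_ne_zero 2 hZ0)
  refine h.congr_deriv ?_
  rw [h0N, h0Z]
  have hZ0' : (∫ p : JCfg P j N, J C η w c m2 μ2 0 p) ≠ 0 := (integral_J_pos C η w c m2 μ2 hw hm hμ 0).ne'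
  simp only [Pi.pow_apply, mul_one]
  field_simp
  ring

/-- **THE TAYLOR COEFFICIENTS OF (1.19) IN THE CHARGE, in Mathlib's `deriv`/`iteratedDeriv`**: `G′_e` is the quotient-rule
expression at every `e`, `G′(0) = 0`, and `iteratedDeriv 2 G (0) = (N″(0)Z(0) − N(0)Z″(0))/Z(0)²`. [cite: Balaban1983Higgs3, (1.21) p.416] -/
theorem iteratedDeriv_two_twoPt (hw : 0 < w) (hm : 0 < m2) (hμ : 0 < μ2) (a b : Fin N) (x x' : Site P j) :
    iteratedDeriv 2 (fun e => twoPt C η w c m2 μ2 e a b x x') 0 =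
      ((∫ p : JCfg P j N, D2 C η w c 0 (toVec p.1) p.2 * J C η w c m2 μ2 0 p * legs a b x x' p.2) *
          (∫ p : JCfg P j N, J C η w c m2 μ2 0 p * (1 : ℝ))
        - (∫ p : JCfg P j N, J C η w c m2 μ2 0 p * legs a b x x' p.2) *
          (∫ p : JCfg P j N, D2 C η w c 0 (toVec p.1) p.2 * J C η w c m2 μ2 0 p * (1 : ℝ))) /
        (∫ p : JCfg P j N, J C η w c m2 μ2 0 p * (1 : ℝ)) ^ 2 := by
  have hd : deriv (fun e => twoPt C η w c m2 μ2 e a b x x') = fun e =>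
      ((∫ p : JCfg P j N, D1 C η w c e (toVec p.1) p.2 * J C η w c m2 μ2 e p * legs a b x x' p.2) *
          (∫ p : JCfg P j N, J C η w c m2 μ2 e p * (1 : ℝ))
        - (∫ p : JCfg P j N, J C η w c m2 μ2 e p * legs a b x x' p.2) *
          (∫ p : JCfg P j N, D1 C η w c e (toVec p.1) p.2 * J C η w c m2 μ2 e p * (1 : ℝ))) /
        (∫ p : JCfg P j N, J C η w c m2 μ2 e p * (1 : ℝ)) ^ 2 := by
    funext e
    exact (hasDerivAt_twoPt C η w c m2 μ2 hw hm hμ a b x x' e).deriv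
  rw [iteratedDeriv_succ, iteratedDeriv_one, hd]
  exact (hasDerivAt_deriv_twoPt_zero C η w c m2 μ2 hw hm hμ a b x x').deriv

/-- **THE CONNECTED FOUR-PROPAGATOR BRACKET OF TERM ④ IN UNITARITY FORM** — the two cubic vertices
`⟪φ(b₋),qφ(b₊)⟫A_b`, `⟪φ(b′₋),qφ(b′₊)⟫A_{b′}` with one scalar leg each to the external points `u`, `v` and one scalar line between
them (the four ways of choosing which end of each bond carries the external leg; signs from `q* = −q`):
`Bk(b,b′;u,v) = −C₀(b₋,u)C₀(b′₋,v)C₀(b₊,b′₊) + C₀(b₋,u)C₀(b′₊,v)C₀(b₊,b′₋) + C₀(b₊,u)C₀(b′₋,v)C₀(b₋,b′₊) − C₀(b₊,u)C₀(b′₊,v)C₀(b₋,b′₋)`;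
`c²·Bk` is the print's `∂C₀·∂C₀·C₀`-form (`Bk_eq_print`). [cite: Balaban1983Higgs3, (1.22) term ④ p.416] -/
def Bk (b b' : PBond P j) (u v : Site P j) : ℝ :=
  -(G w c m2 b.src u * G w c m2 b'.src v * G w c m2 b.tgt b'.tgt)
    + G w c m2 b.src u * G w c m2 b'.tgt v * G w c m2 b.tgt b'.src
    + G w c m2 b.tgt u * G w c m2 b'.src v * G w c m2 b.src b'.tgt
    - G w c m2 b.tgt u * G w c m2 b'.tgt v * G w c m2 b.src b'.src

/-- **THE ORDER-e² COEFFICIENT OF (1.19) BY WICK'S THEOREM (unitarity form)** — all disconnected pieces (the vacuum bubbles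
`tr q²·C₀(b₋,b₊)` of the quartic vertex and the `∫W₀·cur·cur` bubbles of the cubic pair, i.e. the `Z″(0)` subtraction) CANCEL in
`(N″Z − NZ″)/Z²`, the `tr q = 0` loops vanish, and what is left is `C₀·[② + ④]·C₀` with the charge matrix `(q²)_{ab}` factored:
`d²/de²|₀ G_{ab}(x,x′) = ⟪e_a,q²e_b⟫·[ Σ_b η^dc²η²·C^ε(b₋,b₋)·(C₀(b₋,x)C₀(b₊,x′) + C₀(b₊,x)C₀(b₋,x′))`
`  + Σ_{b,b′: μ_b=μ_{b′}} (η^dc²η)²·C^ε(b₋,b′₋)·(Bk(b,b′;x,x′) + Bk(b,b′;x′,x)) ]`.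
[cite: Balaban1983Higgs3, (1.21)–(1.22) terms ②, ④ p.416] [cite: GlimmJaffeQP1987, §8.3 (Wick/integration by parts)] -/
theorem iteratedDeriv_two_twoPt_eq_wick (hw : 0 < w) (hm : 0 < m2) (hμ : 0 < μ2) (a b : Fin N) (x x' : Site P j) :
    iteratedDeriv 2 (fun e => twoPt C η w c m2 μ2 e a b x x') 0 =
      ⟪𝐞 a, C.q (C.q (𝐞 b))⟫_ℝ *
        ((∑ l : PBond P j, w * (c ^ 2 * η ^ 2) * G w c μ2 l.src l.src *
            (G w c m2 l.src x * G w c m2 l.tgt x' + G w c m2 l.tgt x * G w c m2 l.src x'))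
          + ∑ l : PBond P j, ∑ l' : PBond P j, (w * (c ^ 2 * η)) * (w * (c ^ 2 * η)) *
              (G w c μ2 l.src l'.src * if l.dir = l'.dir then 1 else 0) *
                (Bk w c m2 l l' x x' + Bk w c m2 l l' x' x)) := by
  -- `Z(0) = Z_A·Z_φ`
  have hZ0 : ∫ p : JCfg P j N, J C η w c m2 μ2 0 p * (1 : ℝ) =
      (∫ A : Cfg P j P.d, WA η w c μ2 A) * ∫ φ : Cfg P j N, W0 φ := by
    have h := integral_prod_WA_W0 (P := P) (j := j) C η w c m2 μ2 (fun _ : Cfg P j P.d => (1 : ℝ))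
      (fun _ : Cfg P j N => (1 : ℝ))
    simp only [mul_one] at h ⊢
    rw [← h]
    exact integral_congr_ae (Filter.Eventually.of_forall fun p => by dsimp only; rw [J_zero])
  -- `N(0) = Z_A·Z_φ·C₀(x′,x)δ_{ab}`
  have hN0 : ∫ p : JCfg P j N, J C η w c m2 μ2 0 p * legs a b x x' p.2 =
      (∫ A : Cfg P j P.d, WA η w c μ2 A) * ((∫ φ : Cfg P j N, W0 φ) * (G w c m2 x' x * ⟪𝐞 a, 𝐞 b⟫_ℝ)) := by
    have h := integral_prod_WA_W0 C η w c m2 μ2 (fun _ => (1 : ℝ)) (fun φ => ⟪φ x, 𝐞 a⟫_ℝ * ⟪φ x', 𝐞 b⟫_ℝ)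
    simp only [mul_one] at h
    rw [G_symm w c m2 x' x, ← moment2 C η w c m2 hw hm x x' (𝐞 a) (𝐞 b), ← h]
    exact integral_congr_ae (Filter.Eventually.of_forall fun p => by dsimp only; rw [J_zero, legs]; ring)
  -- `Z″(0) = Z_A·[Z_φ·tr q²·Σ_b κ₁C^ε(b₋,b₋)C₀(b₋,b₊) + Σ_{bb′}κ₂C^ε δ ∫W₀·cur_b·cur_{b′}]`
  have hZ2 : ∫ p : JCfg P j N, D2 C η w c 0 (toVec p.1) p.2 * J C η w c m2 μ2 0 p * (1 : ℝ) =
      (∫ A : Cfg P j P.d, WA η w c μ2 A) *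
        ((∫ φ : Cfg P j N, W0 φ) * trE (C.q.comp C.q) *
            (∑ l : PBond P j, w * (c ^ 2 * η ^ 2) * G w c μ2 l.src l.src * G w c m2 l.src l.tgt)
          + ∑ l : PBond P j, ∑ l' : PBond P j, (w * (c ^ 2 * η)) * (w * (c ^ 2 * η)) *
              (G w c μ2 l.src l'.src * if l.dir = l'.dir then 1 else 0) *
                ∫ φ, W0 φ * (⟪φ l.src, C.q (φ l.tgt)⟫_ℝ * ⟪φ l'.src, C.q (φ l'.tgt)⟫_ℝ)) := by
    rw [integral_D2_J_zero (P := P) (j := j) C η w c m2 μ2 hw hm hμ (ExpGrowth.const (1 : ℝ))]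
    simp only [mul_one]
    congr 2
    rw [Finset.mul_sum]
    refine Finset.sum_congr rfl fun l _ => ?_
    have hm2 := moment2_op C η w c m2 hw hm l.src l.tgt (C.q.comp C.q)
    simp only [ContinuousLinearMap.coe_comp, Function.comp_apply] at hm2
    rw [hm2]
    ring
  -- `N″(0)`: the quartic vertex against the legs (`integral_legs_cur`), the cubic pair against the legs (`integral_legs_cur_cur`)
  have hN2 : ∫ p : JCfg P j N, D2 C η w c 0 (toVec p.1) p.2 * J C η w c m2 μ2 0 p * legs a b x x' p.2 =
      (∫ A : Cfg P j P.d, WA η w c μ2 A) *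
        ((∫ φ : Cfg P j N, W0 φ) *
            ((G w c m2 x' x * ⟪𝐞 a, 𝐞 b⟫_ℝ) * trE (C.q.comp C.q) *
                (∑ l : PBond P j, w * (c ^ 2 * η ^ 2) * G w c μ2 l.src l.src * G w c m2 l.src l.tgt)
              + ⟪𝐞 a, C.q (C.q (𝐞 b))⟫_ℝ *
                ∑ l : PBond P j, w * (c ^ 2 * η ^ 2) * G w c μ2 l.src l.src *
                  (G w c m2 l.src x * G w c m2 l.tgt x' + G w c m2 l.tgt x * G w c m2 l.src x'))
          + ((G w c m2 x' x * ⟪𝐞 a, 𝐞 b⟫_ℝ) *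
                (∑ l : PBond P j, ∑ l' : PBond P j, (w * (c ^ 2 * η)) * (w * (c ^ 2 * η)) *
                  (G w c μ2 l.src l'.src * if l.dir = l'.dir then 1 else 0) *
                    ∫ φ, W0 φ * (⟪φ l.src, C.q (φ l.tgt)⟫_ℝ * ⟪φ l'.src, C.q (φ l'.tgt)⟫_ℝ))
              + (∫ φ : Cfg P j N, W0 φ) * (⟪𝐞 a, C.q (C.q (𝐞 b))⟫_ℝ *
                  ∑ l : PBond P j, ∑ l' : PBond P j, (w * (c ^ 2 * η)) * (w * (c ^ 2 * η)) *
                    (G w c μ2 l.src l'.src * if l.dir = l'.dir then 1 else 0) *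
                      (Bk w c m2 l l' x x' + Bk w c m2 l l' x' x)))) := by
    rw [integral_D2_J_zero C η w c m2 μ2 hw hm hμ (expGrowth_legs a b x x')]
    congr 1
    congr 1
    · -- the quartic vertex: bubble + the two connected legs-through-the-vertex terms
      rw [Finset.mul_sum, Finset.mul_sum, ← Finset.sum_add_distrib, Finset.mul_sum]
      refine Finset.sum_congr rfl fun l _ => ?_
      have h1 := integral_legs_cur C η w c m2 hw hm a b x x' l.src l.tgt (C.q.comp C.q)
      simp only [ContinuousLinearMap.coe_comp, Function.comp_apply] at h1
      have hI : ∫ φ, W0 φ * (⟪φ l.src, C.q (C.q (φ l.tgt))⟫_ℝ * legs a b x x' φ) =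
          ∫ φ, W0 φ * (⟪φ x, 𝐞 a⟫_ℝ * ⟪φ x', 𝐞 b⟫_ℝ * ⟪φ l.src, C.q (C.q (φ l.tgt))⟫_ℝ) :=
        integral_congr_ae (Filter.Eventually.of_forall fun φ => by dsimp only; rw [legs]; ring)
      rw [hI, h1, inner_qq_comm C (𝐞 b) (𝐞 a)]
      ring
    · -- the cubic pair: bubble·legs + the eight connected terms (`tr q = 0` kills the one-loop-one-line terms)
      simp only [Finset.mul_sum, ← Finset.sum_add_distrib]
      refine Finset.sum_congr rfl fun l _ => Finset.sum_congr rfl fun l' _ => ?_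
      have h2 := integral_legs_cur_cur C η w c m2 hw hm a b x x' l.src l.tgt l'.src l'.tgt C.q C.q
      simp only [adjoint_q, neg_apply, inner_neg_left, inner_neg_right, neg_neg, B3WT226FreeGaussian.trE_q, inner_q_q,
        inner_qq_comm C (𝐞 b) (𝐞 a), mul_zero, add_zero, zero_add] at h2
      have hI : ∫ φ, W0 φ * (⟪φ l.src, C.q (φ l.tgt)⟫_ℝ * ⟪φ l'.src, C.q (φ l'.tgt)⟫_ℝ * legs a b x x' φ) =
          ∫ φ, W0 φ * (⟪φ x, 𝐞 a⟫_ℝ * ⟪φ x', 𝐞 b⟫_ℝ * (⟪φ l.src, C.q (φ l.tgt)⟫_ℝ * ⟪φ l'.src, C.q (φ l'.tgt)⟫_ℝ)) :=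
        integral_congr_ae (Filter.Eventually.of_forall fun φ => by dsimp only; rw [legs]; ring)
      rw [hI, h2, Bk, Bk]
      ring
  have hZφ0 : (∫ φ : Cfg P j N, W0 φ) ≠ 0 := (B3WT226Traces.Z_pos C η w c m2 hw hm).ne'
  have hZA0 : (∫ A : Cfg P j P.d, WA η w c μ2 A) ≠ 0 := (ZA_pos η w c μ2 hw hμ).ne'
  rw [iteratedDeriv_two_twoPt C η w c m2 μ2 hw hm hμ, hN2, hZ0, hN0, hZ2]
  field_simp
  ring

/-! ## §7 The print's form — `η·c = 1` (`c = ε⁻¹`), bonds as (initial point, direction), r15's `∂^ε`-kernels `d1Kernel` /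
`dKernel`, and the dictionary to p26's typed terms `B3Eq123Counterterms.sig2` (②) and `sig4` (④) -/

open B3Eq123Counterterms B3Sect3ScalarSelfEnergy

omit C η w c m2 in
/-- a sum over the positively oriented bonds is the double sum over initial points and directions (`b = ⟨y, y + εe_μ⟩`).
[cite: Balaban1982Higgs1, (1.4) p.604] -/
theorem sum_bond (F : PBond P j → ℝ) : ∑ l : PBond P j, F l = ∑ y : Site P j, ∑ μ : Fin P.d, F ⟨y, μ⟩ :=
  calc ∑ l : PBond P j, F l = ∑ p : Site P j × Fin P.d, F (bondEquiv p) :=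
        (Equiv.sum_comp (bondEquiv (P := P) (j := j)) F).symm
    _ = ∑ y : Site P j, ∑ μ : Fin P.d, F ⟨y, μ⟩ := Fintype.sum_prod_type _

omit C η w c m2 in
/-- a double bond sum against `δ_{μ_b μ_{b′}}` (the direction-diagonal vector covariance `⟨A_bA_{b′}⟩ = δ_{μμ′}C^ε(b₋,b′₋)` in the
Feynman gauge) is `Σ_{y,y′}Σ_μ` over the two initial points and the common direction. [cite: Balaban1983Higgs3, (1.20) p.416] -/
theorem sum_bond_bond_dir (F : PBond P j → PBond P j → ℝ) :
    ∑ l : PBond P j, ∑ l' : PBond P j, (if l.dir = l'.dir then (1 : ℝ) else 0) * F l l' =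
      ∑ y : Site P j, ∑ y' : Site P j, ∑ μ : Fin P.d, F ⟨y, μ⟩ ⟨y', μ⟩ := by
  rw [sum_bond]
  refine Finset.sum_congr rfl fun y _ => ?_
  simp only [sum_bond, ite_mul, one_mul, zero_mul, Finset.sum_ite_eq, Finset.mem_univ, if_true]
  rw [Finset.sum_comm]

omit C η in
/-- the bracket `Bk` is symmetric under exchanging the two vertices together with the two external legs (all propagators are
symmetric kernels). [cite: Balaban1983Higgs3, (1.22) term ④ p.416] -/
theorem Bk_swap (μ : Fin P.d) (y y' u v : Site P j) :
    G w c μ2 y' y * Bk w c m2 ⟨y', μ⟩ ⟨y, μ⟩ v u = G w c μ2 y y' * Bk w c m2 ⟨y, μ⟩ ⟨y', μ⟩ u v := by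
  simp only [Bk, PBond.tgt]
  rw [G_symm w c μ2 y' y, G_symm w c m2 (y'.shift μ) (y.shift μ), G_symm w c m2 (y'.shift μ) y,
    G_symm w c m2 y' (y.shift μ), G_symm w c m2 y' y]
  ring

omit C η in
/-- … hence the legs-exchanged double sum equals the direct one: `Σ_{y,y′,μ}C^ε(y,y′)Bk(x′,x) = Σ_{y,y′,μ}C^ε(y,y′)Bk(x,x′)`.
[cite: Balaban1983Higgs3, (1.22) term ④ p.416] -/
theorem sum_Bk_swap (κ : ℝ) (u v : Site P j) :
    ∑ y : Site P j, ∑ y' : Site P j, ∑ μ : Fin P.d, κ * G w c μ2 y y' * (c ^ 2 * Bk w c m2 ⟨y, μ⟩ ⟨y', μ⟩ v u) =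
      ∑ y : Site P j, ∑ y' : Site P j, ∑ μ : Fin P.d, κ * G w c μ2 y y' * (c ^ 2 * Bk w c m2 ⟨y, μ⟩ ⟨y', μ⟩ u v) := by
  rw [Finset.sum_comm]
  refine Finset.sum_congr rfl fun y _ => Finset.sum_congr rfl fun y' _ => Finset.sum_congr rfl fun μ _ => ?_
  linear_combination (κ * c ^ 2) * Bk_swap w c m2 μ2 μ y y' u v

/-- **THE THREE COMPANION ATTACHMENTS OF THE CUBIC PAIR.** The lattice vertex (1.8)_{1,0} `−eη^d⟪∂^ηφ(b),qφ(b₋)⟫A_b` carries ONE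
differentiated field; contracting two of them with the external legs `x ↦ u`, `x′ ↦ v` gives four attachment patterns. The
print's ④ is the pattern with both external legs on the undifferentiated `φ(b₋)`, `φ(b′₋)` and both derivatives on the internal
line (`−C₀(y,u)C₀(y′,v)·(∂^ε_μC₀∂^{ε*}_μ)(y,y′)`, r15's `dKernel`); `att` is the sum of the other three, in r15's `d1Kernel =
(∂^ε_μC₀)(y,u) = c(C₀(y+εe_μ,u) − C₀(y,u))` vocabulary: both legs differentiated and the internal line plain, or one leg
differentiated and the internal line differentiated once at the other vertex (`c(C₀(y,y′+εe_μ) − C₀(y,y′)) = (C₀∂^{ε*}_μ)(y,y′)`):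
`att_μ(y,y′;u,v) = −(∂_μC₀)(y,u)(∂_μC₀)(y′,v)C₀(y,y′) + (∂_μC₀)(y,u)C₀(y′,v)(C₀∂*_μ)(y,y′) + C₀(y,u)(∂_μC₀)(y′,v)(∂_μC₀)(y,y′)`.
[cite: Balaban1983Higgs3, (1.8) p.413, (1.22) term ④ p.416] -/
def att (μ : Fin P.d) (y y' u v : Site P j) : ℝ :=
  -(d1Kernel c μ (G w c m2) y u * d1Kernel c μ (G w c m2) y' v * G w c m2 y y')
    + d1Kernel c μ (G w c m2) y u * G w c m2 y' v * (c * (G w c m2 y (y'.shift μ) - G w c m2 y y'))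
    + G w c m2 y u * d1Kernel c μ (G w c m2) y' v * d1Kernel c μ (G w c m2) y y'

omit C η in
/-- **`c²·Bk` IN THE PRINT'S `∂^ε`-FORM**: `c²·Bk(⟨y,μ⟩,⟨y′,μ⟩;u,v) = att_μ(y,y′;u,v) − C₀(y,u)C₀(y′,v)·(∂^ε_μC₀∂^{ε*}_μ)(y,y′)` — the
last term is the print's ④ pattern with r15's `dKernel c μ C₀ = c²[C₀(y⁺,y′⁺) − C₀(y⁺,y′) − C₀(y,y′⁺) + C₀(y,y′)]` (a polynomial
identity in the eight propagator values). [cite: Balaban1983Higgs3, (1.22) term ④ p.416] -/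
theorem sq_mul_Bk_eq (μ : Fin P.d) (y y' u v : Site P j) :
    c ^ 2 * Bk w c m2 ⟨y, μ⟩ ⟨y', μ⟩ u v =
      att w c m2 μ y y' u v - G w c m2 y u * G w c m2 y' v * dKernel c μ (G w c m2) y y' := by
  simp only [Bk, att, d1Kernel, dKernel, PBond.tgt]
  ring

/-- **DICTIONARY: THE ORDER-e² TERM OF (1.19) IS `C₀·[② + ④]·C₀` PLUS THE LATTICE COMPANIONS.** At `η·c = 1` (`c = ε⁻¹`, the
difference quotients of B1 (1.4)), for p26's (1.22)-data `D` carrying these propagators and this charge (`D.C0 = C₀ =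
(−Δ^η+m²)⁻¹`, `D.C = C^ε = (−Δ^η+μ²)⁻¹` in the Feynman gauge, `D.e = e`, `D.q2 = (q²)_{ab} = ⟪e_a,q²e_b⟫`, `D.w = η^d`, `D.c = c`),
the order-e² Taylor term `(e²/2)·d²/de²|₀⟨φ_a(x)φ_b(x′)⟩_e` of the two-point function (1.19) (λ = δm² = 0) EQUALS
`Σ_{y,y′} η^{2d} C₀(x,y)·[sig2 D + sig4 D](y,y′)·C₀(y′,x′)` — p26's typed ② `e²dC^ε(0)q²δ^ε` (with `C^ε(0)` the diagonal value
`C^ε(y,y)`) and ④ `−e²Σ_μ q(∂^ε_μC^ε_0∂^{ε*}_μ)qC^ε` between two free propagators — PLUS `e²(q²)_{ab}` times two explicit lattice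
terms that the list (1.22) does not display: (i) the point-splitting of ②, `(η/2)Σ_{y,μ}η^dC^ε(y,y)[C₀(y,x)(∂^ε_μC₀)(y,x′) +
(∂^ε_μC₀)(y,x)C₀(y,x′)]` (the quartic vertex `½(ηeA_b)²⟪φ(b₋),q²φ(b₊)⟫` has its two fields at the two ends of the bond; one explicit
factor `η = ε`), and (ii) the three companion attachments `Σ_{y,y′,μ}η^{2d}C^ε(y,y′)·att_μ(y,y′;x,x′)` of the cubic pair (an external
leg on the differentiated field `∂^ηφ(b)`). Nothing is claimed here about the size of (i), (ii) or their fate in (1.23).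
[cite: Balaban1983Higgs3, (1.19)–(1.22) terms ②, ④ p.416] [cite: Balaban1982Higgs1, (1.4), (1.7)–(1.8) pp.604–605] -/
theorem secondOrder_eq_C0_sig24_C0 (hw : 0 < w) (hm : 0 < m2) (hμ : 0 < μ2) (hcη : c * η = 1) (e : ℝ) (a b : Fin N)
    (x x' : Site P j) (D : SEData P j) (he : D.e = e) (hq : D.q2 = ⟪𝐞 a, C.q (C.q (𝐞 b))⟫_ℝ)
    (hC0 : D.C0 = G w c m2) (hC : D.C = G w c μ2) (hwD : D.w = w) (hcD : D.c = c) :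
    e ^ 2 / 2 * iteratedDeriv 2 (fun s => twoPt C η w c m2 μ2 s a b x x') 0 =
      (∑ y : Site P j, ∑ y' : Site P j, w * w * (G w c m2 x y * (sig2 D y y' + sig4 D y y') * G w c m2 y' x'))
      + e ^ 2 * ⟪𝐞 a, C.q (C.q (𝐞 b))⟫_ℝ *
        (η / 2 * ∑ y : Site P j, ∑ μ : Fin P.d, w * G w c μ2 y y *
            (G w c m2 y x * d1Kernel c μ (G w c m2) y x' + d1Kernel c μ (G w c m2) y x * G w c m2 y x')
          + ∑ y : Site P j, ∑ y' : Site P j, ∑ μ : Fin P.d, w * w * G w c μ2 y y' * att w c m2 μ y y' x x') := by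
  -- (②): bonds as sites × directions; `c²η² = 1`; `C₀(y⁺,·) = C₀(y,·) + η·(∂_μC₀)(y,·)`
  have hX1 : (∑ l : PBond P j, w * (c ^ 2 * η ^ 2) * G w c μ2 l.src l.src *
        (G w c m2 l.src x * G w c m2 l.tgt x' + G w c m2 l.tgt x * G w c m2 l.src x')) =
      (P.d : ℝ) * (2 * ∑ y : Site P j, w * G w c μ2 y y * (G w c m2 y x * G w c m2 y x'))
        + η * ∑ y : Site P j, ∑ μ : Fin P.d, w * G w c μ2 y y *
            (G w c m2 y x * d1Kernel c μ (G w c m2) y x' + d1Kernel c μ (G w c m2) y x * G w c m2 y x') := by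
    rw [sum_bond]
    trans ∑ y : Site P j, ((∑ _μ : Fin P.d, 2 * (w * G w c μ2 y y * (G w c m2 y x * G w c m2 y x')))
      + ∑ μ : Fin P.d, η * (w * G w c μ2 y y *
          (G w c m2 y x * d1Kernel c μ (G w c m2) y x' + d1Kernel c μ (G w c m2) y x * G w c m2 y x')))
    · refine Finset.sum_congr rfl fun y _ => ?_
      rw [← Finset.sum_add_distrib]
      refine Finset.sum_congr rfl fun μ _ => ?_
      simp only [PBond.tgt, d1Kernel]
      linear_combination (w * G w c μ2 y y * ((G w c m2 y x * G w c m2 (y.shift μ) x'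
        + G w c m2 (y.shift μ) x * G w c m2 y x') * (c * η) + 2 * (G w c m2 y x * G w c m2 y x'))) * hcη
    · rw [Finset.sum_add_distrib]
      simp only [Finset.sum_const, Finset.card_univ, Fintype.card_fin, nsmul_eq_mul, Finset.mul_sum]
  -- (④): `(η^dc²η)² = η^{2d}c²`; `δ_{μμ′}`; the legs-exchanged half equals the direct half; `c²Bk = att − C₀C₀·dKernel`
  have hX2 : (∑ l : PBond P j, ∑ l' : PBond P j, (w * (c ^ 2 * η)) * (w * (c ^ 2 * η)) *
        (G w c μ2 l.src l'.src * if l.dir = l'.dir then 1 else 0) * (Bk w c m2 l l' x x' + Bk w c m2 l l' x' x)) =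
      2 * (∑ y : Site P j, ∑ y' : Site P j, ∑ μ : Fin P.d, w * w * G w c μ2 y y' * att w c m2 μ y y' x x')
        - 2 * (∑ y : Site P j, ∑ y' : Site P j, ∑ μ : Fin P.d, w * w * G w c μ2 y y' *
            (G w c m2 y x * G w c m2 y' x' * dKernel c μ (G w c m2) y y')) := by
    have hκ : (w * (c ^ 2 * η)) * (w * (c ^ 2 * η)) = w * w * c ^ 2 := by
      linear_combination (w * w * c ^ 2 * (c * η + 1)) * hcη
    calc _ = ∑ l : PBond P j, ∑ l' : PBond P j, (if l.dir = l'.dir then (1 : ℝ) else 0) *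
          (w * w * G w c μ2 l.src l'.src * (c ^ 2 * Bk w c m2 l l' x x')
            + w * w * G w c μ2 l.src l'.src * (c ^ 2 * Bk w c m2 l l' x' x)) := by
            refine Finset.sum_congr rfl fun l _ => Finset.sum_congr rfl fun l' _ => ?_
            rw [hκ]; ring
      _ = ∑ y : Site P j, ∑ y' : Site P j, ∑ μ : Fin P.d,
            (w * w * G w c μ2 y y' * (c ^ 2 * Bk w c m2 ⟨y, μ⟩ ⟨y', μ⟩ x x')
              + w * w * G w c μ2 y y' * (c ^ 2 * Bk w c m2 ⟨y, μ⟩ ⟨y', μ⟩ x' x)) := by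
            rw [sum_bond_bond_dir]
      _ = (∑ y : Site P j, ∑ y' : Site P j, ∑ μ : Fin P.d, w * w * G w c μ2 y y' * (c ^ 2 * Bk w c m2 ⟨y, μ⟩ ⟨y', μ⟩ x x'))
            + ∑ y : Site P j, ∑ y' : Site P j, ∑ μ : Fin P.d,
                w * w * G w c μ2 y y' * (c ^ 2 * Bk w c m2 ⟨y, μ⟩ ⟨y', μ⟩ x' x) := by
            simp only [Finset.sum_add_distrib]
      _ = 2 * ∑ y : Site P j, ∑ y' : Site P j, ∑ μ : Fin P.d,
            w * w * G w c μ2 y y' * (c ^ 2 * Bk w c m2 ⟨y, μ⟩ ⟨y', μ⟩ x x') := by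
            rw [sum_Bk_swap w c m2 μ2 (w * w) x x', ← two_mul]
      _ = _ := by
            simp only [sq_mul_Bk_eq, mul_sub, Finset.sum_sub_distrib]
  -- p26's ② between two propagators: `δ^ε` collapses `y′ = y`, `η^{2d}·η^{−d} = η^d`
  have hP2 : (∑ y : Site P j, ∑ y' : Site P j, w * w * (G w c m2 x y * sig2 D y y' * G w c m2 y' x')) =
      e ^ 2 * ⟪𝐞 a, C.q (C.q (𝐞 b))⟫_ℝ *
        ((P.d : ℝ) * ∑ y : Site P j, w * G w c μ2 y y * (G w c m2 y x * G w c m2 y x')) := by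
    have hw1 : w * w⁻¹ = 1 := mul_inv_cancel₀ hw.ne'
    have inner : ∀ y : Site P j, (∑ y' : Site P j, w * w * (G w c m2 x y * sig2 D y y' * G w c m2 y' x')) =
        e ^ 2 * ⟪𝐞 a, C.q (C.q (𝐞 b))⟫_ℝ * ((P.d : ℝ) * (w * G w c μ2 y y * (G w c m2 y x * G w c m2 y x'))) := by
      intro y
      have e1 : ∀ y' : Site P j, w * w * (G w c m2 x y * sig2 D y y' * G w c m2 y' x') =
          if y = y' then w * w * (G w c m2 x y * (e ^ 2 * (P.d : ℝ) * G w c μ2 y y * ⟪𝐞 a, C.q (C.q (𝐞 b))⟫_ℝ * w⁻¹) *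
            G w c m2 y' x') else 0 := by
        intro y'
        simp only [sig2, delta, hC, he, hq, hwD]
        split_ifs with h
        · rfl
        · ring
      rw [Finset.sum_congr rfl fun y' _ => e1 y', Finset.sum_ite_eq, if_pos (Finset.mem_univ y), G_symm w c m2 x y]
      linear_combination (e ^ 2 * (P.d : ℝ) * G w c μ2 y y * ⟪𝐞 a, C.q (C.q (𝐞 b))⟫_ℝ * G w c m2 y x *
        G w c m2 y x' * w) * hw1
    rw [Finset.sum_congr rfl fun y _ => inner y, ← Finset.mul_sum, ← Finset.mul_sum]
  -- p26's ④ between two propagators, the `Σ_μ` pulled outermost-in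
  have hP4 : (∑ y : Site P j, ∑ y' : Site P j, w * w * (G w c m2 x y * sig4 D y y' * G w c m2 y' x')) =
      -(e ^ 2 * ⟪𝐞 a, C.q (C.q (𝐞 b))⟫_ℝ *
        ∑ y : Site P j, ∑ y' : Site P j, ∑ μ : Fin P.d, w * w * G w c μ2 y y' *
          (G w c m2 y x * G w c m2 y' x' * dKernel c μ (G w c m2) y y')) := by
    simp only [sig4, hC0, hC, he, hq, hcD, Finset.mul_sum, Finset.sum_mul, ← Finset.sum_neg_distrib]
    refine Finset.sum_congr rfl fun y _ => Finset.sum_congr rfl fun y' _ => Finset.sum_congr rfl fun μ _ => ?_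
    rw [G_symm w c m2 x y]
    ring
  have hsplit : (∑ y : Site P j, ∑ y' : Site P j, w * w * (G w c m2 x y * (sig2 D y y' + sig4 D y y') * G w c m2 y' x')) =
      (∑ y : Site P j, ∑ y' : Site P j, w * w * (G w c m2 x y * sig2 D y y' * G w c m2 y' x'))
        + ∑ y : Site P j, ∑ y' : Site P j, w * w * (G w c m2 x y * sig4 D y y' * G w c m2 y' x') := by
    simp only [mul_add, add_mul, Finset.sum_add_distrib]
  rw [iteratedDeriv_two_twoPt_eq_wick C η w c m2 μ2 hw hm hμ a b x x', hX1, hX2, hsplit, hP2, hP4]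
  ring

end SecondOrder

/-! ## §8 Dictionary of the measure: `J_e(A,φ) = e^{−S^ε(A,φ)}` with r15's typed Feynman-gauge action (B1 (1.11)) at
`λ = δm² = E = 0` — the integrand of (1.19)/(1.20) in the Feynman gauge IS this file's joint weight -/

omit C η w c m2 in
/-- `|v|² = Σ_ν ⟪v,e_ν⟫²` in `ℝ^M`. [folklore] -/
private theorem norm_sq_eq_sum_inner {M : ℕ} (v : EuclideanSpace ℝ (Fin M)) :
    ‖v‖ ^ 2 = ∑ ν : Fin M, ⟪v, EuclideanSpace.basisFun (Fin M) ℝ ν⟫_ℝ ^ 2 := by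
  rw [← real_inner_self_eq_norm_sq, ← (EuclideanSpace.basisFun (Fin M) ℝ).sum_inner_mul_inner v v]
  refine Finset.sum_congr rfl fun ν _ => ?_
  rw [real_inner_comm v (EuclideanSpace.basisFun (Fin M) ℝ ν), sq]

omit C m2 in
/-- the vector-field Gaussian in components: `⟨A,(−Δ^η+μ²)A⟩` of the `d`-component site field `A` is r15's
`Σ_{x,μ,ν}η^d(∂^η_νA_μ)(x)² + Σ_bη^dμ²A_b²` of `feynmanHiggsAction` for the bond field `A_{⟨x,x+ηe_μ⟩} = A_μ(x)`.
[cite: Balaban1982Higgs1, (1.11) p.605] -/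
theorem quadForm_Cvec_eq (A : Cfg P j P.d) :
    quadForm (Cvec P.d) η w c μ2 (0 : VecField P j ℝ) A =
      (∑ x : Site P j, ∑ μ : Fin P.d, ∑ ν : Fin P.d, w * (pdiff c ν (fun z => toVec A ⟨z, μ⟩) x) ^ 2)
        + ∑ b : PBond P j, w * (μ2 * (toVec A b) ^ 2) := by
  have hU : ∀ v : EuclideanSpace ℝ (Fin P.d), (Cvec P.d).Urep η 0 v = v := fun v => by
    rw [HiggsLattice.ChargeData.Urep_apply, HiggsLattice.ChargeData.U_zero, one_apply_eq_self]
  -- per bond: `|c(A(b₊) − A(b₋))|² = Σ_ν (c(A_ν(b₊) − A_ν(b₋)))²`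
  have hb : ∀ b : PBond P j, ‖covDerivScalar c ((Cvec P.d).Urep η) (0 : VecField P j ℝ) A b‖ ^ 2 =
      ∑ ν : Fin P.d, (c * (toVec A ⟨b.tgt, ν⟩ - toVec A ⟨b.src, ν⟩)) ^ 2 := by
    intro b
    rw [covDerivScalar, Pi.zero_apply, hU, norm_smul, mul_pow, Real.norm_eq_abs, sq_abs, norm_sq_eq_sum_inner,
      Finset.mul_sum]
    refine Finset.sum_congr rfl fun ν _ => ?_
    rw [toVec_apply, toVec_apply, inner_sub_left]
    ring
  -- per site: `|A(x)|² = Σ_ν A_ν(x)²`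
  have hx : ∀ x : Site P j, ‖A x‖ ^ 2 = ∑ ν : Fin P.d, (toVec A ⟨x, ν⟩) ^ 2 := fun x => by
    rw [norm_sq_eq_sum_inner]
    exact Finset.sum_congr rfl fun ν _ => by rw [toVec_apply]
  unfold quadForm covLaplaceForm massForm
  have hL : (∑ b : PBond P j, w * ‖covDerivScalar c ((Cvec P.d).Urep η) (0 : VecField P j ℝ) A b‖ ^ 2) =
      ∑ x : Site P j, ∑ μ : Fin P.d, ∑ ν : Fin P.d, w * (pdiff c ν (fun z => toVec A ⟨z, μ⟩) x) ^ 2 := by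
    rw [sum_bond]
    refine Finset.sum_congr rfl fun x _ => ?_
    rw [Finset.sum_comm]
    refine Finset.sum_congr rfl fun μ _ => ?_
    rw [hb, Finset.mul_sum]
    refine Finset.sum_congr rfl fun ν _ => ?_
    simp only [pdiff, PBond.tgt, smul_eq_mul]
  have hM : μ2 * (∑ x : Site P j, w * ‖A x‖ ^ 2) = ∑ b : PBond P j, w * (μ2 * (toVec A b) ^ 2) := by
    rw [sum_bond, Finset.mul_sum]
    refine Finset.sum_congr rfl fun x _ => ?_
    rw [hx, Finset.mul_sum, Finset.mul_sum]
    exact Finset.sum_congr rfl fun ν _ => by ring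
  rw [hL, hM]

/-- **`J_e(A,φ) = exp(−S^ε(A,φ))`** with `S^ε` r15's typed Feynman-gauge action `LatticeFieldCalculus.feynmanHiggsAction` (B1
(1.11): `½⟨φ,(−Δ_A+m²)φ⟩ + Σε^d(½m²|φ|² + λ|φ|⁴) + ½⟨A,(−Δ+μ₀²)A⟩ + E`) at `λ = 0`, `E = 0`, no `δm²`, representation
`U = exp(qηeA)` of charge `e`, vector field `A_b = A_{μ_b}(b₋)`: the integrand of (1.19) with the action (1.20) in the Feynman
gauge. [cite: Balaban1983Higgs3, (1.19)–(1.20) p.416] [cite: Balaban1982Higgs1, (1.11) p.605] -/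
theorem J_eq_exp_neg_feynmanHiggsAction (e : ℝ) (p : JCfg P j N) :
    J C η w c m2 μ2 e p = Real.exp (-(feynmanHiggsAction w c ((Ce C e).Urep η) m2 0 μ2 0 (toVec p.1) p.2)) := by
  have hA := quadForm_Cvec_eq η w c μ2 p.1
  have hφ : (∑ x : Site P j, w * ((1 / 2) * m2 * ‖p.2 x‖ ^ 2 + 0 * ‖p.2 x‖ ^ 4)) = (1 / 2) * (m2 * massForm w p.2) := by
    simp only [massForm, zero_mul, add_zero, Finset.mul_sum]
    exact Finset.sum_congr rfl fun x _ => by ring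
  rw [J, WA, weight, weight, ← Real.exp_add, feynmanHiggsAction, hφ]
  congr 1
  rw [quadForm] at hA ⊢
  rw [quadForm]
  linear_combination (-(1 / 2) : ℝ) * hA



/-! ## §9 The STRUCTURE (1.21) at order e²: `C₀[Σ + Σ_μ(∂^{ε*}_μΣ₁,μ + Σ₁,μ^*∂^ε_μ + ∂^{ε*}_μΣ₂∂^ε_μ)]C₀` with DERIVED kernels
`Σ = ② + ④`, `Σ₁,μ`, `Σ₂` — the companions (i), (ii) of §7 regrouped by where the external `∂^ε` sits -/

section Structure121

open B3Eq123Counterterms B3Sect3ScalarSelfEnergy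

/-- the standard orthonormal basis vector `e_a` of `R^N` (notation local to this file). [folklore] -/
local notation "𝐞" => EuclideanSpace.basisFun (Fin N) ℝ

/-- **THE DERIVED `Σ₁,μ` AT ORDER e²** (the kernel met between `C₀∂^{ε*}_μ` on the left and `C₀` on the right, and — transposed —
between `C₀` and `∂^ε_μC₀`): a LOCAL part `(η/2)e²q²C^ε(y,y)δ^ε(y−y′)` (the tadpole of the vertex (1.8)_{2,0}, p26's `delta w =
η^{−d}𝟙`) plus `e²q²·(C₀∂^{ε*}_μ)(y,y′)·C^ε(y,y′)` (the cubic pair with the internal scalar line differentiated once, at its `y′` end: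
`c(C₀(y,y′+ηe_μ) − C₀(y,y′))`). The paper does not display `Σ₁^ε`; this is what the Feynman rules of (1.20) give at order `e²`.
[cite: Balaban1983Higgs3, (1.21) p.416] -/
def sgOne (e q2 : ℝ) (μ : Fin P.d) : Kernel P j := fun y y' =>
  e ^ 2 * q2 * (η / 2 * G w c μ2 y y * delta w y y' + c * (G w c m2 y (y'.shift μ) - G w c m2 y y') * G w c μ2 y y')

/-- **THE DERIVED `Σ₂` AT ORDER e²** (the kernel met between `C₀∂^{ε*}_μ` and `∂^ε_μC₀`, the same for every `μ`):
`−e²q²·C₀(y,y′)·C^ε(y,y′)` (the cubic pair with both external legs on the differentiated fields and the internal scalar line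
plain). The paper does not display `Σ₂^ε`; this is what the Feynman rules of (1.20) give at order `e²`. [cite: Balaban1983Higgs3, (1.21) p.416] -/
def sgTwo (e q2 : ℝ) : Kernel P j := fun y y' => -(e ^ 2 * q2 * (G w c m2 y y' * G w c μ2 y y'))

/-- **THE ORDER-e² TERM OF (1.19) HAS THE STRUCTURE OF THE `n = 1` TERM OF (1.21).** With `C₀ = C^η_{m²}`, `(∂^ε_μC₀)(y,x) =
d1Kernel c μ C₀ y x` (r15's kernel of `∂^η_μ∘C₀`, `B3Sect3ScalarSelfEnergy.kernelOp_d1Kernel`; by the symmetry of `C₀` also the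
kernel `(x,y) ↦ (C₀∂^{η*}_μ)(x,y)` of `C₀∘∂^{η*}_μ`, summation by parts `LatticeFieldCalculus.sum_pdiff_mul`), p26's typed `Σ = sig2 D +
sig4 D` (② + ④) and the derived `Σ₁,μ = sgOne`, `Σ₂ = sgTwo` above:
`(e²/2)·d²/de²|₀G_{ab}(x,x′) = Σ_{y,y′}η^{2d}C₀(x,y)Σ(y,y′)C₀(y′,x′) + Σ_{y,y′}Σ_μ η^{2d}[(∂_μC₀)(y,x)·Σ₁,μ(y,y′)·C₀(y′,x′) +
C₀(x,y)·Σ₁,μ(y′,y)·(∂_μC₀)(y′,x′) + (∂_μC₀)(y,x)·Σ₂(y,y′)·(∂_μC₀)(y′,x′)]` — the kernels of `C₀ΣC₀`, `C₀∂^{ε*}_μΣ₁,μC₀`,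
`C₀Σ₁,μ^*∂^ε_μC₀`, `C₀∂^{ε*}_μΣ₂∂^ε_μC₀` summed over `μ`: the bracket `(−δm² + Σ^ε + ∂^{ε*}Σ₁^ε + Σ₁^{ε*}∂^ε + ∂^{ε*}Σ₂^ε∂^ε)` of (1.21)
at order `e²λ⁰` (`δm²`-free), between two free propagators, DERIVED from (1.19)/(1.20) (at `cη = 1`, Feynman gauge, hypotheses of
`secondOrder_eq_C0_sig24_C0`). No claim that these `Σ₁,μ`, `Σ₂` are one-particle irreducible to all orders or that the paper
groups them this way; at this order each is a single connected graph with two amputated legs. [cite: Balaban1983Higgs3, (1.21)–(1.22) p.416] -/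
theorem secondOrder_eq_structure121 (hw : 0 < w) (hm : 0 < m2) (hμ : 0 < μ2) (hcη : c * η = 1) (e : ℝ) (a b : Fin N)
    (D : SEData P j) (he : D.e = e) (hq : D.q2 = ⟪𝐞 a, C.q (C.q (𝐞 b))⟫_ℝ)
    (hC0 : D.C0 = G w c m2) (hC : D.C = G w c μ2) (hwD : D.w = w) (hcD : D.c = c) (x x' : Site P j) :
    e ^ 2 / 2 * iteratedDeriv 2 (fun s => twoPt C η w c m2 μ2 s a b x x') 0 =
      (∑ y : Site P j, ∑ y' : Site P j, w * w * (G w c m2 x y * (sig2 D y y' + sig4 D y y') * G w c m2 y' x'))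
      + ∑ y : Site P j, ∑ y' : Site P j, ∑ μ : Fin P.d, w * w *
          (d1Kernel c μ (G w c m2) y x * sgOne η w c m2 μ2 e ⟪𝐞 a, C.q (C.q (𝐞 b))⟫_ℝ μ y y' * G w c m2 y' x'
            + G w c m2 x y * sgOne η w c m2 μ2 e ⟪𝐞 a, C.q (C.q (𝐞 b))⟫_ℝ μ y' y * d1Kernel c μ (G w c m2) y' x'
            + d1Kernel c μ (G w c m2) y x * sgTwo w c m2 μ2 e ⟪𝐞 a, C.q (C.q (𝐞 b))⟫_ℝ y y' *
                d1Kernel c μ (G w c m2) y' x') := by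
  rw [secondOrder_eq_C0_sig24_C0 C η w c m2 μ2 hw hm hμ hcη e a b x x' D he hq hC0 hC hwD hcD]
  congr 1
  set Q : ℝ := ⟪𝐞 a, C.q (C.q (𝐞 b))⟫_ℝ with hQ
  have hw1 : w * w⁻¹ = 1 := mul_inv_cancel₀ hw.ne'
  -- split every summand into its local (`δ^ε`) part and its non-local part
  have hS : ∀ (y y' : Site P j) (μ : Fin P.d), w * w *
      (d1Kernel c μ (G w c m2) y x * sgOne η w c m2 μ2 e Q μ y y' * G w c m2 y' x'
        + G w c m2 x y * sgOne η w c m2 μ2 e Q μ y' y * d1Kernel c μ (G w c m2) y' x'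
        + d1Kernel c μ (G w c m2) y x * sgTwo w c m2 μ2 e Q y y' * d1Kernel c μ (G w c m2) y' x') =
      (w * w * (d1Kernel c μ (G w c m2) y x * (e ^ 2 * Q * (η / 2 * G w c μ2 y y * delta w y y')) * G w c m2 y' x')
        + w * w * (G w c m2 x y * (e ^ 2 * Q * (η / 2 * G w c μ2 y' y' * delta w y' y)) * d1Kernel c μ (G w c m2) y' x'))
      + w * w * (d1Kernel c μ (G w c m2) y x * (e ^ 2 * Q * (c * (G w c m2 y (y'.shift μ) - G w c m2 y y') * G w c μ2 y y')) *
            G w c m2 y' x'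
          + G w c m2 x y * (e ^ 2 * Q * (c * (G w c m2 y' (y.shift μ) - G w c m2 y' y) * G w c μ2 y' y)) *
            d1Kernel c μ (G w c m2) y' x'
          + d1Kernel c μ (G w c m2) y x * (-(e ^ 2 * Q * (G w c m2 y y' * G w c μ2 y y'))) * d1Kernel c μ (G w c m2) y' x') := by
    intro y y' μ
    simp only [sgOne, sgTwo]
    ring
  -- the local part: `δ^ε` collapses `y′ = y`; the two orderings of the tadpole of (1.8)_{2,0}
  have hloc1 : (∑ y : Site P j, ∑ y' : Site P j, ∑ μ : Fin P.d,
      w * w * (d1Kernel c μ (G w c m2) y x * (e ^ 2 * Q * (η / 2 * G w c μ2 y y * delta w y y')) * G w c m2 y' x')) =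
      e ^ 2 * Q * (η / 2) * ∑ y : Site P j, ∑ μ : Fin P.d, w * G w c μ2 y y * (d1Kernel c μ (G w c m2) y x * G w c m2 y x') := by
    trans ∑ y : Site P j, ∑ μ : Fin P.d, e ^ 2 * Q * (η / 2) * (w * G w c μ2 y y * (d1Kernel c μ (G w c m2) y x * G w c m2 y x'))
    · refine Finset.sum_congr rfl fun y _ => ?_
      have e1 : ∀ y' : Site P j, (∑ μ : Fin P.d,
          w * w * (d1Kernel c μ (G w c m2) y x * (e ^ 2 * Q * (η / 2 * G w c μ2 y y * delta w y y')) * G w c m2 y' x')) =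
          if y = y' then ∑ μ : Fin P.d,
            w * w * (d1Kernel c μ (G w c m2) y x * (e ^ 2 * Q * (η / 2 * G w c μ2 y y * w⁻¹)) * G w c m2 y' x') else 0 := by
        intro y'
        split_ifs with h
        · exact Finset.sum_congr rfl fun μ _ => by simp only [delta, if_pos h]
        · exact Finset.sum_eq_zero fun μ _ => by simp only [delta, if_neg h, mul_zero, zero_mul]
      rw [Finset.sum_congr rfl fun y' _ => e1 y', Finset.sum_ite_eq, if_pos (Finset.mem_univ y)]
      refine Finset.sum_congr rfl fun μ _ => ?_
      linear_combination (e ^ 2 * Q * (η / 2) * G w c μ2 y y * w * (d1Kernel c μ (G w c m2) y x * G w c m2 y x')) * hw1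
    · simp only [Finset.mul_sum]
  have hloc2 : (∑ y : Site P j, ∑ y' : Site P j, ∑ μ : Fin P.d,
      w * w * (G w c m2 x y * (e ^ 2 * Q * (η / 2 * G w c μ2 y' y' * delta w y' y)) * d1Kernel c μ (G w c m2) y' x')) =
      e ^ 2 * Q * (η / 2) * ∑ y : Site P j, ∑ μ : Fin P.d, w * G w c μ2 y y * (G w c m2 y x * d1Kernel c μ (G w c m2) y x') := by
    trans ∑ y : Site P j, ∑ μ : Fin P.d, e ^ 2 * Q * (η / 2) * (w * G w c μ2 y y * (G w c m2 y x * d1Kernel c μ (G w c m2) y x'))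
    · refine Finset.sum_congr rfl fun y _ => ?_
      have e2 : ∀ y' : Site P j, (∑ μ : Fin P.d,
          w * w * (G w c m2 x y * (e ^ 2 * Q * (η / 2 * G w c μ2 y' y' * delta w y' y)) * d1Kernel c μ (G w c m2) y' x')) =
          if y' = y then ∑ μ : Fin P.d,
            w * w * (G w c m2 x y * (e ^ 2 * Q * (η / 2 * G w c μ2 y' y' * w⁻¹)) * d1Kernel c μ (G w c m2) y' x') else 0 := by
        intro y'
        split_ifs with h
        · exact Finset.sum_congr rfl fun μ _ => by simp only [delta, if_pos h]
        · exact Finset.sum_eq_zero fun μ _ => by simp only [delta, if_neg h, mul_zero, zero_mul]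
      rw [Finset.sum_congr rfl fun y' _ => e2 y', Finset.sum_ite_eq', if_pos (Finset.mem_univ y), G_symm w c m2 x y]
      refine Finset.sum_congr rfl fun μ _ => ?_
      linear_combination (e ^ 2 * Q * (η / 2) * G w c μ2 y y * w * (G w c m2 y x * d1Kernel c μ (G w c m2) y x')) * hw1
    · simp only [Finset.mul_sum]
  have hR1 : (∑ y : Site P j, ∑ μ : Fin P.d, w * G w c μ2 y y *
      (G w c m2 y x * d1Kernel c μ (G w c m2) y x' + d1Kernel c μ (G w c m2) y x * G w c m2 y x')) =
      (∑ y : Site P j, ∑ μ : Fin P.d, w * G w c μ2 y y * (G w c m2 y x * d1Kernel c μ (G w c m2) y x'))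
        + ∑ y : Site P j, ∑ μ : Fin P.d, w * G w c μ2 y y * (d1Kernel c μ (G w c m2) y x * G w c m2 y x') := by
    simp only [mul_add, Finset.sum_add_distrib]
  -- the non-local part is `e²(q²)_{ab}·Σ C^ε·att` termwise (symmetry of the kernels in the middle term)
  have hnl : (∑ y : Site P j, ∑ y' : Site P j, ∑ μ : Fin P.d,
      (w * w * (d1Kernel c μ (G w c m2) y x * (e ^ 2 * Q * (c * (G w c m2 y (y'.shift μ) - G w c m2 y y') * G w c μ2 y y')) *
            G w c m2 y' x'
          + G w c m2 x y * (e ^ 2 * Q * (c * (G w c m2 y' (y.shift μ) - G w c m2 y' y) * G w c μ2 y' y)) *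
            d1Kernel c μ (G w c m2) y' x'
          + d1Kernel c μ (G w c m2) y x * (-(e ^ 2 * Q * (G w c m2 y y' * G w c μ2 y y'))) * d1Kernel c μ (G w c m2) y' x'))) =
      e ^ 2 * Q * ∑ y : Site P j, ∑ y' : Site P j, ∑ μ : Fin P.d, w * w * G w c μ2 y y' * att w c m2 μ y y' x x' := by
    rw [Finset.mul_sum]
    refine Finset.sum_congr rfl fun y _ => ?_
    rw [Finset.mul_sum]
    refine Finset.sum_congr rfl fun y' _ => ?_
    rw [Finset.mul_sum]
    refine Finset.sum_congr rfl fun μ _ => ?_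
    simp only [att, d1Kernel]
    rw [G_symm w c m2 x y, G_symm w c m2 y' (y.shift μ), G_symm w c m2 y' y, G_symm w c μ2 y' y]
    ring
  simp only [hS, Finset.sum_add_distrib]
  rw [hloc1, hloc2, hnl, hR1]
  ring

/-! ### (1.21) at order e² AS OPERATORS: `C₀[Σ + Σ_μ(∂^{η*}_μΣ₁,μ + Σ₁,μ^*∂^η_μ + ∂^{η*}_μΣ₂∂^η_μ)]C₀` in r15's `kernelOp` /
`pdiff` / `pdiffAdj` vocabulary -/

omit C η m2 in
/-- linearity of r15's integral operator `kernelOp` in the function. [cite: Balaban1983Higgs3, (3.9) p.435] -/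
private theorem kernelOp_add_right (K : Kernel P j) (f g : SiteField P j ℝ) :
    kernelOp w K (f + g) = kernelOp w K f + kernelOp w K g := by
  funext x
  simp only [kernelOp, Pi.add_apply, mul_add, Finset.sum_add_distrib]

omit C η m2 in
/-- `kernelOp` of a finite sum of functions. [cite: Balaban1983Higgs3, (3.9) p.435] -/
private theorem kernelOp_sum_right (K : Kernel P j) (g : Fin P.d → SiteField P j ℝ) :
    kernelOp w K (∑ μ : Fin P.d, g μ) = ∑ μ : Fin P.d, kernelOp w K (g μ) := by
  funext x
  simp only [kernelOp, Finset.sum_apply, Finset.mul_sum]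
  rw [Finset.sum_comm]

omit C η m2 in
/-- the kernel of a triple composition `A∘B∘K` with the volume element: `Σ_{x′}η^d[Σ_{y,y′}η^{2d}A(x,y)B(y,y′)K(y′,x′)]f(x′)`.
[cite: Balaban1983Higgs3, (3.9) p.435] -/
private theorem kernelOp_comp₃ (A B K : Kernel P j) (f : SiteField P j ℝ) (x : Site P j) :
    kernelOp w A (kernelOp w B (kernelOp w K f)) x =
      ∑ x' : Site P j, w * (∑ y : Site P j, ∑ y' : Site P j, w * w * (A x y * B y y' * K y' x')) * f x' := by
  calc kernelOp w A (kernelOp w B (kernelOp w K f)) x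
      = ∑ y : Site P j, ∑ y' : Site P j, ∑ x' : Site P j, w * A x y * (w * B y y' * (w * K y' x' * f x')) := by
        simp only [kernelOp, Finset.mul_sum]
    _ = ∑ y : Site P j, ∑ x' : Site P j, ∑ y' : Site P j, w * A x y * (w * B y y' * (w * K y' x' * f x')) :=
        Finset.sum_congr rfl fun _ _ => Finset.sum_comm
    _ = ∑ x' : Site P j, ∑ y : Site P j, ∑ y' : Site P j, w * A x y * (w * B y y' * (w * K y' x' * f x')) := Finset.sum_comm
    _ = _ := by
        refine Finset.sum_congr rfl fun x' _ => ?_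
        rw [Finset.mul_sum, Finset.sum_mul]
        refine Finset.sum_congr rfl fun y _ => ?_
        rw [Finset.mul_sum, Finset.sum_mul]
        exact Finset.sum_congr rfl fun y' _ => by ring

omit C η w c m2 in
/-- moving a direction sum from outermost to innermost past three site sums. [folklore] -/
private theorem sum4_comm (F : Fin P.d → Site P j → Site P j → Site P j → ℝ) :
    ∑ μ : Fin P.d, ∑ x' : Site P j, ∑ y : Site P j, ∑ y' : Site P j, F μ x' y y' =
      ∑ x' : Site P j, ∑ y : Site P j, ∑ y' : Site P j, ∑ μ : Fin P.d, F μ x' y y' :=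
  calc ∑ μ : Fin P.d, ∑ x' : Site P j, ∑ y : Site P j, ∑ y' : Site P j, F μ x' y y'
      = ∑ x' : Site P j, ∑ μ : Fin P.d, ∑ y : Site P j, ∑ y' : Site P j, F μ x' y y' := Finset.sum_comm
    _ = ∑ x' : Site P j, ∑ y : Site P j, ∑ μ : Fin P.d, ∑ y' : Site P j, F μ x' y y' :=
        Finset.sum_congr rfl fun _ _ => Finset.sum_comm
    _ = ∑ x' : Site P j, ∑ y : Site P j, ∑ y' : Site P j, ∑ μ : Fin P.d, F μ x' y y' :=
        Finset.sum_congr rfl fun _ _ => Finset.sum_congr rfl fun _ _ => Finset.sum_comm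

omit C η in
/-- summation by parts against the symmetric `C₀`: `Σ_yη^dC₀(x,y)(∂^{η*}_μg)(y) = Σ_yη^d(∂^η_μC₀)(y,x)g(y)` — the kernel of `C₀∘∂^{η*}_μ`
is `(x,y) ↦ d1Kernel c μ C₀ y x`. [cite: Balaban1984PropagatorsI, (1.21) p.21] -/
theorem sum_G_mul_pdiffAdj (μ : Fin P.d) (g : SiteField P j ℝ) (x : Site P j) :
    ∑ y : Site P j, w * G w c m2 x y * pdiffAdj c μ g y = ∑ y : Site P j, w * d1Kernel c μ (G w c m2) y x * g y := by
  have h := sum_pdiff_mul (P := P) (j := j) c μ (fun z => G w c m2 x z) g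
  have h' : ∀ y : Site P j, pdiff c μ (fun z => G w c m2 x z) y = d1Kernel c μ (G w c m2) y x := fun y => by
    simp only [pdiff, d1Kernel, smul_eq_mul]
    rw [G_symm w c m2 x (y.shift μ), G_symm w c m2 x y]
  simp only [h'] at h
  simp only [mul_assoc, ← Finset.mul_sum]
  rw [h]

/-- **(1.21) AT ORDER e², AS OPERATORS.** With r15's integral operator `kernelOp η^d K` ((3.9): `(Kf)(x) = Σ_{x′}η^dK(x,x′)f(x′)`),
forward/backward differences `pdiff c μ = ∂^η_μ`, `pdiffAdj c μ = ∂^{η*}_μ`, the free propagator `C₀`, p26's `Σ = sig2 D + sig4 D` and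
the derived `Σ₁,μ = sgOne`, `Σ₂ = sgTwo`: the integral operator of the order-e² kernel `(e²/2)·d²/de²|₀G_{ab}(x,x′)` of (1.19) IS
`C₀[Σ + Σ_μ(∂^{η*}_μΣ₁,μ + Σ₁,μ^*∂^η_μ + ∂^{η*}_μΣ₂∂^η_μ)]C₀` applied to `f` (`Σ₁,μ^*` = the transposed kernel) — the `n = 1` term
`C₀^ε[(−δm² + Σ^ε + ∂^{ε*}Σ₁^ε + Σ₁^{ε*}∂^ε + ∂^{ε*}Σ₂^ε∂^ε)C₀^ε]` of (1.21) at order `e²λ⁰(δm²)⁰`, DERIVED from (1.19)/(1.20) (at `cη =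
1`, Feynman gauge; `∂^{ε*}Σ₁^ε` read as `Σ_μ∂^{ε*}_μΣ^ε_{1,μ}` etc.). [cite: Balaban1983Higgs3, (1.21) p.416] -/
theorem secondOrder_structure121_op (hw : 0 < w) (hm : 0 < m2) (hμ : 0 < μ2) (hcη : c * η = 1) (e : ℝ) (a b : Fin N)
    (D : SEData P j) (he : D.e = e) (hq : D.q2 = ⟪𝐞 a, C.q (C.q (𝐞 b))⟫_ℝ)
    (hC0 : D.C0 = G w c m2) (hC : D.C = G w c μ2) (hwD : D.w = w) (hcD : D.c = c) (f : SiteField P j ℝ) :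
    kernelOp w (fun x x' => e ^ 2 / 2 * iteratedDeriv 2 (fun s => twoPt C η w c m2 μ2 s a b x x') 0) f =
      kernelOp w (G w c m2)
        (kernelOp w (sig2 D + sig4 D) (kernelOp w (G w c m2) f)
          + ∑ μ : Fin P.d,
            (pdiffAdj c μ (kernelOp w (sgOne η w c m2 μ2 e ⟪𝐞 a, C.q (C.q (𝐞 b))⟫_ℝ μ) (kernelOp w (G w c m2) f))
              + kernelOp w (fun y y' => sgOne η w c m2 μ2 e ⟪𝐞 a, C.q (C.q (𝐞 b))⟫_ℝ μ y' y)
                  (pdiff c μ (kernelOp w (G w c m2) f))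
              + pdiffAdj c μ (kernelOp w (sgTwo w c m2 μ2 e ⟪𝐞 a, C.q (C.q (𝐞 b))⟫_ℝ)
                  (pdiff c μ (kernelOp w (G w c m2) f))))) := by
  set Q : ℝ := ⟪𝐞 a, C.q (C.q (𝐞 b))⟫_ℝ with hQ
  have hK := secondOrder_eq_structure121 C η w c m2 μ2 hw hm hμ hcη e a b D he hq hC0 hC hwD hcD
  funext x
  -- the four operator terms as kernels `Σ_{x′} η^d T(x,x′) f(x′)`
  have hR0 : kernelOp w (G w c m2) (kernelOp w (sig2 D + sig4 D) (kernelOp w (G w c m2) f)) x =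
      ∑ x' : Site P j, w * (∑ y : Site P j, ∑ y' : Site P j,
        w * w * (G w c m2 x y * (sig2 D y y' + sig4 D y y') * G w c m2 y' x')) * f x' := by
    rw [kernelOp_comp₃]
    rfl
  have hR1 : ∀ μ : Fin P.d, kernelOp w (G w c m2) (pdiffAdj c μ (kernelOp w (sgOne η w c m2 μ2 e Q μ)
      (kernelOp w (G w c m2) f))) x =
      ∑ x' : Site P j, w * (∑ y : Site P j, ∑ y' : Site P j,
        w * w * (d1Kernel c μ (G w c m2) y x * sgOne η w c m2 μ2 e Q μ y y' * G w c m2 y' x')) * f x' := by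
    intro μ
    rw [← kernelOp_comp₃ w (fun u v => d1Kernel c μ (G w c m2) v u)]
    exact sum_G_mul_pdiffAdj w c m2 μ _ x
  have hR2 : ∀ μ : Fin P.d, kernelOp w (G w c m2) (kernelOp w (fun y y' => sgOne η w c m2 μ2 e Q μ y' y)
      (pdiff c μ (kernelOp w (G w c m2) f))) x =
      ∑ x' : Site P j, w * (∑ y : Site P j, ∑ y' : Site P j,
        w * w * (G w c m2 x y * sgOne η w c m2 μ2 e Q μ y' y * d1Kernel c μ (G w c m2) y' x')) * f x' := by
    intro μ
    rw [← kernelOp_d1Kernel, kernelOp_comp₃]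
  have hR3 : ∀ μ : Fin P.d, kernelOp w (G w c m2) (pdiffAdj c μ (kernelOp w (sgTwo w c m2 μ2 e Q)
      (pdiff c μ (kernelOp w (G w c m2) f)))) x =
      ∑ x' : Site P j, w * (∑ y : Site P j, ∑ y' : Site P j,
        w * w * (d1Kernel c μ (G w c m2) y x * sgTwo w c m2 μ2 e Q y y' * d1Kernel c μ (G w c m2) y' x')) * f x' := by
    intro μ
    rw [← kernelOp_d1Kernel, ← kernelOp_comp₃ w (fun u v => d1Kernel c μ (G w c m2) v u)]
    exact sum_G_mul_pdiffAdj w c m2 μ _ x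
  rw [kernelOp_add_right, kernelOp_sum_right]
  simp only [Pi.add_apply, Finset.sum_apply, kernelOp_add_right, hR0, hR1, hR2, hR3]
  -- the left-hand side: the kernel of §9, the `μ`-sum pulled outermost
  simp only [kernelOp, hK, mul_add, add_mul, Finset.sum_add_distrib, Finset.mul_sum, Finset.sum_mul]
  rw [← hQ]
  simp only [sum4_comm]

/-- **THE `n = 0` TERM AND THE VANISHING ORDER `e¹`**: `G_{0,ab}(x,x′) = C₀(x′,x)δ_{ab}` and `d/de|₀G_{ab} = 0` — with §10, the Taylor
polynomial of degree two of (1.19) in the charge at `e = 0` (λ = δm² = 0) is `C₀ + C₀[Σ + Σ_μ(∂^{η*}_μΣ₁,μ + Σ₁,μ^*∂^η_μ +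
∂^{η*}_μΣ₂∂^η_μ)]C₀∣_{e²}`, the series (1.21) through `n = 1` at this order. [cite: Balaban1983Higgs3, (1.19), (1.21) p.416] -/
theorem twoPt_zero (hw : 0 < w) (hm : 0 < m2) (hμ : 0 < μ2) (a b : Fin N) (x x' : Site P j) :
    twoPt C η w c m2 μ2 0 a b x x' = G w c m2 x' x * ⟪𝐞 a, 𝐞 b⟫_ℝ ∧ deriv (fun e => twoPt C η w c m2 μ2 e a b x x') 0 = 0 := by
  refine ⟨?_, (hasDerivAt_twoPt_zero C η w c m2 μ2 hw hm hμ a b x x').deriv⟩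
  have hZ0 : ∫ p : JCfg P j N, J C η w c m2 μ2 0 p =
      (∫ A : Cfg P j P.d, WA η w c μ2 A) * ∫ φ : Cfg P j N, weight C η w c m2 (0 : VecField P j ℝ) φ := by
    have h := integral_prod_WA_W0 (P := P) (j := j) C η w c m2 μ2 (fun _ : Cfg P j P.d => (1 : ℝ))
      (fun _ : Cfg P j N => (1 : ℝ))
    simp only [mul_one] at h
    rw [← h]
    exact integral_congr_ae (Filter.Eventually.of_forall fun p => by dsimp only; rw [J_zero])
  have hN0 : ∫ p : JCfg P j N, J C η w c m2 μ2 0 p * (⟪p.2 x, 𝐞 a⟫_ℝ * ⟪p.2 x', 𝐞 b⟫_ℝ) =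
      (∫ A : Cfg P j P.d, WA η w c μ2 A) *
        ((∫ φ : Cfg P j N, weight C η w c m2 (0 : VecField P j ℝ) φ) * (G w c m2 x' x * ⟪𝐞 a, 𝐞 b⟫_ℝ)) := by
    have h := integral_prod_WA_W0 C η w c m2 μ2 (fun _ => (1 : ℝ)) (fun φ => ⟪φ x, 𝐞 a⟫_ℝ * ⟪φ x', 𝐞 b⟫_ℝ)
    simp only [mul_one] at h
    rw [G_symm w c m2 x' x, ← moment2 C η w c m2 hw hm x x' (𝐞 a) (𝐞 b), ← h]
    exact integral_congr_ae (Filter.Eventually.of_forall fun p => by dsimp only; rw [J_zero]; ring)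
  have hZφ0 : (∫ φ : Cfg P j N, weight C η w c m2 (0 : VecField P j ℝ) φ) ≠ 0 := (B3WT226Traces.Z_pos C η w c m2 hw hm).ne'
  have hZA0 : (∫ A : Cfg P j P.d, WA η w c μ2 A) ≠ 0 := (ZA_pos η w c μ2 hw hμ).ne'
  rw [twoPt, hN0, hZ0]
  field_simp

end Structure121

end Joint

end Literature.MathematicalPhysics.QuantumFieldTheory.Balaban1983to89.B3Eq122ChargeWick

end
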